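import Summits.QuantumFields.YangMills.Theorems.BalabanUVNodesN24K1R9ByNameOfOpenStubsGridGChildrenSplitSlot8Thm1AEPosN09T5AtGaussPinPrintedZBY
import Summits.QuantumFields.YangMills.Theorems.BalabanUVNodesN24K1R9ByNameSlot8Thm1AEInstPerKappaPrimeGuarded
import Summits.QuantumFields.YangMills.Theorems.BalabanUVNodesN05SubBP2DK2PerKappaSlotExistsOfBindersLettersPerDoorL
import Literature.MathematicalPhysics.QuantumFieldTheory.Balaban1983to89.B9Thm33BindersUniformZdPerNestedEta
import Literature.MathematicalPhysics.QuantumFieldTheory.Balaban1983to89.Node00.Record12NumericsFamilyFiniteDim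
import Summits.QuantumFields.YangMills.Theorems.BalabanUVNodesN06AtOpsYNuOfRecordV6EPairVH
import Literature.MathematicalPhysics.QuantumFieldTheory.Balaban1983to89.B9SectionCarryingMembersV1
import Literature.MathematicalPhysics.QuantumFieldTheory.Balaban1983to89.Node00.CarriersZSectE
import Summits.QuantumFields.YangMills.Theorems.BalabanUVNodesN08AlphaEq324RowACReMassedZSlot
import Literature.MathematicalPhysics.QuantumFieldTheory.Balaban1983to89.Node00.Record12NumericsFamilyTraceState
import Summits.QuantumFields.YangMills.Theorems.BalabanUVNodesK0V22ZDefs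

/-!
# NODE N24 (B2) — THE K1 FACE AT V22-Z's Z3 MEMBER, EDITION «N09T5» (engine = ✓«N09T3» p726416 with the consumed door's label `ε₀ := a₀`, ym-nodeO DEF-1 g30 LOCATED-EPS0-LABEL, and the per-door display PINNED to that door by `hε₀ρ : ε₀ = a₀`), INSTANTIATION (α5) (the N06 pin over the SECTION-CARRYING = surjective-β sub-family of members, `ιB hι` CONSTRUCTED by dag-n06-c's carrier `SCMemberY`), RE-KEYED FROM N06's CERTIFICATE EDITION «UD» (the (α5) faces p737119 at «UD», p740270 at «UJ», p745609 at «UN», p750549 at «UT» #10992, p755614 at «UT» over the engine «N09T5» #11026 (■ BATCH 68), p759737 at «VD» = the K1 FACE OF RECORD #11108 since 2026-08-30 04:1xZ, chair lead g33 ■ BATCH 73) TO ITS SUCCESSOR EDITION «VH» (JUNCTION «J9T» + a₀-SHRINK + DOOR CEILING GUARD + K0⁷ = THE TWO REGISTERED V22-Z STUBS BY NAME, the door's threshold chosen inside the engine): the face `…N24K1FaceTrN06PCN07N08JunctionLSlot8KappaPrimeAtGaussPinPrintedZBY` lineage (p717662 → p719388 → N09T∕N09T2 faces p720099 ∕ p724237),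 RE-KEYED TO N06's CERTIFICATE EDITION «VH», with
# NODE N09's THEOREM-3 DOOR READ THROUGH N09's OWN EIGHT STRUCTURAL INPUT ROWS; K0⁷ DISPLAYED AS EXACTLY THE TWO REGISTERED STUBS BY NAME (`Prop8StepCoPGridGAt`, `AbsBetaBoxAtThm1WitnessCCMGenGridGZAt`) (`hN09T`, displayed per door) instead of its conclusion `h09T` — over the «N09T3» engine `…Thm1AEPosN09T3AtGaussPinPrintedZBY` (edition of p723546: K0⁷ = EXACTLY the two REGISTERED V22-Z stubs BY NAME on DEF-1's `K0V22ZDefs` §1; the door's small-field threshold CHOSEN `ε₀ := 2a₀∕L²` (door v1.2's third numerics row with equality; the N09-friendliest label — FLAG №7's reg8 road then reads `B₃^{N07} ≤ L²∕2`) and the registered box read at that label through DEF-1 g29's ε₀-blindness reader `K0ZBWitnessBetaEps0.forall_eps0_absBox_of_GZAt`; the two L-only numerics rows PROVED at a SHRUNK ceiling), which feeds dag-n09-w2's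
# `thm3Member_forall_stage13SepCoPH_onDomains_of_axialOn_of_reg8_of_suppPt` BY NAME with the ⚑EPSBG letter `hle : θ.ν.εreg ≤ θ.εbg` PROVED `le_rfl`; K1⁹ `StabilityBRunRowsAtRecordR13SepCoPHV` (stmt-QuantumFields-27364) BY ITS ROUTE NAME

EDITION (α5) AT N06's EDITION «VH» (THIS FILE = the K1 FACE OF RECORD #11108 ✓p759737 `…N24K1FaceTrN06VDSCN07N08N09T5JunctionLSlot8KappaPrimeAtGaussPinPrintedZBY` — VD-keyed, over the engine «N09T5» #11022 ✓p755526 with the door-pinned per-door display; referee dag-ref-H g34 READ-612 PASS · NON-VACUITY 16∕16 · 0 NIT, chair lead g33 ■ BATCH 73 2026-08-30 04:1xZ (director-ym №327 (1)); lineage: the (α5) face of record p737119 at «UD» (FLAG №8′ CLOSED OF RECORD on it, director-ym №302∕№303, dag-ref-H g33 V-591∕V-592, chair T-300″) re-keyed «UJ» p740270 → «UN» p745609 → «UT» p750549 (#10992, ■ BATCH 66) → over «N09T5» p755614 (#11026, ■ BATCH 68) → «VD» p759737 (#11108, ■ BATCH 73) — with the N06 certificate read from edition «VH» instead of «VD»;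 the instantiation (α5), the engine «N09T5», the door pins and every other slot UNCHANGED).  HISTORY OF THE INSTANTIATION: FLAG №8 was RE-OPENED AT THE (α4) FACE ONLY — chair lead g30 T-299⁺ 2026-08-29 17:36Z, YM-PLAN v0.13.34 row 06; referee dag-ref-H g33 VERDICT 587 RE-LABELLED + INSTANTIATION VERDICT «LOCATED-19: YES»; kernel witness dag-n06-c g18 `B9BetaNotchMemberV1.not_exists_sections_memberY` p735619).  At (α4) (`J := MemberY …`, `f := id`; face `…N24K1FaceTrN06UDN07N08N09T3JunctionLSlot8KappaPrimeAtGaussPinPrintedZBY` p731579) the displayed pair `(ιB F) (hι F)` asked a RIGHT INVERSE of `β` at EVERY member of the record, and the tree's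
index set `MemberY` contains «notch» members whose `β` is not onto ([Balaban1984PropagatorsII] (2.3) p.224, (2.45) p.231 as typed): that pair is UNSATISFIABLE for every `F`, so the (α4) face was VACUOUS at
its l.253 (A3).  HERE the certificate's free index `{J : Type} (f : J → MemberY …)` is instantiated at the SURJECTIVE-β SUB-FAMILY — `J := {x : MemberY (stage3OfFamily F).d₆ … (Mstar F) // Function.Surjective (β x.toKIdx.hN x.toKIdx.D x.toKIdx.hk)}`, `f := Subtype.val` — and the pair is CONSTRUCTED (Mathlib), not displayed: `ιB := fun j => Function.surjInv j.2`,
`hι := fun j s => Function.surjInv_eq j.2 s` (dag-n06-c g18's published cure, 2026-08-29 17:33Z).  The three remaining `J`-indexed rows `C38 hunitA hnbrB` are displayed over that sub-family (`j.1` = the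
member; at editions from «UF» on only `C38` is left of them — `hunitA` is SUPPLIED inside the certificate by dag-n06-c∕dag-n06-j, `hnbrB` likewise gone); the certificate's own member-indexed `∀ x : MemberY …` rows are ITS text (edition «UD») and stay verbatim.  The sub-family is NON-EMPTY at every `M⋆` — a constant-level member (one empty top
level) has `β` onto: `B8Thm2TorusMemberCatalogue.surjective_beta_of_constLev` ∕ `exists_constLev_member`, packaged as a `MemberY` by dag-n06-c's carrier `B9SectionCarryingMembersV1`
(`exists_member_surjective_beta`, `SCMemberY.nonempty`; its `SCMemberY` IS this subtype) — CITED, not re-proved: no binder of this face needs it.  HONEST SCOPE of the N06 pin after (α5): the leaf is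
certified over the section-carrying members ONLY (node00-def-Y g28: the coded carrier's design intends the whole member type — this is NARROWER and says so); N06 NOT discharged; the engine's `∃ Y₀`
socket stays junk-inhabitable (no N06 → K1 credit); 344 displayed N06 binders = «VH»'s 346 (as Skolemised here) minus `ιB hι`.  STATEMENT DELTA w.r.t. the K1 face of record #11108 ✓p759737 = the N06 display re-keyed «VD» → «VH» ONLY (instantiation (α5), engine «N09T5» ✓p755526 by import, the five door-pinned per-door families `h09 hN09T h11N h13pos hrowsR`, the N07∕N08∕N10∕N13-`hEfl`∕K0 slots and the conclusion BY NAME untouched; w.r.t. the previous face of record #11026 ✓p755614 (UT-keyed) = that delta + READ-612's N06-display delta «UT» → «VD» (GONE 10 · NEW 19 · RETYPED 4)). W.r.t. #11108 binder by binder: GONE `hpXDv` (derived at «VF», dag-n06-c's BX leg v1.1 ✓p754003) and `hdgDvd13 hpdgDvd13 Bd13 Bd2₁₃ hBd13 hBd2₁₃` (derived∕dropped at «VH», dag-n06-c's UNIT D at print's transported site class), RETYPED `hrgdd13` (target class `bHXT x U ε′`), nothing added: 351 → 344 displayed N06 binders.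

TRACK A (YM-PLAN §2d, node N24 of 28 = binder B2), seat `pub-ymgap-dag-n24-c` (R134 s2; gen 19, INTENT-96).  Summits lane; count-neutral.  [4] = [Balaban1985BackgroundPropagators]; [B8] = [Balaban1985RegularSpaces];
[V] = [Balaban1989LargeFieldII]; [III] = [Balaban1988Convergent]; [I] = [Balaban1987RG1]; [B11] = [Balaban1985Variational].

WHAT THE FACE IS (generators `genLface.py` ∕ `genTr.py` ∕ `pinEd2.py` ∕ `genJ9T.py` ∕ `genJ9T3.py` ∕ `guardDoors.py` ∕ `genJ9T4.py` ∕ `edNamesHeader.py` ∕ `instJ.py` ∕ `alphaSC.py` ∕ `faceOverT5.py` ∕ `pinEps0.py` ∕ `hdrT5pin.py` ∕ `hdrVB.py` (driver `rekeyFaceT5.sh`), HOME `pub-ymgap-dag-n24-c/lean/g1[6-9]-PRESTAGE/gen`; one pass per N06 edition).  ONE theorem = ONE `refine` of the engine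
`…N24K1R9ByNameOfOpenStubsGridGChildrenSplitSlot8Thm1AEPosN09T5AtGaussPinPrintedZBY` §2 — the K1 engine at the Z3 member `εbg := a₀`: K0⁷'s two REGISTERED V22-Z stubs displayed BY NAME
(ym-nodeO DEF-1 `K0V22ZDefs` §1: `h1G3 : ∀ F, Prop8StepCoPGridGAt F` = REGISTERED 1-G‴; `h3 : ∀ F, AbsBetaBoxAtThm1WitnessCCMGenGridGZAt F` = REGISTERED 3ᴬ′-G‴-Z; the LOCATED-K0ε₀ letter met WITH EQUALITY at the engine's chosen threshold `ε₀ := 2a₀∕L²` via DEF-1 g29's ε₀-blindness reader — edition «N09T3»); every per-door child row keyed at the Gauss pin `θᴳᶻᴮ(π) := gaussPinH (Stage13HParams.ofHistoryBlind F 2 ⟨θZB(π), ZrOfRecord₁₃ F 2 θZB(π)⟩)`,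
`θZB(π) := theta13OfThm1CCMWZB F 2 j γ a₀ ε₀ ε₂₉ B₃ B₃' a₀ a₁ (Efl F j γ …) (fun p i => log z(gOfRecord₁₃ F 2 θZB(0) p i ^ 2, ε))` ([I] (0.15), read along the Z3 member's own history); N13's level 0 consumed
inside — with FOUR child slots FED BY NAME and their suppliers' hypotheses DISPLAYED:
* NODE N06 — dag-n06-d's Stage-11 certificate **edition 107 «VH»** `N06AtOpsYNuOfRecordV6EPairVH.b9LeafXUR_opsYNuOfRecordV6E_pairVH` (dag-n06-d g21, p761921, accepted 2026-08-30 05:06Z; R-generic, print-literal twin = «VI» p761981; = the certificate TOP EDITION, n06-d LANDED-21 I.32199; VF booked #11099).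
  LINEAGE: «VH» = edition 105 «VF» (p759375, #11099 — TOP PAIR «VF»∕«VG» chair lead g33 I.32061) with the rows-20–21 GRADIENT letters `hdgDvd13 : ∀ ν ε, HasMaj (bHX x ε) (ofBlocks (𝔬12 x).blk)
  ((𝔡A x).Dd U ν ∘ₗ ((𝔬12 x).G0 U ∘ₗ (𝔬12 x).Dv U)) (Bd13 ε · e^{−δ12₃ d})` and `hpdgDvd13 : ∀ ν ε β, HasMaj (bHX x (β+ε)) (ofBlocks (𝔭A x).blkPX) (((𝔭A x).ΦX U β ∘ₗ (𝔡A x).Dd U ν) ∘ₗ (G0 ∘ₗ Dv))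
  (Bd2₁₃ ε β · len^{−β} · e^{−δ12₃ d})` REMOVED together with their letters∕signs `Bd13 Bd2₁₃ hBd13 hBd2₁₃`, and DERIVED inside the certificate AT PRINT's TRANSPORTED SITE CLASS (3.40) `bHW13 := bHXT`
  (`bHZPIfam (taxiS U)`) by dag-n06-c's UNIT D (`thm33G0DirT_of_local3107` p758723 → LEG v1.1 `dgDvd_pdgDvd_of_pinsT_all` → `…N06StateLayerAtPinsPUW` p760678 with `htransW := hasMaj_bHZPIfam_of_supBlocks` p760411,
  `hκW13 := bHZPIfam_κ`, `hdomW := exists_l1_control_bHZPIfam` p759248; U8 v2 state layer `…StateProducersBAtPinsPUW` p760519 ∕ `…StateAssemblyAtPinsPUW` p760386); `hrgdd13` RETYPED once more (target class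
  `bHX x ε′ ↦ bHXT x U ε′`); 348 → 342 displayed, 17 [B9] letter-schemas left (`h348; h36 h36H hopI; h36A hGsqA h36HA h36A2 hopIA; hrgdd13 hD2sup hZ hΔ2; h14₁ h14₂ hexp14; hE`), witness
  `…N06NumericsWitnessR.numerics_inhabited_ed107` (= witness Q minus the `Bd13 ∕ Bd2₁₃` letters and their two signs); «VF» = edition 103 «VD» (p757219) with the rows-20–21 Dv-letter `hpXDv : ∀ x …, ∀ β, 0 ≤ β → β < 1 → HasMaj (cNormR 1 (H x) (𝔬12 x).blkW _ 0) (cNormR 1 (H x) (𝔭A x).blkPX _ (β − 1))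
  (((𝔭A x).ΦX U β ∘ₗ (𝔬12 x).G0 U) ∘ₗ (𝔬12 x).Dv U) (Bx13 β · e^{−δ12₃ d})` REMOVED and DERIVED inside the certificate by dag-n06-c's BX-handle leg v1.1 `pXDv_of_pins_KX` (p754003) from the G₀ layer's
  `(hG0C …).1.h43R` at `(M₀, aZ)` with `Bh12 := BhC` (the U8 state layer's `hpXDv` slot reads `Bx13 := fun β => max (max (Bx13 β) Bxz) (KX · BhC β)`, sup bound via the displayed closed `hwBhG`);
  349 → 348 displayed (−`hpXDv`; nothing added or retyped; `Bx13 hBx13 Bx13₀ hBx13₀ hwBx13` STAY for the W-route member), NUMERICS IDENTICAL (witness Q `…N06NumericsWitnessQ.numerics_inhabited_ed103` p756543 applies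
  verbatim), 19 [B9] letter-schemas left (`h348; h36 h36H hopI; h36A hGsqA h36HA h36A2 hopIA; hdgDvd13 hpdgDvd13 hrgdd13 hD2sup hZ hΔ2; h14₁ h14₂ hexp14; hE`); «VD» = edition 101 «VB» (p755299; = the CERTIFICATE TOP X-SIDE EDITION OF RECORD, chair lead g32 ■ BATCH 67 #11015) read through dag-n06-l g32's Thm 3.12∕3.13 face v1.7 «hrgdd LOSSY»
  `…StateSUCLE.t312_t313_of_pins_stateSUCLE` (P-HRGDD step (2), ε-LOSS RE-CUT): the rows-20–21 sup letter `hrgdd13` HONESTLY RE-DISPLAYED in print's LOSSY two-exponent species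
  `∀ μ ε ε′, 0 < ε′ → ε′ < 1 → ε′ < ε → ε ≤ ε′ + 1 → HasMaj (bHXA x ε) (bHX x ε′) (R ∘ Dvstar ∘ G1 ∘ (𝔡A x).Dsd U μ) (Br13 ε ε′ · e^{−δ12₃ d})` (was the LOSSLESS one-exponent form — dag-n06-l LOCATED-hrgdd:
  not print's species), the letters `Br13 Bd2₁₃ : ℝ → ℝ → ℝ` RETYPED two-argument and `hBr13` GUARDED; 349 displayed (count unchanged), witness `…N06NumericsWitnessQ.numerics_inhabited_ed103`; «VB» = edition 99 «UZ» (p754552) with the block-L² letter `hZ1` DERIVED from dag-n06-c's D_U leg and Thm 3.13's `C₁` line `hc1L2` produced INSIDE dag-n06-l g32's Thm 3.12∕3.13 face v1.6 «c1 INSIDE»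
  `…N06Thm312313AtPinsStateSUCL` (p755018, over the leaf `B9Thm313WholeLeafCompletePairMBCZcUSXCL` p754770) — `hZ1 hc1L2` GONE, 351 → 349 displayed, 20 [B9] letter-schemas left (`h348; h36 h36H hopI; h36A hGsqA h36HA h36A2 hopIA;
  hdgDvd13 hpdgDvd13 hpXDv hrgdd13 hD2sup hZ hΔ2; h14₁ h14₂ hexp14; hE`); «UZ» = edition 97 «UX» (p753455) with dag-n06-c's second-order block-L² leg C2c `…N06RgdDsLegAtPinsPhysR` (p753696) folded —
  `hrgdDs hrgdDd` GONE, ONE new pure numeric `hδ12₃F : δ12₃ ≤ (1 − 2p.α_F)((1 − 2p.α)p.δ₀)` ((3.47) split window; witness `…N06NumericsWitnessP.numerics_inhabited_ed99` p754581), 352 → 351; «UX» = edition 95 «UV»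
  (p752474) with the G₀ layer at its CLOSED Hölder profile (dag-n06-l GUSP `…N06G0LayerFromThm310AtPinsGUSP` p744654: the bundled probe letter `hG0P` and `BhG hBhG` GONE, the budget `hwBhG` RESTATED on the
  closed form `BhC := holderConst …`) and Thm 3.13's block-L² pair record `hLL2` ASSEMBLED from three legs (dag-n06-l `…N06G0QstarL2LettersLegAtPinsPU` p750957, dag-n06-c `…N06DvLettersLegAtPinsPU` p751403 +
  `…N06RgdILegAtPinsPhysR` p751879) — `hLL2` GONE as a binder (8 of its 12 (3.46)-type fields DERIVED, `hrgdDs hc1L2 hrgdDd` displayed in its slot; witness O p753481), 353 → 352; «UV» = edition 93 «UT» (p748277)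
  with the rows-20–21 INPUT members `h44m h45X h45Y h44G hp45W` DERIVED from rows 18∕19 by dag-n06-c's assemblers `B9H44mFromPinsKA.h44m_h45X_h45Y_of_local3107` (p749029) ∕
  `B9H44GFromPinsSN.h44G_hp45W_of_thm37PrintedSN` (p748285) — those five GONE; NEW in their slots: the Cor.-3.6 TRANSPORTED input legs `bHXT hbHXT hopI` (site: `InputLegsPair37 ∧ FactorsInputPair37Dir`
  at `bHZPIfam (taxiS U)`, after `h36H`) and `bHXTA hbHXTA hopIA` (bond: `InputLegsPair310 ∧ FactorsInputPair310` at `bHZKPIfam (taxiB U)`, after `h36HA`), the windows `hα3 : 3p.α ≤ (1 − p.α_F)(1 − 2p.α)`,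
  `hschβ : β′ < sch β′`, and ten transfer numerics `hBi44ge hδ44le ∕ hBZge hδ45le ∕ hBiYge hδ45Yle` (q-side) ∕ `hB44Gge hδ44Gle ∕ hB45Wge hδ45Wle` (p-side; the (3.45) constants of `hB44Gge hB45Wge` written with
  `let Cσ := …` heads) (witness N p752511); 340 → 353 displayed, letter-schemas 27 → 22 (+2 legs);
  «UT» ← «UR» ← «UP» ← «UN» ← «UL» ← «UJ» ← «UH» ← «UF» ← «UD» (= edition 77, THE CERTIFICATE OF RECORD — FLAG №8 CLOSED director-ym №296; print twins «UE»…«UU»): those earlier folds (node00-def-Y's records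
  `h𝔬12`∕`h𝔈`∕`hbI`, dag-n06-l's G₀Q*∕(3.132)∕leg folds and GUSP-side budget `hwBhG`, dag-n06-c's near-pair assemblers deriving `h43Gp`∕`hpDGW` + the SN probe re-pin `h𝔭`) are listed EDITION BY EDITION in the
  docstrings of the K1 faces of record #11026 ✓p755614 ∕ #10992 ✓p750549 (UT-keyed) and are not repeated here; displayed-binder counts 373 → 347 → 344 → 343 → 335 → 335 → 339 → 340 («UD»…«UT») → 353 → 352 →
  351 → 349 → 349 → 348 → 342 («UV»…«VH») by those editions' own counts; conclusion IDENTICAL from «UD» through «VF» at the coded carrier `B9LeafX (Y9OfRecordUPb N θ₃ M⋆ (opsYNuStOfRecordV4PE …) f bR ιB C38)` (node00-def-Y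
  `CarriersYU` (α2), dag-n06-c `B9SectBStepUGuardedR` §4 = the (α3) object of record, knit `B9LeafXCodedKnitU`); the regular-families PARAMETERS `{R₁ R₂}` with the class-transfer
  binders `hGR hRP1 hRP2 hP1 hP2` and the cube constant `c hcB hc` displayed (director-ym №290 (1); discharged in the print-literal twin); CONE CENSUS per its header (0 raw-class
  Step letters, 0 unguarded Reg335-keyed binders).  (α5) HERE (replacing (α4) of p731579 —
  see EDITION (α5) above): `J := {x : MemberY (stage3OfFamily F).d₆ … (Mstar F) // Function.Surjective (β x.toKIdx…)}`, `f := Subtype.val`, `ιB := fun j => Function.surjInv j.2`,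
  `hι := fun j s => Function.surjInv_eq j.2 s` (by name: dag-n06-c's `SCMemberY` ∕ `.val` ∕ `.ιBsc` ∕ `.hιsc`) — the pinned leaf covers the surjective-`β` members and the (α3) block's `J`-indexed row(s) `C38` are displayed over them (`ιB hι`
  CONSTRUCTED, off the display); `{ιR} [Fintype] [DecidableEq] bR` (an ℝ-basis of
  M₂(ℂ)) and the constants stay displayed as data; N06 NOT discharged; the certificate OF RECORD stays «UD»∕«UE» (director-ym №296∕№303) — THIS re-key reads the slimmest successor
  edition and changes the N06 display ONLY): 344 of its 346 binders after `(θ) (hθ)` (all but `ιB hι`) are THIS THEOREM's HYPOTHESES VERBATIM up to `J ∕ f` as above, `N := 2`, `θ.toStage3Params ∕ θ.<Stage-3 field> ↦ (stage3OfFamily F)…`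
  and Skolemisation in `F` (`(b : T)` ↦ `(b : ∀ F : T4Family, T[e ↦ e F])`, implicit groups made explicit; instance binders named `instN06_k`; inner bound names colliding with an
  outer certificate name α-renamed `·ᵢ`).  Per door the proof has
  `have h06 F … : B9LeafX (Y9OfRecordUPb 2 (stage3OfFamily F) (Mstar F) (opsYNuStOfRecordV4PE 2 (stage3OfFamily F) (Mstar F) (𝔯 F) (sectEStYOfRecordV7 2 (stage3OfFamily F) (Mstar F) (𝔢₀ F)) (𝔴 F) (𝔈 F)) SCMemberY.val (bR F) SCMemberY.ιBsc (C38 F))` —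
  TYPED AT N06's OBJECT OF RECORD — proved by the certificate at the door witness's Stage-11 view `(θZB(π)).toStage12Params.toStage11 F 2 ⟨0, 0, 0⟩` (its Stage-3 dictionary IS `stage3OfFamily F`,
  `rfl`; admissible by `admissible_theta13OfThm1CCMWZB_of_le_half … .toStage12.toStage11`; the view's run-indexed weight binder is read by no certificate binder), then fed to the engine's
  CARRIER-GENERIC socket `∃ Y₀ : PrintedCarriers9X, B9LeafX Y₀` as `⟨_, h06 F …⟩`.  That socket is JUNK-INHABITABLE (referee dag-ref-H g32 VERDICT 555: `emptyCarriers9X` + `B9LeafKnit.b9LeafX_of_isEmpty`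
  ⊢ `exists_b9LeafX_vacuous`; p682802 :22–23's standard «the honest display of N06 is the FACE's»): the N06 binders here are load-bearing for the PIN and the DISPLAY (N06's open burdens, unweakened),
  NOT for the truth of the conclusion through that socket; NO N06 → K1 credit is claimed (chair lead g29's note of 2026-08-29 12:18Z is the reading of record).  Q-SOCKET (dag-n06-d g17, located
  2026-08-29): the certificate's W-letter display `hB` (FLAG №8) is located UNSATISFIABLE AS INSTANTIATED for `N ≥ 2`; road (α) re-concludes the certificate at the coded carrier `Y9OfRecordU` — one
  generator pass then re-keys this face; until then this face INHERITS that located display verbatim (A2 caveat declared here, not resolved here).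
* NODE N07 — `h07 : ∀ F, ∃ ζ, B11Leaf (Z11OfRecord F 2 ζ)` fed by NODE 00's Sect.-E presentation `CarriersZSectE.b11Leaf_Z11OfRecord_withSectE_of_parts` at print's letters (`L := F.L`,
  `η i := (F.P i.K).eta i.k`): displayed per `F` (`hN07`, 23 conjuncts) = the presentation `E`, n16's bridges + laws + capped existence leaves, the `famX` laws, the Sect. A law (14), the printed
  sign∕size relations, THE SIX REMAINING PRINTED PARTS `Prop2∕3∕5∕8Printed`, `SectFPrinted`, `Prop9Printed`.  N07's ∀-form junk channel (`ζ.R`, F8) NOT closed — said in `CarriersZSectE`.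
* NODE N08 — `h08 : ∀ F, PrintedUV3V 2 F.L` fed by dag-n08-w4's `…N08AlphaEq324RowACReMassedZSlot.printedUV3V_at_slotOfRecord_of_coreLTAtAC_of_massBoundZAE_of_consts`: displayed per `F` (`hN08`, 6) = the
  (α)-AC residual (AC inputs at print's averaging, the numeric window, the EDITED (α)-AC rows `RunAlphaEq324CoreLTAtAC`, `0 ≤ c_m`, the `dU`-a.e. mass bound); E6′ seam ∕ object gap = n08's located items.
* NODE N09's THEOREM-3 DOOR (editions «N09T»∕«N09T2»∕«N09T3»∕«N09T5» — THIS file's delta w.r.t. `…N08Junction…PrintedZBY`; «N09T5» (engine `…Thm1AEPosN09T5AtGaussPinPrintedZBY`, 2026-08-29): the engine CONSUMES the per-door families at the TOP of the window `ε₀ := a₀` instead of `2a₀∕L²` — ym-nodeO DEF-1 g30 LOCATED-EPS0-LABEL: at `2a₀∕L²` K0e's threshold route `hord` to the displayed `hχregpt` is EMPTY, and the reg8 road that wanted ε₀ small is DEAD (FLAG №7′, door v1.3 ✓p747503, consumable here after (D1′)); the displayed families below are DOOR-PINNED IN `ε₀`: each gains ONE guard binder `(hε₀ρ : ε₀ =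 a₀)` after the ceiling guard `ha₀ρ`, so the rows are demanded only at the door the engine consumes (weaker hypotheses; the other door letters stay ∀ under their signs∕ceiling, V-579's caveat shrinks to them)) — INSIDE THE ENGINE, per door: `⟨1, one_pos, fun _ hC _ => thm3Member_forall_stage13SepCoPH_onDomains_of_axialOn_of_reg8_of_suppPt θᴳᶻᴮ(π) hP hC
  cd hreg8 le_rfl ha₀.le haxDom haxbg hχregpt hint h11 hres huniq hε' ha₀ hbg3 hbg2 hbg₀⟩ (`hbg3`∕`hbg2` PROVED at the engine's SHRUNK ceiling `a₀ ≤ 1∕(109824·L²)`; `hbg₀` = the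
  LOCATED-K0ε₀ letter `K0N09Eps0LetterAt F a₀ ε₀` read off the engine's internally DERIVED Eps0 text at its door — editions «N09T2»∕«N09T3»)`; the face PASSES THROUGH the engine's displayed binder `hN09T : <door letters, signs, box> → ∃ cd : (P : B12.RunParams) → (i : ℕ) →
  ContourData (F.P P.K) i (SU 2), hreg8 ∧ haxDom ∧ haxbg ∧ hχregpt ∧ hint ∧ h11 ∧ hres ∧ huniq` — dag-n09-w2's door v1.2 (FILE 10 `…N09AxialCovariance181OnDomainsReg8Nesting`:
  nesting + a.e. (F7a) DERIVED from [B7] Prop. 2 (53)) INPUT rows VERBATIM at `N := 2`, the Z3-pin projections in reduced form (`θ.ν ↦ numerics7OfThm1CCM F.L j ε₀ B₃ B₃' a₀ a₁`, `θ.εbg ∕ θ.ν.εreg ↦ a₀`,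
  `θ.ν.ε₀ ↦ ε₀`, `θ.toStage13Params ↦ θZB(π)`; all `rfl`: Z3 `theta13OfThm1CCMWZB_ν ∕ _εbg ∕ _εreg ∕ _ε₀`, `gaussPinH_toStage13Params`): (8)-membership at radius `a₀` (dag-n09-w1; LOCATED modulo N07's
  Theorem-1 slot), [I] (2.3)'s axial convention + hierarchical block-axiality of the background's partial averages (definitional after node00-def's re-points), POINTWISE (F7a) (K0e), (I19),
  [B11] Thm 1 ×3 at radius `a₀` (N07's slot), — each a located item, displayed not resolved; `hεreg`, `0 < εbg`, `0 < ε₂₉` by the door's signs.  The three [B7]-numerics rows are OFF the per-door bill (edition «N09T2»): the two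
  L-only ones PROVED at the engine's SHRUNK ceiling; the third IS the LOCATED-K0ε₀ letter `K0N09Eps0LetterAt F a₀ ε₀ := 2a₀ ≤ ε₀L²`, since edition «N09T3» met at the engine's CHOSEN threshold («N09T3»: `2a₀∕L²` with equality; «N09T5»: `a₀`, by `2 ≤ L²`) — superseding the words that follow: formerly WITH EQUALITY at the engine's CHOSEN threshold `ε₀ := 2a₀∕L²`, the registered
  box being read at that label by DEF-1 g29 `K0ZBWitnessBetaEps0.forall_eps0_absBox_of_GZAt` (β of record at the Z3 member is ε₀-blind by `rfl`) — displayed NOWHERE on this face.  DOOR CEILING GUARD: every per-door family of this face carries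
  `(ha₀ρ : a₀ ≤ 1 ∕ (109824·L²))` — demanded only below the engine's shrunk ceiling (ref-H 579's door-side suggestion).  PER-DOOR CAVEAT: rows are still demanded at EVERY such door (letters +
  signs + β-box); joint inhabitation across doors is NOT claimed (LOCATED-N09NUM ∕ ref-H VERDICT 579).  The ⚑EPSBG letter `hle : θ.ν.εreg ≤ θ.εbg` (FALSE at the `εbg = 1` members, dag-n09-w1) is `le_rfl` HERE.
* N05 (inside the N05∕N06 slot `hN06`, 43 conjuncts: Hölder pair + [4]'s letters `hLet`∕`SLetUB`) read through dag-n05-d's ζ-L door BY NAME at the witness slot of record `Slot8κ′`, N06's five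
  N05-side binders consumed η-free (p688041's slot proof VERBATIM); print's TRACE STATE `(τ, C_τ)` on `(stage3OfFamily F).𝔸 = Matrix (Fin 2) (Fin 2) ℂ` OFF the bill since edition «Tr» (NODE 00
  `Record12NumericsFamilyTraceState.exists_traceState_stage3OfFamily`; [I] (0.2) p.252, [B8] p.76).

WHICH CHILD BLOCKS AT THE Z3 GAUSS PIN AFTER THIS FILE (= its hypotheses): K0⁷ = `Prop8StepCoPGridGAt F` (REGISTERED 1-G‴, fe2ecbb43f63b100) ∧ `AbsBetaBoxAtThm1WitnessCCMGenGridGZAt F` — EXACTLY the two REGISTERED stubs BY NAME (0∕2); the LOCATED-K0ε₀ letter `2a₀ ≤ ε₀L²` DERIVED inside the engine (DEF-1 g29: ε₀-blind β, edition «N09T3»); per `F` at `stage3OfFamily F`: the N05∕N06 slot `hN06`;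
**N06 = 344 of edition «VH»'s 346 certificate binders VERBATIM** (as Skolemised here; `ιB hι` CONSTRUCTED at (α5), `C38` over the section-carrying sub-family); **N07 `hN07`**;
**N08 `hN08`**; N10 `h10` (display-only, inhabited AS TYPED, p685841); per door: N09 `h09` ([I] Lemma 4 leaf) + **`hN09T` (the eight structural Thm-3 input rows)**, N11 `h11N` (FLAG №1), N13 `h13pos` + `hEfl`,
NODE O `hrowsR`; `0 < ε`.  OFF the bill: N06's ∕ N07's bare leaves, N08's bare slot, N09's Thm-3 CONCLUSION and its EPSBG letter, N13's level 0, `logz`, the trace state.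

FLAG №14 (director-ym №256) — STATE OF RECORD: the family dictionary is RECORD-NONABELIAN (`(stage3OfFamily F).𝔸 = Matrix (Fin 2) (Fin 2) ℂ`, `rfl`, `Record12NumericsColourTie.stage3OfFamily_𝔸`;
`FiniteDimensional ℝ (stage3OfFamily F).𝔸` BY NAME from `Node00.finiteDimensional_𝔸_stage3OfFamily`); N06's certificate binders read the dictionary's GEOMETRY only (`d₆ ℓ₆ hd' hL' b₀ b₁`; 0 occurrences
of `θ.𝔸`) over print's cube class with coefficients `Matrix (Fin 2) (Fin 2) ℂ` ∕ `specialUnitaryUnits (Fin 2)` (SU(2) AS TYPED); no K-display movement claimed.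

HONEST FRAMING.  Composition BY NAME (one typed `have` per door for N06, one `refine` of the engine, p688041's N05∕N06-slot proof); NO estimate of Bałaban's proved here; every family DISPLAYED as a
hypothesis (CONDITIONAL, audit `proof.conditional`) — every letter schema of N06's certificate and every N09 input family REMAINS a displayed hypothesis, now on the K1 face; `Efl`, `ε` FREE; NOT a
claim that the Z3 member IS K1⁹'s witness; NO v10 ∕ V22-Z stub proved or closed; **N06, N07, N08, N09 NOT discharged** (no «DISCHARGE CLAIMED» line exists for any; the chair books discharges on
referee reads, R417); N05's discharge is R467's; N10 ∕ N11 ∕ N13 NOT discharged; N24 COMPOSITE — no count moved (typed 28∕28 · discharged 8∕28, 8∕27 excl. NODE O); K0⁷ «V22-Z 0∕2 (+2′)» ∕ K1⁹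
stmt-QuantumFields-27364 (DECIDING; v10 0∕6, HARD FREEZE respected — Theorems side only) ∕ K3⁸ OPEN; one finite 𝕋⁴ programme at fixed ε, Bałaban AS PRINTED; R4 = the conditional finite-𝕋⁴ rung
`BalabanLadder.UV` only — NOT continuum ∕ ℝ⁴ ∕ OS ∕ mass gap ∕ Clay: the Yang–Mills mass gap is NOT proved by any of this.  No `sorry`, `def`, `instance`, `notation`.  Elaboration options as the
certificate's own (`maxHeartbeats 800000`, `synthInstance.maxSize 2048`, `maxRecDepth 8192`).
-/

noncomputable section

open scoped Matrix.Norms.L2Operator BigOperators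
open Filter Topology MeasureTheory

namespace Summit.QuantumFields.YangMills.BalabanUVNodes.N24K1FaceTrN06VHSCN07N08N09T5JunctionLSlot8KappaPrimeAtGaussPinPrintedZBY

open Literature.MathematicalPhysics.QuantumFieldTheory.Balaban1983to89
open Literature.MathematicalPhysics.QuantumFieldTheory.Balaban1983to89.Node00
open DagBinding T4Continuum T4DatumAssembly FlowStepRuns AveragingRT
open FlowStep (HBeta RGEqH prefixOf prefixOf_apply BetaLowerH BetaUpperH Box mem_box clampPrefix Y)
open Literature.MathematicalPhysics.QuantumFieldTheory.Balaban1983to89.B8LeafModelZd (ZdIdx)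
open Literature.MathematicalPhysics.QuantumFieldTheory.Balaban1983to89.B8TowerBondsPrinted (towerBondsP)
open Literature.MathematicalPhysics.QuantumFieldTheory.Balaban1983to89.B9SupplySockB9P3ZdSrcPer (SrcAtIPer SrcHolderAtIH2Per)
open Literature.MathematicalPhysics.QuantumFieldTheory.Balaban1983to89.B9SupplySockB9P3ZdLetters (OpsZd)
open Literature.MathematicalPhysics.QuantumFieldTheory.Balaban1983to89.B9Eq327GreenZdHermPer (InvAtHIPer)
open Literature.MathematicalPhysics.QuantumFieldTheory.Balaban1983to89.B9SupplySockB9P3ZdPer (GlobAtIPer)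
open Literature.MathematicalPhysics.QuantumFieldTheory.Balaban1983to89.B9SupplySockB9P3ZdH2Per (HolderAtIH2Per holderAtIH2Per_anti)
open Literature.MathematicalPhysics.QuantumFieldTheory.Balaban1983to89.B9SupplySockB9P3ZdAllLettersZdPer (opsAllZdPer)
open T4TermwiseTorus (IsPeriodic)
open MatrixLog B7Prop2Explicit B7Prop1Local B7Eq92Concrete
open B8Ineq132 (InAk covDerivFwd)
open B8Eq119TwistedAxial (bgT)
open B8Eq140Level (SideTouches)
open B8Eq138LandauZd (covLap QT)
open B7Eq78Linearization (zdBlocking QprimeIter)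
open B8Eq1117Concrete (XSpace)
open B8Prop5ContractionKLevel (Bd2)
open B8LambdaSpaceKLevel (wt)
open Summit.QuantumFields.YangMills.Theorems.K0V19Defs (Prop8StepCoPAt AbsBetaBoxAtThm1WitnessCCMGenAt)
open Summit.QuantumFields.YangMills.Theorems.K0V22ZDefs (Prop8StepCoPGridGAt AbsBetaBoxAtThm1WitnessCCMGenGridGZAt)
open Summit.QuantumFields.YangMills.Theorems.BalabanUVNodesN11GaussianCertificateDefs (gaussPinH)
open Summit.QuantumFields.YangMills.Theorems.BalabanUVNodesN11Sect3SupplyChainDefs (Sect3Supplier)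
open Summit.QuantumFields.YangMills.Theorems.BalabanUVNodesN11Sect3SupplyChainObligationsDefs (SupplierObligations OperandRowsAlongChain)
open Summit.QuantumFields.YangMills.BalabanUVNodes.N05SubBP2DK2PerKappaSlotExistsOfBindersLettersPerDoorL (exists_residB8_slot8κ'_of_bindersLettersPer_doorL)
open Summit.QuantumFields.YangMills.BalabanUVNodes.N24K1R9ByNameOfOpenStubsGridGChildrenSplitSlot8Thm1AEPosN09T5AtGaussPinPrintedZBY (N24_stabilityBRunRowsAtRecordR13SepCoPHV_byName_of_registeredStubsGridGZ_of_childrenSplitSlot8DoorPinnedN09Thm3InputsN11OperandRowsThm1AEPos_atGaussPinPrintedZB_pinY_of_runRowsCont)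
open T4Continuum (T4Family) open Node00 open B9PinMembersKLevelV1 (MemberY geo9Y bg9Y) open B9PinGeometryKLevelV1 (dOmegaY OmKY inΛY unitDistY c35Y) open B7Prop2SpecialUnitary (specialUnitaryUnits specialUnitaryUnits_le_unitaryUnits) open B9Ineq347GAAtLetters (hGA_opsYOfLetters) open B9Ineq344LocalPairHolds (hGp_opsYOfLetters_holds) open B9Cor35ComparisonsGAAtLetters (hGA_e_opsYOfLetters hGA_h1_opsYOfLetters hGA_e4_opsYOfLetters hGA_h2_opsYOfLetters hGA_l2_opsYOfLetters) open B9CoReadingCoordsHolderAdm (holderProbesKA bond_h1ReadsNbr_of_pinsA) open B9CoReadingCoordsHolderAdmReadings (bond_coReadsHHolderNbr_of_pinsA bond_inputReadsFam_of_pinsA) open B9CoReadingCoordsHolderSNear (holderProbesSN site_h1ReadsNbr_of_pinsSN) open B9CoReadingCoordsHolderSNearReadings (site_inputReadsFam_of_pinsSN) open N06DirKinematicsAtPinsR (h36HA_of_dir_pinsR h36_of_dirSq_pinsR h36A_of_dirSq_pinsR) open N06DirKinematics3AtPinsSN (h36H_of_dir_pins₃SN) open B9H43GpFromPinsSN (h43Gp_of_thm37PrintedSN)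 open B9HpDGWFromPinsSN (hpDGW_of_thm37PrintedSN_unif) open B9H44GFromPinsSN (h44G_hp45W_of_thm37PrintedSN) open B9H44mFromPinsKA (h44m_h45X_h45Y_of_local3107 thm33G0DirT_of_local3107 inputConst44_pins_nonneg inputConst45_pins_nonneg const37_pins_nonneg) open B9SmoothHolderClassPI (bHZPIfam bHZKPIfam) open B9RWSums347DefiniteFaces (exp261) open B9RWSums344Input (inputConst44 inputConst45) open B9RWSums343Holder (holderConst) open B9Thm37Whole (const37) open B9RWSums346MixedFactorAtRecordClosed (MRec aRec BRec δRec) open N06CurrentMajAtPinsIdPhys (hBJ_of_pins_P) open B9WalkLettersOps (opsWalkY dirOpsWalkY dirLettersWalkY kappaWalkY thetaWalkY KcWalkY rdWalkY) open B9WalkLettersOpsFacts (staticOK_opsWalkY bounded_kappaWalkY) open N06WalkLettersAtRecordR (localityDir_opsWalkY_of_agree identities₂_opsWalkY_of_reg335R) open N06XdYdLegAtPinsPhysPU (hXd_of_pinsP_geo9Y pYDH_of_pinsP_geo9Y) open N06DgLegAtPinsPhysPU (hκ13_of_pinsP dgDH_dgDHd_of_pinsP_geo9Y) open B9SmoothHolderClassP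 (bHZPG bHZKP bHZKPG) open N06WELegAtPinsPhysPUB (hκX_of_pinsP hWE_of_pinsP_geo9Y_budget) open N06WGpLegAtPinsPhysPU (hwGp_of_pinsP_geo9Y) open N06RgdH43LegAtPinsPhysPU (hrgdH_of_pinsP43_geo9Y) open B9SmoothHolderClassPProducers (CTel) open B9Ineq349SiteThresholdRateNamed (thrM349 cg349 cg349_pos fineEntryS_le_named) open B9Thm39ReadingAtLetters (basis39 κ39) open B9MultiscaleSmoothPartitionYNear (rNear) open B9Thm313WholeDvHolderAtPinsGraded (thetaL CJG) open B9PlaquetteBinderOfReg335Y (plaqV_binder_of_regYR_budget_SU budget_nonneg) open B9SectDSup (weightNorm) open B9MultiscaleSmoothPartitionYLip (CLip) open B9GradViaDivLettersTransported (taxiS taxiB) open B9OpsRTransport (ops312RY) open B9Ineq349SiteFacesAtLettersR (s349_site_of_t37_display348_of_R) open B9Thm314Thm315LayerR (thm314_pair_layerOfLettersR) open B9Eq335ClassBridgePV1 (regY335_of_regYP335 regY336_of_regYP336) open B9BackgroundsKLevelV1P (bg9YP) open N06MixedLegAtPinsPhysR (l2MixedLegs37_of_pinsR)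
open N06MixedFactorAtPinsPhysR (h36H_with_factor_of_pinsR) open N06SplitMajorantsAtPinsPhysR (split_majorants_of_letter_schemasR) open N06StepL2AtPinsPhysR (stepL2_of_letter_schemas_residualR) open N06Thm312313AtPinsStateSUCLE (t312_t313_of_pins_stateSUCLE) open B9Thm313WholeLeafCompletePairMBCZcUSXCL (letters313L2Pc_of_fields) open N06Rgd2LegAtPinsPhysPU (hrgd2_of_pinsP_geo9Y) open B9SectBStepUClosedSUOfSections (sectBStepU_C37GY_su_extraYPb_closed) open Node00.OpsYExpsOfRecordV2 (expsYOfRecordV2) open Node00.OpsYOps312OfRecord (ops312YOfRecord) open Node00.OpsYBondMapOfRecord (bIYOfRecord) open N06G0QstarLettersLegAtPinsPU (g0qstar_letters_of_pins) open N06G0QstarTransferLegAtPinsPU (g0qstar_transfer_letters_of_pins) open B9Thm39FacesAtLettersRC (t39_hksum_oneCube_opsYOfLetters_FRC) open B9Thm311Thm315FacesAtLettersR (t311_of_pins_opsYOfLettersR) open B9Thm315SectEStarRepAtLettersR (DecayMidOnStY t315_opsYNuStOfRecordV4PE_sectEStYOfRecordV7_of_3185_onR) open B9BackgroundsKLevelV1R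 (RegFamY MemOfFam mem_of_reg335R bg9YR regYP335 regYP336 regYP335_one kernelFamilyR hKernelR rwExpansionR fineKernelR) open B9LeafXClassAntitone (ClassIncl residualGpAtOne_R residualGAGlobAtOne_R rwSumsYieldIneqs_R rwKernelSumYields_R thm37Printed_antitone cor38Printed_antitone thm39Printed_antitone thm310Printed_antitone thm311Printed_antitone thm312Printed_antitone thm313Printed_antitone thm314Printed_antitone thm315FullPrinted_antitone stmt349Printed_antitone stmt3132Printed_antitone thm314LocalPrinted_antitone) open B9PinGeometryKLevelV1B (c35B ten_L3_le_c35B ten_L4_le_c35B c35Y_le_ten) open DagBinding (B9LeafX) open N06Ids3152AtPinsPhys (ids3124_ids3152_of_hZ_pins) open Node00.OpsYNablaBridge (cf_mul_etaS_of_hcfk) open B9Cor35ComparisonsGpCAtLetters (hGp_e_opsYOfLetters hGp_h1_opsYOfLetters hC_opsYOfLetters) open B9Cor35ComparisonsEH (hE4_of_hGA_e4 hH2_of_hGA_h2) open B9GeoLemma21KLevelV1 (geo9Y_len_pos) open B9Thm39WholeBlk (Conv348Blk) open B9Thm39OneCubeReadingAtLettersY (oneCubeOps39YF) open B9RowSum261DefiniteFaces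 (rowConst261) open B9Thm312Whole (GeoOK FormSmall cNorm PosDefEnd) open B11SectG (BlockNorm HasMaj) open B9GeoNormsKLevelV1 (geo9K_dist_nonneg geo9K_supNorm_nonneg) open B9GeoLemma21KLevelV1 (geo9Y_dist_triangle geo9Y_dist_comm) open B9GeoNormsKLevelModelSignsV1 (modelSignsOn_geo9K) open B9Thm34Ext (toB6) open B9CoRealizesRelAtLetters (RelB maj342_relB_left maj342_relB_right dist_eq_of_relB len_eq_of_relB relB_refl) open B9SectCDiffDict (maj342) open B6Ineq2142KLevelV1 (β) open B9CarrierBlockMultiplicity (card_sameCarrier_le_kIdx) open B9Thm311ReadingCoords (PosDefTr) open B9PinGeometryKLevelV1 (kLab) open B9Thm314GpFlatTorusGeometry (tdistK OmegaC) open B9Thm314WholePinGeometry (locDataY) open B9Thm314WholePair (locData₂) open B9Thm314WholePairWalks (pairWalkSets) open B9Thm314WholeSummation (WalkSetsSpec WalkWeightsSummable) open B9SectCWalkTermsAllNorms (Thm310AllNormsPrinted) open B9Thm314WholeExpansionReads (ExpansionReads)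
open B9Thm314WholeCancellationLayer (pairOp) open B9Thm37Whole (Ops Sizes StaticOK Local342) open B9Cor38Whole (WalkReading) open B9Thm310Whole (Ops310 WalkReading310 Sizes310 StaticOK310 Locality310 Local342G) open B9Thm310WholeDir (DirLetters310 Identities310₂) open B9RWSumsDefinitePins (PinPrims) open B9RWSumsDefinitePinsPair (PairPrims) open B9RWSumsDefinitePinsPairM (MixedPrims E310YPairM) open B9RWSumsDefinitePinsPairMDir (E37YPairMDir) open B9RWSumsDefinitePinsPairMDir4Rows (rows131819_definite_geo9Y_pairM_dir₄) open B9Thm37WholeDir (DirLetters37 Identities₂) open B9Cor38WholeDir (LocalityDir) open B9Thm37KLetterDir (HolderV37Dir FactorsInputPair37Dir) open B9RWSums344InputFam (InputReadsFam sliceProbe) open B9RWSums344InputPair (InputLegsPair37 InputLegsPair310 FactorsInputPair310) open B9RWSums346MixedPair (L2MixedLegs310 FactorsL2Mixed310) open B9CoReadingCoordsTranspose (TrIdx trBasis isTransposePair_GcoK_trBasis isTransposePair_DcoK_GcoK_trBasis isTransposePair_GcoS_trBasis isTransposePair_DcoS_GcoS_trBasis) open B9Thm311SymmAtRecordV4 (symm0_parSymY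 symmG_parSymY) open B9Thm311AdjointPairs (GpY_isSymmTr) open B9RWSums346SecondDiff (familyOp DirOps310 L2SecondLegs310) open B9RWSums346SecondDiffGp (DirOps37 L2SecondLegs37) open B9Thm37Glue (IsTransposePair) open B9RWSumsReadsNbr (H1ReadsNbr) open B9RWSums346Two (L2TwoLegs310 FactorsL2_310) open B9RWSums343Holder (HolderProbes HolderLegs310 FactorsHolder310) open B9RWSums343HolderGp (HolderLegs37) open B9Thm39ReadingCoords (cR39) open B9CoReadingCoords (XBK evBK blkBK GcoK DcoK DscoK LcoK coordOpK cdBₗ cdsBₗ) open B9CoReadingCoordsS (XSK evSK blkSK sIK sIK_faithful off_bound_evSK GcoS DcoS DscoS LcoS) open B9CoReadingCoordsL2S (sIK_dist_le_one site_l2ReadsNbr012_of_pins site_l2ReadsNbr345_of_pins) open B9CoReadingCoordsL2Pair (bond_l2ReadsNbr345_of_pins) open B9Ineq349SiteComposite (cdSL cdsSL) open B9Thm312WholeL2 (StepL2) open B9Thm312WholeHHolderNbr (CoReadsHHolderNbr) open B9Thm311ReadingCoords (IsSymmTr) open N06CoReadingsOfPins (bond_coReadings3_of_pins bond_coReadingsLap_of_pins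 site_coReadings4_of_pins bond_l2ReadsNbr3_of_pins) open B9GeoNbrCountKLevelV1 (nbrM₀Y nbrCountY hnbr_two_of_le) open B9CoReadingCoordsH (XHK) open B6Ineq2142KLevelV1 (lvl) open B9Thm314WholePinGeometry (locDataY_laws) open B9PinGeometryKLevelV1 (dOmegaY_nonneg) open scoped Matrix.Norms.L2Operator open N06Proj349AtPinsPhysRC (proj349Maj_of_t37_display348_rateR_ge cP349_nonneg) open B9Eq346GradGpDivAtPinsL2Closed (M46 a46 B46 δ46 M46_pos a46_pos B46_pos blockBd_DvGcoSDvs_memberY_at) open B9PerturbationL2Delta2 (D2coK constL2Pi constL2Pi_nonneg) open B9PerturbationL2Letters (constL2 constL2_nonneg) open N06SectDUnitsAtPinsPhys (isUnit_deltaPiAY_of_formSmall_phys isUnit_deltaOneY_of_formSmall_phys posDefEnd_S0coK_of_posDefTr_phys posDefTr_deltaOneY_of_formSmall_pins_phys identitiesDef_of_pins_phys isUnit_deltaAY_phys_of_posDefTr) open B9Thm313WholeLettersCut (Letters313HZc Letters313L2Pc)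
open B9Thm313WholeRgdFrom3152 (Ids3152) open B9SectDSup (weightNorm) open B9Thm313WholeLeftZ (Letters313DZ) open B9Thm313WholeDirZ (Letters313DMZ) open B9Thm313WholeHolderZ (Letters313HZ) open B9Thm313WholeDirL2Z (Letters313L2MZ) open B9LettersHZAtOne (plateau_pos) open B9Thm313WholeDirInputBC (Letters313IML) open B9Thm312WholeClasses (cNormR) open B9CoReadingCoordsHolder (PK) open B9CoReadingCoordsInput (bHK) open B9CoReadingCoordsInputS (bHS) open N06G0LayerFromThm310GUSP (g0_layer_of_thm310_coreDir₃USP) open N06G0QstarL2LettersLegAtPinsPU (g0qstar_l2_letters_of_pins) open N06DvLettersLegAtPinsPU (dv_letters_of_pins pXDv_of_pins_KX) open N06RgdILegAtPinsPhysR (rgdI_of_pinsR) open N06RgdDsLegAtPinsPhysR (rgdDs_rgdDd_of_pinsR) open N06DivLegAtPinsPhysR (hdivDs_of_pinsR) open N06HHLegAtPinsPhysRU (hLHH_of_pinsRU) open N06CutL2LettersAtPinsPhysR (vDRDG_vGDRD_of_pinsR) open B9Thm313WholeLettersCutKept (Letters313L2Pk Letters313L2Pc.of_kept) open N06MixedLegAtPinsPhys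 (hcntM_of_walkCnt) open N06Row17FromRow19LettersDir (row17_of_row19_letters₂) open B9WalkLettersCoordsS (SblkY hWalkY gsqcoS walkCntM₀Y walkCntY nearBlkCntY) open B6Cover236MultiLevelBlocks (cubes) open B9Eq346MixedLegAtPinsL2Closed (MMix aMix BMix δMix) open B9Thm39ReadingCoords (coordBound39 basisBound39) open B9Thm31GpMajFromPinsPairMR (thm31GpMaj_of_t37_pairMR) open B9PerturbationMajorantLetters (const3131) open B9RowSum261DefiniteFaces (rowConst261) open B9Thm312WholeIdentitiesSplit (Ids3124 identities_of_def_3124) open Node00.OpsYSectDCoords (DvcoKH DvscoKH GcoK_GAY_mul_S0coK cR39_trBasis_pos) open B9Thm311ReadingCoords (isUnit_of_posDefTr) open N06StateLayerAtPinsPUW (hStateTuplesW_of_pinsP_geo9Y) open N06DgDvdLegAtPinsT (dgDvd_pdgDvd_of_pinsT_all) open B9GradLetterTransportedSupSource (hasMaj_bHZPIfam_of_supBlocks) open B9GradLetterTransportedInputClassesPI (bHZPIfam_κ exists_l1_control_bHZPIfam) open B9MultiscaleSmoothPartitionYNear (rNear) open B9GeoLemma21KLevelV1 (rowSum261_geo9Y)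 open B9RWSumsDefinitePins (PinPrims.rate_pos) open B9Eq3132FromStateR (s3132Nu_opsYSectE_of_stepS_R_of_refinesY) open B9StateAprioriL1 (exists_l1_control_bHK exists_l1_control_bHS) open B9MultiscaleSmoothPartitionYLip (CLip_nonneg) open B9Thm312WholeClasses (rwt rwt_nonneg) open B9LeafXCodedKnitU (b9LeafX_carriersYU) open B9SectBCodedClassR (regC335 regC336 bg9YC extraYPb classIncl_regC335Pb_regYPb335 classIncl_regC336Pb_regYPb336 classIncl_regYPb335_regC335Pb) open Node00 (Y9OfRecordUPb carriersYU CfgY BlkY IBondY deltaAY) open B9Eq360DeltaPrimeAY (AfldY) open B9PinMembersKLevelV1 (mstar_le_M) open B9LettersZSchemasMono (kernel_mono letters313DMZ_mono)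
open Summit.QuantumFields.YangMills.BalabanUVNodes.N06AtOpsYNuOfRecordV6EPairVH (b9LeafXUR_opsYNuOfRecordV6E_pairVH) open Literature.MathematicalPhysics.QuantumFieldTheory.Balaban1983to89.B9SectionCarryingMembersV1 (SCMemberY)

set_option maxHeartbeats 800000 in set_option synthInstance.maxSize 2048 in set_option maxRecDepth 8192 in
/-- **★★★★ THE K1 FACE AT THE Z3 MEMBER, EDITION «N09T5» AT N06's EDITION «VH», INSTANTIATION (α5)** — K1⁹ `StabilityBRunRowsAtRecordR13SepCoPHV` (stmt-QuantumFields-27364) BY ITS ROUTE NAME: ONE `refine` of the «N09T3»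
engine's §2 (the two REGISTERED V22-Z stubs displayed BY NAME; per-door rows at the Gauss pin of `θZB(π)`, `εbg := a₀`, printed z) with NODE N06's leaf = a per-door `have` TYPED AT N06's OBJECT OF RECORD
`B9LeafX (Y9OfRecordUPb 2 (stage3OfFamily F) (Mstar F) (opsYNuStOfRecordV4PE 2 (stage3OfFamily F) (Mstar F) (𝔯 F) (sectEStYOfRecordV7 2 (stage3OfFamily F) (Mstar F) (𝔢₀ F)) (𝔴 F) (𝔈 F)) SCMemberY.val (bR F) SCMemberY.ιBsc (C38 F))` proved by dag-n06-d's certificate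
`N06AtOpsYNuOfRecordV6EPairVH.b9LeafXUR_opsYNuOfRecordV6E_pairVH` (edition «VH») at the door view (instantiation (α5): `J` = the surjective-`β` members, `f := Subtype.val`, `ιB ∕ hι` by `Function.surjInv ∕ surjInv_eq`; its other binders = this theorem's N06 hypotheses VERBATIM, Skolemised in `F`) and fed to the engine's carrier-generic (junk-inhabitable —
header) socket as `⟨_, h06 F …⟩`; NODE N07's leaf by `⟨ζ.withSectE E, CarriersZSectE.b11Leaf_Z11OfRecord_withSectE_of_parts …⟩` from `hN07`; NODE N08's slot by dag-n08-w4's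
`printedUV3V_at_slotOfRecord_of_coreLTAtAC_of_massBoundZAE_of_consts` from `hN08`; NODE N09's THEOREM-3 door by dag-n09-w2's `thm3Member_forall_stage13SepCoPH_onDomains_of_axialOn_of_reg8_of_suppPt`
INSIDE the engine from `hN09T` (`hle := le_rfl`; threshold `ε₀ := 2a₀∕L²` chosen inside); N05 through ζ-L at `Slot8κ′` with print's trace state by name.  CONDITIONAL (every family displayed; audit
`proof.conditional`); not a closure; NO stub used as proved; N06 ∕ N07 ∕ N08 ∕ N09 ∕ N10 ∕ N11 ∕ N13 NOT discharged; no N06 → K1 credit claimed; no count moved.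
[cite: Balaban1985BackgroundPropagators, Thms 3.1–3.15 pp.397–432, (3.40)–(3.47) pp.397–398, (3.87)–(3.90) pp.408–409, (3.117)–(3.121) p.419; Balaban1985RegularSpaces, Lemma 1 p.79 – Thm 8 p.101, Prop. 5 p.94, Prop. 6 p.99; Balaban1989LargeFieldII, Thm 1 p.355, (0.1) pp.355–356, (0.15) p.360; Balaban1988Convergent, Theorem p.245, Cor. 3 (2.50) p.264, (3.16)–(3.25) pp.268–270; Balaban1987RG1, (0.14)–(0.17) pp.254–255, Thm 3 p.264, §1 pp.263–264; Balaban1988RG2Cluster, Lemmas 1–3 pp.9–20; Balaban1985Variational, Thm 1 p.279, Props 2–9 pp.281–309, Sect. E (111)–(121) pp.293–296; Balaban1985UV3, Thm 1 p.257, Thm 2 p.272, (41) p.266 (bookkeeping)] -/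
theorem N24_stabilityBRunRowsAtRecordR13SepCoPHV_byName_of_registeredStubsGridGZ_of_n06TorusDataLettersLSlot8KappaPrime_n06CertificateVHSC_n07PartsSectE_n08ResidualAC_doorPinned_n09Thm3Inputs_trM2_stage3DoorFree_n13LevelZero_atGaussPinPrintedZB_pinY_of_runRowsCont (M₁ R : ℕ) (hM₁ : 1 ≤ M₁) (ε : ℝ) (hεz : 0 < ε)
    (Efl : T4Family → ℕ → ℝ → ℝ → ℝ → ℝ → ℝ → ℝ → ℝ → B12.RunParams → ℕ → ℝ)
    -- K0⁷'s display = EXACTLY the two REGISTERED V22-Z stubs BY NAME (ym-nodeO DEF-1 `Theorems/BalabanUVNodesK0V22ZDefs` §1, skeleton fe2ecbb43f63b100 :73–78 ∕ :84–96):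
    -- stub 1-G‴ = `Prop8StepCoPGridGAt F`, stub 3ᴬ′-G‴-Z = `AbsBetaBoxAtThm1WitnessCCMGenGridGZAt F`; the LOCATED-K0ε₀ letter is DERIVED inside (DEF-1 g29 `K0ZBWitnessBetaEps0`: β of record at the
    -- Z3 member is ε₀-BLIND by `rfl`, so the Eps0 text follows from the registered one — editions «N09T3»∕«N09T5»; «N09T5» consumes the families at the door `ε₀ := a₀`)
    (h1G3 : ∀ F : T4Family, Prop8StepCoPGridGAt F)
    (h3 : ∀ F : T4Family, AbsBetaBoxAtThm1WitnessCCMGenGridGZAt F)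
    -- N05∕N06 SLOT (per F): print's trace state `(τ, C_τ)` is OFF this display since edition «Tr» — a THEOREM at the record algebra `(stage3OfFamily F).𝔸 = M₂(ℂ)` (NODE 00 `Record12NumericsFamilyTraceState`), fed in the proof
    (hN06 : ∀ (F : T4Family) [FiniteDimensional ℝ (stage3OfFamily F).𝔸],
      ∃ (β : ℝ) (len : B7Prop1Explicit.Site (stage3OfFamily F).D → ℝ) (B₀'H B₂' BG BR cL : ℝ),
        0 ≤ β ∧ (∀ v : B7Prop1Explicit.Site (stage3OfFamily F).D, 0 < len v → 1 ≤ len v) ∧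
        0 < B₀'H ∧ 0 ≤ B₂' ∧ 0 ≤ BG ∧ 0 ≤ BR ∧ 0 < cL ∧
        (∀ a : IdxB8SubDPerκ (stage3OfFamily F) (M₁ * (stage3OfFamily F).L) M₁ R, ∀ α₀ : ℝ, 0 < α₀ → α₀ ≤ cL → ∀ U₀ : B7Prop1Explicit.Site (stage3OfFamily F).D → Fin (stage3OfFamily F).D → (stage3OfFamily F).𝔸ˣ, (∀ x κ, U₀ x κ ∈ unitaryUnits (stage3OfFamily F).𝔸) → IsPeriodic (M₁ * (stage3OfFamily F).L) U₀ →
      InAk (stage3OfFamily F).L a.toZdIdx.k a.toZdIdx.η α₀ a.toZdIdx.Ω U₀ → ∀ n, 1 ≤ n → n ≤ a.toZdIdx.k →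
      ∃ (g Δ : (B7Prop1Explicit.Site (stage3OfFamily F).D → (stage3OfFamily F).𝔸) →ₗ[ℂ] (B7Prop1Explicit.Site (stage3OfFamily F).D → (stage3OfFamily F).𝔸)) (q : (B7Prop1Explicit.Site (stage3OfFamily F).D → (stage3OfFamily F).𝔸) →ₗ[ℂ] (ℕ → B7Prop1Explicit.Site (stage3OfFamily F).D → (stage3OfFamily F).𝔸)) (qs : (ℕ → B7Prop1Explicit.Site (stage3OfFamily F).D → (stage3OfFamily F).𝔸) →ₗ[ℂ] (B7Prop1Explicit.Site (stage3OfFamily F).D → (stage3OfFamily F).𝔸))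
        (Aw c : (ℕ → B7Prop1Explicit.Site (stage3OfFamily F).D → (stage3OfFamily F).𝔸) →ₗ[ℂ] (ℕ → B7Prop1Explicit.Site (stage3OfFamily F).D → (stage3OfFamily F).𝔸)) (H' : XSpace (stage3OfFamily F).D n (stage3OfFamily F).𝔸 →ₗ[ℂ] (B7Prop1Explicit.Site (stage3OfFamily F).D → (stage3OfFamily F).𝔸)),
        (∀ x, (∀ (z : B7Prop1Explicit.Site (stage3OfFamily F).D) (i : Fin (stage3OfFamily F).D), x (z + ((M₁ * (stage3OfFamily F).L) : ℤ) • B7Prop1Explicit.e i) = x z) → ∀ y ∈ a.toZdIdx.Ω 0, (Δ (g x) + qs (Aw (q (g x)))) y = x y) ∧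
        (∀ f, (∀ (z : B7Prop1Explicit.Site (stage3OfFamily F).D) (i : Fin (stage3OfFamily F).D), f (z + ((M₁ * (stage3OfFamily F).L) : ℤ) • B7Prop1Explicit.e i) = f z) → q (g (g (qs (c (q f))))) = q f) ∧
        (∀ (f : B7Prop1Explicit.Site (stage3OfFamily F).D → (stage3OfFamily F).𝔸) (z : B7Prop1Explicit.Site (stage3OfFamily F).D) (i : Fin (stage3OfFamily F).D), g f (z + ((M₁ * (stage3OfFamily F).L) : ℤ) • B7Prop1Explicit.e i) = g f z) ∧
        (∀ f : B7Prop1Explicit.Site (stage3OfFamily F).D → (stage3OfFamily F).𝔸, (∀ (z : B7Prop1Explicit.Site (stage3OfFamily F).D) (i : Fin (stage3OfFamily F).D), f (z + ((M₁ * (stage3OfFamily F).L) : ℤ) • B7Prop1Explicit.e i) = f z) →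
      ∀ (z : B7Prop1Explicit.Site (stage3OfFamily F).D) (i : Fin (stage3OfFamily F).D), qs (c (q f)) (z + ((M₁ * (stage3OfFamily F).L) : ℤ) • B7Prop1Explicit.e i) = qs (c (q f)) z) ∧
        (∀ (f : B7Prop1Explicit.Site (stage3OfFamily F).D → (stage3OfFamily F).𝔸), ∀ x ∈ a.toZdIdx.Ω 0, Δ f x = covLap a.toZdIdx.η U₀ ((a.toZdIdx.Ω 0).indicator f) x) ∧
        (∀ (μ : ℕ → B7Prop1Explicit.Site (stage3OfFamily F).D → (stage3OfFamily F).𝔸), ∀ x ∈ a.toZdIdx.Ω 0, qs μ x = QT (stage3OfFamily F).L n (a.toZdIdx.Λs n) U₀ μ x) ∧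
        (∀ (f : B7Prop1Explicit.Site (stage3OfFamily F).D → (stage3OfFamily F).𝔸) (j : ℕ), j ≤ n → ∀ y ∈ a.toZdIdx.Λs n j, q f j y = QprimeIter (zdBlocking (stage3OfFamily F).D (stage3OfFamily F).L) (bgT (stage3OfFamily F).L U₀) j f y) ∧
        (∀ (X : XSpace (stage3OfFamily F).D n (stage3OfFamily F).𝔸) (x : B7Prop1Explicit.Site (stage3OfFamily F).D), ‖H' X x‖ ≤ B₀'H * ‖X‖) ∧
        (∀ j, j ≤ n → ∀ (X : XSpace (stage3OfFamily F).D n (stage3OfFamily F).𝔸), ∀ b ∈ {b : B7Prop1Explicit.Site (stage3OfFamily F).D × Fin (stage3OfFamily F).D | SideTouches (a.toZdIdx.Ω j) b.1 b.2},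
      wt (stage3OfFamily F).L a.toZdIdx.η j * ‖covDerivFwd a.toZdIdx.η U₀ b.2 (H' X) b.1‖ ≤ B₀'H * ‖X‖) ∧
        (∀ X : XSpace (stage3OfFamily F).D n (stage3OfFamily F).𝔸, Bd2 (stage3OfFamily F).L a.toZdIdx.η n a.toZdIdx.Ω (covLap a.toZdIdx.η U₀ (H' X)) (B₂' * ‖X‖)) ∧
        (∀ (X : XSpace (stage3OfFamily F).D n (stage3OfFamily F).𝔸) (x : B7Prop1Explicit.Site (stage3OfFamily F).D), x ∉ a.toZdIdx.Ω 0 → H' X x = 0) ∧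
        (∀ X Y : XSpace (stage3OfFamily F).D n (stage3OfFamily F).𝔸, (∀ b, Y b = -star (X b)) → ∀ x, H' Y x = -star (H' X x)) ∧
        (∀ X : XSpace (stage3OfFamily F).D n (stage3OfFamily F).𝔸, (∀ (b : Fin (n + 1) × B7Prop1Explicit.Site (stage3OfFamily F).D) (i : Fin (stage3OfFamily F).D), X (b.1, b.2 + (((M₁ * (stage3OfFamily F).L) : ℤ) / ((stage3OfFamily F).L : ℤ) ^ (b.1 : ℕ)) • B7Prop1Explicit.e i) = X b) →
      ∀ (z : B7Prop1Explicit.Site (stage3OfFamily F).D) (i : Fin (stage3OfFamily F).D), H' X (z + ((M₁ * (stage3OfFamily F).L) : ℤ) • B7Prop1Explicit.e i) = H' X z) ∧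
        (∀ (Y : XSpace (stage3OfFamily F).D n (stage3OfFamily F).𝔸), (∀ (b : Fin (n + 1) × B7Prop1Explicit.Site (stage3OfFamily F).D) (i : Fin (stage3OfFamily F).D), Y (b.1, b.2 + (((M₁ * (stage3OfFamily F).L) : ℤ) / ((stage3OfFamily F).L : ℤ) ^ (b.1 : ℕ)) • B7Prop1Explicit.e i) = Y b) →
      ∀ (j : ℕ) (hj : j ≤ n) (y : B7Prop1Explicit.Site (stage3OfFamily F).D), y ∈ a.toZdIdx.Λs n j →
      QprimeIter (zdBlocking (stage3OfFamily F).D (stage3OfFamily F).L) (bgT (stage3OfFamily F).L U₀) j (H' Y) y = Y (⟨j, Nat.lt_succ_of_le hj⟩, y)) ∧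
        (∀ (f : B7Prop1Explicit.Site (stage3OfFamily F).D → (stage3OfFamily F).𝔸) (r : ℝ), 0 ≤ r → Bd2 (stage3OfFamily F).L a.toZdIdx.η n a.toZdIdx.Ω f r →
      (∀ x, ‖g f x‖ ≤ BG * r) ∧ ∀ j, j ≤ n → ∀ b ∈ {b : B7Prop1Explicit.Site (stage3OfFamily F).D × Fin (stage3OfFamily F).D | SideTouches (a.toZdIdx.Ω j) b.1 b.2},
        wt (stage3OfFamily F).L a.toZdIdx.η j * ‖covDerivFwd a.toZdIdx.η U₀ b.2 (g f) b.1‖ ≤ BG * r) ∧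
        (∀ (f : B7Prop1Explicit.Site (stage3OfFamily F).D → (stage3OfFamily F).𝔸) (x : B7Prop1Explicit.Site (stage3OfFamily F).D), x ∉ a.toZdIdx.Ω 0 → g f x = 0) ∧
        (∀ f : B7Prop1Explicit.Site (stage3OfFamily F).D → (stage3OfFamily F).𝔸, (∀ j, j ≤ n → ∀ x ∈ a.toZdIdx.Ω j, IsSelfAdjoint (f x)) → ∀ x, IsSelfAdjoint (g f x)) ∧
        (∀ (f : B7Prop1Explicit.Site (stage3OfFamily F).D → (stage3OfFamily F).𝔸) (r : ℝ), 0 ≤ r → Bd2 (stage3OfFamily F).L a.toZdIdx.η n a.toZdIdx.Ω f r → Bd2 (stage3OfFamily F).L a.toZdIdx.η n a.toZdIdx.Ω (f - g (qs (c (q (g f))))) (BR * r)) ∧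
        (∀ f : B7Prop1Explicit.Site (stage3OfFamily F).D → (stage3OfFamily F).𝔸, (∀ j, j ≤ n → ∀ x ∈ a.toZdIdx.Ω j, IsSelfAdjoint (f x)) →
      ∀ j, j ≤ n → ∀ x ∈ a.toZdIdx.Ω j, IsSelfAdjoint ((f - g (qs (c (q (g f))))) x))) ∧
        (∀ a : IdxB8LanCκPer (stage3OfFamily F) (M₁ * (stage3OfFamily F).L) M₁ R, ∀ α₀ : ℝ, 0 < α₀ → α₀ ≤ cL → InAk (stage3OfFamily F).L a.toZdLanIdx.k a.toZdLanIdx.η α₀ a.toZdLanIdx.Ω a.toZdLanIdx.U₀ →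
      ∃ (g Δ : (B7Prop1Explicit.Site (stage3OfFamily F).D → (stage3OfFamily F).𝔸) →ₗ[ℂ] (B7Prop1Explicit.Site (stage3OfFamily F).D → (stage3OfFamily F).𝔸)) (q : (B7Prop1Explicit.Site (stage3OfFamily F).D → (stage3OfFamily F).𝔸) →ₗ[ℂ] (ℕ → B7Prop1Explicit.Site (stage3OfFamily F).D → (stage3OfFamily F).𝔸)) (qs : (ℕ → B7Prop1Explicit.Site (stage3OfFamily F).D → (stage3OfFamily F).𝔸) →ₗ[ℂ] (B7Prop1Explicit.Site (stage3OfFamily F).D → (stage3OfFamily F).𝔸))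
        (Aw c : (ℕ → B7Prop1Explicit.Site (stage3OfFamily F).D → (stage3OfFamily F).𝔸) →ₗ[ℂ] (ℕ → B7Prop1Explicit.Site (stage3OfFamily F).D → (stage3OfFamily F).𝔸)) (H' : XSpace (stage3OfFamily F).D a.toZdLanIdx.k (stage3OfFamily F).𝔸 →ₗ[ℂ] (B7Prop1Explicit.Site (stage3OfFamily F).D → (stage3OfFamily F).𝔸)),
        (∀ x : B7Prop1Explicit.Site (stage3OfFamily F).D → (stage3OfFamily F).𝔸, (∀ (z : B7Prop1Explicit.Site (stage3OfFamily F).D) (i : Fin (stage3OfFamily F).D), x (z + ((M₁ * (stage3OfFamily F).L) : ℤ) • B7Prop1Explicit.e i) = x z) → (∃ C : ℝ, ∀ y, ‖x y‖ ≤ C) →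
          g (Δ x + qs (Aw (q x))) = x) ∧
        (∀ φ : ℕ → B7Prop1Explicit.Site (stage3OfFamily F).D → (stage3OfFamily F).𝔸, (∀ n, n ≤ a.toZdLanIdx.k → ∀ (y : B7Prop1Explicit.Site (stage3OfFamily F).D) (i : Fin (stage3OfFamily F).D), φ n (y + (((M₁ * (stage3OfFamily F).L) : ℤ) / ((stage3OfFamily F).L : ℤ) ^ n) • B7Prop1Explicit.e i) = φ n y) →
          qs (c (q (g (g (qs φ))))) = qs φ) ∧
        (∀ (f : B7Prop1Explicit.Site (stage3OfFamily F).D → (stage3OfFamily F).𝔸), ∀ x ∈ a.toZdLanIdx.Ω 0, Δ f x = covLap a.toZdLanIdx.η a.toZdLanIdx.U₀ ((a.toZdLanIdx.Ω 0).indicator f) x) ∧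
        (∀ (μ : ℕ → B7Prop1Explicit.Site (stage3OfFamily F).D → (stage3OfFamily F).𝔸), ∀ x ∈ a.toZdLanIdx.Ω 0, qs μ x = QT (stage3OfFamily F).L a.toZdLanIdx.k a.toZdLanIdx.Λ a.toZdLanIdx.U₀ μ x) ∧
        (∀ (f : B7Prop1Explicit.Site (stage3OfFamily F).D → (stage3OfFamily F).𝔸) (n : ℕ), n ≤ a.toZdLanIdx.k → ∀ y ∈ a.toZdLanIdx.Λ n, q f n y = QprimeIter (zdBlocking (stage3OfFamily F).D (stage3OfFamily F).L) (bgT (stage3OfFamily F).L a.toZdLanIdx.U₀) n f y) ∧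
        (∀ (f : B7Prop1Explicit.Site (stage3OfFamily F).D → (stage3OfFamily F).𝔸) (n : ℕ) (y : B7Prop1Explicit.Site (stage3OfFamily F).D), ¬ (n ≤ a.toZdLanIdx.k ∧ y ∈ a.toZdLanIdx.Λ n) → q f n y = 0) ∧
        (∀ (f : B7Prop1Explicit.Site (stage3OfFamily F).D → (stage3OfFamily F).𝔸) (z : B7Prop1Explicit.Site (stage3OfFamily F).D) (i : Fin (stage3OfFamily F).D), g f (z + ((M₁ * (stage3OfFamily F).L) : ℤ) • B7Prop1Explicit.e i) = g f z) ∧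
        (∀ μ : ℕ → B7Prop1Explicit.Site (stage3OfFamily F).D → (stage3OfFamily F).𝔸, ∀ n, n ≤ a.toZdLanIdx.k → ∀ (y : B7Prop1Explicit.Site (stage3OfFamily F).D) (i : Fin (stage3OfFamily F).D), Aw μ n (y + (((M₁ * (stage3OfFamily F).L) : ℤ) / ((stage3OfFamily F).L : ℤ) ^ n) • B7Prop1Explicit.e i) = Aw μ n y) ∧
        (∀ (X : XSpace (stage3OfFamily F).D a.toZdLanIdx.k (stage3OfFamily F).𝔸) (x : B7Prop1Explicit.Site (stage3OfFamily F).D), ‖H' X x‖ ≤ B₀'H * ‖X‖) ∧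
        (∀ n, n ≤ a.toZdLanIdx.k → ∀ (X : XSpace (stage3OfFamily F).D a.toZdLanIdx.k (stage3OfFamily F).𝔸), ∀ b ∈ {b : B7Prop1Explicit.Site (stage3OfFamily F).D × Fin (stage3OfFamily F).D | SideTouches (a.toZdLanIdx.Ω n) b.1 b.2},
          wt (stage3OfFamily F).L a.toZdLanIdx.η n * ‖covDerivFwd a.toZdLanIdx.η a.toZdLanIdx.U₀ b.2 (H' X) b.1‖ ≤ B₀'H * ‖X‖) ∧
        (∀ X : XSpace (stage3OfFamily F).D a.toZdLanIdx.k (stage3OfFamily F).𝔸, Bd2 (stage3OfFamily F).L a.toZdLanIdx.η a.toZdLanIdx.k a.toZdLanIdx.Ω (covLap a.toZdLanIdx.η a.toZdLanIdx.U₀ (H' X)) (B₂' * ‖X‖)) ∧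
        (∀ X : XSpace (stage3OfFamily F).D a.toZdLanIdx.k (stage3OfFamily F).𝔸, (∀ (q : Fin (a.toZdLanIdx.k + 1) × B7Prop1Explicit.Site (stage3OfFamily F).D) (i : Fin (stage3OfFamily F).D), X (q.1, q.2 + (((M₁ * (stage3OfFamily F).L) : ℤ) / ((stage3OfFamily F).L : ℤ) ^ (q.1 : ℕ)) • B7Prop1Explicit.e i) = X q) →
          ∀ (z : B7Prop1Explicit.Site (stage3OfFamily F).D) (i : Fin (stage3OfFamily F).D), H' X (z + ((M₁ * (stage3OfFamily F).L) : ℤ) • B7Prop1Explicit.e i) = H' X z) ∧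
        (∀ (Y : XSpace (stage3OfFamily F).D a.toZdLanIdx.k (stage3OfFamily F).𝔸), (∀ (q : Fin (a.toZdLanIdx.k + 1) × B7Prop1Explicit.Site (stage3OfFamily F).D) (i : Fin (stage3OfFamily F).D), Y (q.1, q.2 + (((M₁ * (stage3OfFamily F).L) : ℤ) / ((stage3OfFamily F).L : ℤ) ^ (q.1 : ℕ)) • B7Prop1Explicit.e i) = Y q) →
          ∀ (n : ℕ) (hn : n ≤ a.toZdLanIdx.k) (y : B7Prop1Explicit.Site (stage3OfFamily F).D), y ∈ a.toZdLanIdx.Λ n →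
          QprimeIter (zdBlocking (stage3OfFamily F).D (stage3OfFamily F).L) (bgT (stage3OfFamily F).L a.toZdLanIdx.U₀) n (H' Y) y = Y (⟨n, Nat.lt_succ_of_le hn⟩, y)) ∧
        (∀ (f : B7Prop1Explicit.Site (stage3OfFamily F).D → (stage3OfFamily F).𝔸) (r : ℝ), 0 ≤ r → Bd2 (stage3OfFamily F).L a.toZdLanIdx.η a.toZdLanIdx.k a.toZdLanIdx.Ω f r →
          (∀ x, ‖g f x‖ ≤ BG * r) ∧ ∀ n, n ≤ a.toZdLanIdx.k → ∀ b ∈ {b : B7Prop1Explicit.Site (stage3OfFamily F).D × Fin (stage3OfFamily F).D | SideTouches (a.toZdLanIdx.Ω n) b.1 b.2},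
            wt (stage3OfFamily F).L a.toZdLanIdx.η n * ‖covDerivFwd a.toZdLanIdx.η a.toZdLanIdx.U₀ b.2 (g f) b.1‖ ≤ BG * r) ∧
        (∀ (f : B7Prop1Explicit.Site (stage3OfFamily F).D → (stage3OfFamily F).𝔸) (r : ℝ), 0 ≤ r → Bd2 (stage3OfFamily F).L a.toZdLanIdx.η a.toZdLanIdx.k a.toZdLanIdx.Ω f r →
          Bd2 (stage3OfFamily F).L a.toZdLanIdx.η a.toZdLanIdx.k a.toZdLanIdx.Ω (f - g (qs (c (q (g f))))) (BR * r))))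
    -- NODE N06's LEAF: dag-n06-d's Stage-11 certificate b9LeafXUR_opsYNuOfRecordV6E_pairVH — its binders VERBATIM (N := 2, θ.toStage3Params := stage3OfFamily F), Skolemised in F
    (Mstar : ∀ F : T4Family, ℕ) (𝔯 : ∀ F : T4Family, ResY 2 (stage3OfFamily F) (Mstar F)) (𝔢₀ : ∀ F : T4Family, SectEY 2 (stage3OfFamily F) (Mstar F)) (𝔴 : ∀ F : T4Family, RWEY 2 (stage3OfFamily F) (Mstar F)) (𝔈 : ∀ F : T4Family, ExpsY 2 (stage3OfFamily F) (Mstar F)) (𝔈₀ : ∀ F : T4Family, ExpsY 2 (stage3OfFamily F) (Mstar F)) (R₁ R₂ : ∀ F : T4Family, RegFamY (stage3OfFamily F).d₆ (stage3OfFamily F).ℓ₆ (stage3OfFamily F).hd' (stage3OfFamily F).hL' (stage3OfFamily F).b₀ (stage3OfFamily F).b₁ (Mstar F) (Matrix (Fin 2) (Fin 2) ℂ)) (c : ∀ F : T4Family, ℝ) (hcB : ∀ F : T4Family, c35B (stage3OfFamily F).ℓ₆ ≤ (c F)) (hc : ∀ F : T4Family, 0 < (c F)) (hGR : ∀ F :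 T4Family, MemOfFam (specialUnitaryUnits (Fin 2)) (R₁ F)) (hRP1 : ∀ F : T4Family, ∀ (x : MemberY (stage3OfFamily F).d₆ (stage3OfFamily F).ℓ₆ (stage3OfFamily F).hd' (stage3OfFamily F).hL' (stage3OfFamily F).b₀ (stage3OfFamily F).b₁ (Mstar F)) (α₀ : ℝ) (U : (bg9YR (Matrix (Fin 2) (Fin 2) ℂ) (specialUnitaryUnits (Fin 2)) (R₁ F) (R₂ F) x).Cfg), (bg9YR (Matrix (Fin 2) (Fin 2) ℂ) (specialUnitaryUnits (Fin 2)) (R₁ F) (R₂ F) x).Reg335 (c F) α₀ U → 0 ≤ α₀ ∧ (bg9YP (Matrix (Fin 2) (Fin 2) ℂ) (specialUnitaryUnits (Fin 2)) x).Reg335 c35Y α₀ U) (hRP2 : ∀ F : T4Family, ∀ (x : MemberY (stage3OfFamily F).d₆ (stage3OfFamily F).ℓ₆ (stage3OfFamily F).hd' (stage3OfFamily F).hL' (stage3OfFamily F).b₀ (stage3OfFamily F).b₁ (Mstar F)) (α₀ : ℝ) (U : (bg9YR (Matrix (Fin 2) (Fin 2) ℂ) (specialUnitaryUnits (Fin 2))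 (R₁ F) (R₂ F) x).Cfg), (bg9YR (Matrix (Fin 2) (Fin 2) ℂ) (specialUnitaryUnits (Fin 2)) (R₁ F) (R₂ F) x).Reg336 (c F) α₀ U → 0 ≤ α₀ ∧ (bg9YP (Matrix (Fin 2) (Fin 2) ℂ) (specialUnitaryUnits (Fin 2)) x).Reg336 c35Y α₀ U) (hP1 : ∀ F : T4Family, ClassIncl (regYP335 (Matrix (Fin 2) (Fin 2) ℂ) (specialUnitaryUnits (Fin 2))) c35Y (R₁ F) (c F)) (hP2 : ∀ F : T4Family, ClassIncl (regYP336 (Matrix (Fin 2) (Fin 2) ℂ) (specialUnitaryUnits (Fin 2))) c35Y (R₂ F) (c F)) (instN06_1 : ∀ F : T4Family, ∀ x : MemberY (stage3OfFamily F).d₆ (stage3OfFamily F).ℓ₆ (stage3OfFamily F).hd' (stage3OfFamily F).hL' (stage3OfFamily F).b₀ (stage3OfFamily F).b₁ (Mstar F), Fintype (geo9Y x).Site) (instN06_2 : ∀ F : T4Family, ∀ x : MemberY (stage3OfFamily F).d₆ (stage3OfFamily F).ℓ₆ (stage3OfFamily F).hd' (stage3OfFamily F).hL' (stage3OfFamily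 F).b₀ (stage3OfFamily F).b₁ (Mstar F), DecidableEq (geo9Y x).Site)
    (instN06_3 : ∀ F : T4Family, ∀ x : MemberY (stage3OfFamily F).d₆ (stage3OfFamily F).ℓ₆ (stage3OfFamily F).hd' (stage3OfFamily F).hL' (stage3OfFamily F).b₀ (stage3OfFamily F).b₁ (Mstar F), DecidableRel (RelB x.toKIdx)) (bI : ∀ F : T4Family, ∀ x : MemberY (stage3OfFamily F).d₆ (stage3OfFamily F).ℓ₆ (stage3OfFamily F).hd' (stage3OfFamily F).hL' (stage3OfFamily F).b₀ (stage3OfFamily F).b₁ (Mstar F), FBondY x.toKIdx → IBondY x.toKIdx) (hbI : ∀ F : T4Family, (bI F) = bIYOfRecord (stage3OfFamily F) (Mstar F)) (α' r39 δ39 B39 a39 M39 : ∀ F : T4Family, ℝ) (hα'0 : ∀ F : T4Family, 0 < (α' F)) (hα'1 : ∀ F : T4Family, (α' F) < 1) (hr39 : ∀ F : T4Family, 0 < (r39 F)) (hrδ39 : ∀ F : T4Family, (r39 F) ≤ (δ39 F)) (hB39 : ∀ F : T4Family, 0 < (B39 F)) (ha39 : ∀ F : T4Family, 0 < (a39 F))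 (hM39 : ∀ F : T4Family, 0 < (M39 F)) (h348 : ∀ F : T4Family, ∀ x : MemberY (stage3OfFamily F).d₆ (stage3OfFamily F).ℓ₆ (stage3OfFamily F).hd' (stage3OfFamily F).hL' (stage3OfFamily F).b₀ (stage3OfFamily F).b₁ (Mstar F), (M39 F) ≤ (geo9Y x).M → ∀ α₀ : ℝ, 0 < α₀ → (c F) * (geo9Y x).M * α₀ ≤ (a39 F) → ∀ U : (bg9YR (Matrix (Fin 2) (Fin 2) ℂ) (specialUnitaryUnits (Fin 2)) (R₁ F) (R₂ F) x).Cfg, (bg9YR (Matrix (Fin 2) (Fin 2) ℂ) (specialUnitaryUnits (Fin 2)) (R₁ F) (R₂ F) x).Reg335 (c F) α₀ U → Conv348Blk (oneCubeOps39YF (stage3OfFamily F) (Mstar F) (lettersYOfRecordV4P 2 (stage3OfFamily F) (Mstar F) (𝔯 F)) (bI F) x) (B39 F) (δ39 F) U) (ιA AA : ∀ F : T4Family, MemberY (stage3OfFamily F).d₆ (stage3OfFamily F).ℓ₆ (stage3OfFamily F).hd' (stage3OfFamily F).hL' (stage3OfFamily F).b₀ (stage3OfFamily F).b₁ (Mstar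 F) → Type) (instN06_4 : ∀ F : T4Family, ∀ x, Fintype ((ιA F) x)) (instN06_5 : ∀ F : T4Family, ∀ x, Fintype ((AA F) x)) (p q : ∀ F : T4Family, PinPrims) (hp : ∀ F : T4Family, (p F).OK) (hq : ∀ F : T4Family, (q F).OK) (hα3 : ∀ F : T4Family, 3 * (p F).α ≤ (1 - (p F).αF) * (1 - 2 * (p F).α)) (p3 q3 : ∀ F : T4Family, PairPrims) (hp3 : ∀ F : T4Family, (p3 F).OK) (hq3 : ∀ F : T4Family, (q3 F).OK) (pM qM : ∀ F : T4Family, MixedPrims) (hpM : ∀ F : T4Family, (pM F).OK) (hqM : ∀ F : T4Family, (qM F).OK) (H : ∀ F : T4Family, MemberY (stage3OfFamily F).d₆ (stage3OfFamily F).ℓ₆ (stage3OfFamily F).hd' (stage3OfFamily F).hL' (stage3OfFamily F).b₀ (stage3OfFamily F).b₁ (Mstar F) → Prop)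
    (hM₀ : ∀ F : T4Family, nbrM₀Y (stage3OfFamily F).d₆ (stage3OfFamily F).ℓ₆ (stage3OfFamily F).hd' (stage3OfFamily F).hL' (stage3OfFamily F).b₀ (stage3OfFamily F).b₁ 2 ≤ (Mstar F)) (hM₀' : ∀ F : T4Family, nbrM₀Y (stage3OfFamily F).d₆ (stage3OfFamily F).ℓ₆ (stage3OfFamily F).hd' (stage3OfFamily F).hL' (stage3OfFamily F).b₀ (stage3OfFamily F).b₁ (((stage3OfFamily F).ℓ₆ : ℝ) + 4) ≤ (Mstar F)) (hM₀B : ∀ F : T4Family, nbrM₀Y (stage3OfFamily F).d₆ (stage3OfFamily F).ℓ₆ (stage3OfFamily F).hd' (stage3OfFamily F).hL' (stage3OfFamily F).b₀ (stage3OfFamily F).b₁ (2 * (((stage3OfFamily F).d₆ : ℝ) + 1)) ≤ (Mstar F)) (𝔭 : ∀ F : T4Family, ∀ x : MemberY (stage3OfFamily F).d₆ (stage3OfFamily F).ℓ₆ (stage3OfFamily F).hd' (stage3OfFamily F).hL' (stage3OfFamily F).b₀ (stage3OfFamily F).b₁ (Mstar F), HolderProbes (geo9Y x) (bg9YR (Matrix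 (Fin 2) (Fin 2) ℂ) (specialUnitaryUnits (Fin 2)) (R₁ F) (R₂ F) x) (XSK (TrIdx 2) x.toKIdx) (XSK (TrIdx 2) x.toKIdx) (PK (SiteY x.toKIdx) (Fin ((stage3OfFamily F).d₆ + 1)) (TrIdx 2)) (PK (SiteY x.toKIdx) (Fin ((stage3OfFamily F).d₆ + 1)) (TrIdx 2))) (h𝔭 : ∀ F : T4Family, ∀ x : MemberY (stage3OfFamily F).d₆ (stage3OfFamily F).ℓ₆ (stage3OfFamily F).hd' (stage3OfFamily F).hL' (stage3OfFamily F).b₀ (stage3OfFamily F).b₁ (Mstar F), (𝔭 F) x = holderProbesSN x.toKIdx (trBasis 2) (bg9YR (Matrix (Fin 2) (Fin 2) ℂ) (specialUnitaryUnits (Fin 2)) (R₁ F) (R₂ F) x) (fun U => U) (lettersYOfRecordV4P 2 (stage3OfFamily F) (Mstar F) (𝔯 F) x).parS ((bI F) x)) (bHX : ∀ F : T4Family, ∀ x : MemberY (stage3OfFamily F).d₆ (stage3OfFamily F).ℓ₆ (stage3OfFamily F).hd' (stage3OfFamily F).hL' (stage3OfFamily F).b₀ (stage3OfFamily F).b₁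 (Mstar F), ℝ → BlockNorm (toB6 (geo9Y x) 1 ((H F) x)) ((XSK (TrIdx 2) x.toKIdx) → ℝ)) (hbHX : ∀ F : T4Family, ∀ x : MemberY (stage3OfFamily F).d₆ (stage3OfFamily F).ℓ₆ (stage3OfFamily F).hd' (stage3OfFamily F).hL' (stage3OfFamily F).b₀ (stage3OfFamily F).b₁ (Mstar F), (bHX F) x = fun ε => letI : Fintype (B9GeoNormsKLevelV1.geo9K x.toKIdx).Site := (inferInstance : Fintype (geo9Y x).Site); bHS x.toKIdx (sIK x.toKIdx ((bI F) x)) ε) (SH S3 SI : ∀ F : T4Family, ∀ x : MemberY (stage3OfFamily F).d₆ (stage3OfFamily F).ℓ₆ (stage3OfFamily F).hd' (stage3OfFamily F).hL' (stage3OfFamily F).b₀ (stage3OfFamily F).b₁ (Mstar F), ↥(cubes x.toKIdx.D.toDomains) → Finset (geo9Y x).Site)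
    (h36 : ∀ F : T4Family, ∀ x, (p F).M₁ ≤ (geo9Y x).M → ∀ α₀ : ℝ, 0 < α₀ → (c F) * (geo9Y x).M * α₀ ≤ (p F).a₁ → ∀ U : (bg9YR (Matrix (Fin 2) (Fin 2) ℂ) (specialUnitaryUnits (Fin 2)) (R₁ F) (R₂ F) x).Cfg, (bg9YR (Matrix (Fin 2) (Fin 2) ℂ) (specialUnitaryUnits (Fin 2)) (R₁ F) (R₂ F) x).Reg335 (c F) α₀ U → Local342 (opsWalkY x (trBasis 2) (bg9YR (Matrix (Fin 2) (Fin 2) ℂ) (specialUnitaryUnits (Fin 2)) (R₁ F) (R₂ F) x) (fun U => U) (parSymY x.toKIdx) ((bI F) x)) 1 ((H F) x) (p F).B₀ (p F).δ₀ U)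
    (h36H : ∀ F : T4Family, ∀ x, (p F).M₁ ≤ (geo9Y x).M → ∀ α₀ : ℝ, 0 < α₀ → (c F) * (geo9Y x).M * α₀ ≤ (p F).a₁ → ∀ U : (bg9YR (Matrix (Fin 2) (Fin 2) ℂ) (specialUnitaryUnits (Fin 2)) (R₁ F) (R₂ F) x).Cfg, (bg9YR (Matrix (Fin 2) (Fin 2) ℂ) (specialUnitaryUnits (Fin 2)) (R₁ F) (R₂ F) x).Reg335 (c F) α₀ U → HolderLegs37 (opsWalkY x (trBasis 2) (bg9YR (Matrix (Fin 2) (Fin 2) ℂ) (specialUnitaryUnits (Fin 2)) (R₁ F) (R₂ F) x) (fun U => U) (parSymY x.toKIdx) ((bI F) x)) ((𝔭 F) x) 1 ((H F) x) ((SH F) x) (p F).Bl (p F).δ₀ U ∧ HolderV37Dir (opsWalkY x (trBasis 2) (bg9YR (Matrix (Fin 2) (Fin 2) ℂ) (specialUnitaryUnits (Fin 2)) (R₁ F) (R₂ F) x) (fun U => U) (parSymY x.toKIdx) ((bI F) x)) (dirOpsWalkY x (trBasis 2) (bg9YR (Matrix (Fin 2) (Fin 2) ℂ) (specialUnitaryUnits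 (Fin 2)) (R₁ F) (R₂ F) x) (fun U => U) (parSymY x.toKIdx) ((bI F) x)) (dirLettersWalkY x (trBasis 2) (bg9YR (Matrix (Fin 2) (Fin 2) ℂ) (specialUnitaryUnits (Fin 2)) (R₁ F) (R₂ F) x) (fun U => U) (parSymY x.toKIdx) ((bI F) x)) ((𝔭 F) x) 1 ((H F) x) (p F).Bt (p F).δ₀ U ∧ (L2SecondLegs37 (opsWalkY x (trBasis 2) (bg9YR (Matrix (Fin 2) (Fin 2) ℂ) (specialUnitaryUnits (Fin 2)) (R₁ F) (R₂ F) x) (fun U => U) (parSymY x.toKIdx) ((bI F) x)) (dirOpsWalkY x (trBasis 2) (bg9YR (Matrix (Fin 2) (Fin 2) ℂ) (specialUnitaryUnits (Fin 2)) (R₁ F) (R₂ F) x) (fun U => U) (parSymY x.toKIdx) ((bI F) x)) 1 ((H F) x) ((S3 F) x) (p3 F).B3 (p F).δ₀ U ∧ (∀ q' μ, IsTransposePair ((dirLettersWalkY x (trBasis 2) (bg9YR (Matrix (Fin 2) (Fin 2) ℂ) (specialUnitaryUnits (Fin 2)) (R₁ F) (R₂ F) x) (fun U => U) (parSymY x.toKIdx)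 ((bI F) x)).Pt U q' μ) ((dirLettersWalkY x (trBasis 2) (bg9YR (Matrix (Fin 2) (Fin 2) ℂ) (specialUnitaryUnits (Fin 2)) (R₁ F) (R₂ F) x) (fun U => U) (parSymY x.toKIdx) ((bI F) x)).P U q' μ)) ∧ (∀ q', IsTransposePair ((opsWalkY x (trBasis 2) (bg9YR (Matrix (Fin 2) (Fin 2) ℂ) (specialUnitaryUnits (Fin 2)) (R₁ F) (R₂ F) x) (fun U => U) (parSymY x.toKIdx) ((bI F) x)).Ct U q') ((opsWalkY x (trBasis 2) (bg9YR (Matrix (Fin 2) (Fin 2) ℂ) (specialUnitaryUnits (Fin 2)) (R₁ F) (R₂ F) x) (fun U => U) (parSymY x.toKIdx) ((bI F) x)).Cop U q'))) ∧ (InputLegsPair37 (opsWalkY x (trBasis 2) (bg9YR (Matrix (Fin 2) (Fin 2) ℂ) (specialUnitaryUnits (Fin 2)) (R₁ F) (R₂ F) x) (fun U => U) (parSymY x.toKIdx) ((bI F) x)) (dirOpsWalkY x (trBasis 2) (bg9YR (Matrix (Fin 2) (Fin 2) ℂ) (specialUnitaryUnits (Fin 2)) (R₁ F) (R₂ F)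 x) (fun U => U) (parSymY x.toKIdx) ((bI F) x)) ((𝔭 F) x) 1 ((H F) x) ((bHX F) x) ((SI F) x) (p F).BI (p F).BI2 (p F).δ₀ U ∧ FactorsInputPair37Dir (opsWalkY x (trBasis 2) (bg9YR (Matrix (Fin 2) (Fin 2) ℂ) (specialUnitaryUnits (Fin 2)) (R₁ F) (R₂ F) x) (fun U => U) (parSymY x.toKIdx) ((bI F) x)) (dirOpsWalkY x (trBasis 2) (bg9YR (Matrix (Fin 2) (Fin 2) ℂ) (specialUnitaryUnits (Fin 2)) (R₁ F) (R₂ F) x) (fun U => U) (parSymY x.toKIdx) ((bI F) x)) (dirLettersWalkY x (trBasis 2) (bg9YR (Matrix (Fin 2) (Fin 2) ℂ) (specialUnitaryUnits (Fin 2)) (R₁ F) (R₂ F) x) (fun U => U) (parSymY x.toKIdx) ((bI F) x)) 1 ((H F) x) ((bHX F) x) (p F).θI (p F).δ₀ U))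
    (bHXT : ∀ F : T4Family, ∀ x : MemberY (stage3OfFamily F).d₆ (stage3OfFamily F).ℓ₆ (stage3OfFamily F).hd' (stage3OfFamily F).hL' (stage3OfFamily F).b₀ (stage3OfFamily F).b₁ (Mstar F), (bg9YR (Matrix (Fin 2) (Fin 2) ℂ) (specialUnitaryUnits (Fin 2)) (R₁ F) (R₂ F) x).Cfg → ℝ → BlockNorm (toB6 (geo9Y x) 1 ((H F) x)) ((XSK (TrIdx 2) x.toKIdx) → ℝ)) (hbHXT : ∀ F : T4Family, ∀ (x : MemberY (stage3OfFamily F).d₆ (stage3OfFamily F).ℓ₆ (stage3OfFamily F).hd' (stage3OfFamily F).hL' (stage3OfFamily F).b₀ (stage3OfFamily F).b₁ (Mstar F)) (U : (bg9YR (Matrix (Fin 2) (Fin 2) ℂ) (specialUnitaryUnits (Fin 2)) (R₁ F) (R₂ F) x).Cfg), (bHXT F) x U = fun ε => letI : Fintype (B9GeoNormsKLevelV1.geo9K x.toKIdx).Site := (inferInstance : Fintype (geo9Y x).Site); bHZPIfam (κ := TrIdx 2) x.toKIdx (trBasis 2) (taxiS x.toKIdx (bg9YR (Matrix (Fin 2)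 (Fin 2) ℂ) (specialUnitaryUnits (Fin 2)) (R₁ F) (R₂ F) x) (fun U => U) U) (R := (1 : ℝ)) (H := (H F) x) ε) (hopI : ∀ F : T4Family, ∀ x, (p F).M₁ ≤ (geo9Y x).M → ∀ α₀ : ℝ, 0 < α₀ → (c F) * (geo9Y x).M * α₀ ≤ (p F).a₁ → ∀ U : (bg9YR (Matrix (Fin 2) (Fin 2) ℂ) (specialUnitaryUnits (Fin 2)) (R₁ F) (R₂ F) x).Cfg, (bg9YR (Matrix (Fin 2) (Fin 2) ℂ) (specialUnitaryUnits (Fin 2)) (R₁ F) (R₂ F) x).Reg335 (c F) α₀ U → InputLegsPair37 (opsWalkY x (trBasis 2) (bg9YR (Matrix (Fin 2) (Fin 2) ℂ) (specialUnitaryUnits (Fin 2)) (R₁ F) (R₂ F) x) (fun U => U) (parSymY x.toKIdx) ((bI F) x)) (dirOpsWalkY x (trBasis 2) (bg9YR (Matrix (Fin 2) (Fin 2) ℂ) (specialUnitaryUnits (Fin 2)) (R₁ F) (R₂ F) x) (fun U => U) (parSymY x.toKIdx) ((bI F) x)) ((𝔭 F) x) 1 ((H F) x) ((bHXT F) x U)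 ((SI F) x) (p F).BI (p F).BI2 (p F).δ₀ U ∧ FactorsInputPair37Dir (opsWalkY x (trBasis 2) (bg9YR (Matrix (Fin 2) (Fin 2) ℂ) (specialUnitaryUnits (Fin 2)) (R₁ F) (R₂ F) x) (fun U => U) (parSymY x.toKIdx) ((bI F) x)) (dirOpsWalkY x (trBasis 2) (bg9YR (Matrix (Fin 2) (Fin 2) ℂ) (specialUnitaryUnits (Fin 2)) (R₁ F) (R₂ F) x) (fun U => U) (parSymY x.toKIdx) ((bI F) x)) (dirLettersWalkY x (trBasis 2) (bg9YR (Matrix (Fin 2) (Fin 2) ℂ) (specialUnitaryUnits (Fin 2)) (R₁ F) (R₂ F) x) (fun U => U) (parSymY x.toKIdx) ((bI F) x)) 1 ((H F) x) ((bHXT F) x U) (p F).θI (p F).δ₀ U) (hM1mix : ∀ F : T4Family, MMix (stage3OfFamily F).d₆ (stage3OfFamily F).ℓ₆ (stage3OfFamily F).hd' (stage3OfFamily F).hL' (stage3OfFamily F).b₀ (stage3OfFamily F).b₁ (Mstar F) 2 (c F) (hc F) ≤ (p F).M₁)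
    (ha1mix : ∀ F : T4Family, (p F).a₁ ≤ aMix (stage3OfFamily F).d₆ (stage3OfFamily F).ℓ₆ (stage3OfFamily F).hd' (stage3OfFamily F).hL' (stage3OfFamily F).b₀ (stage3OfFamily F).b₁ (Mstar F) 2 (c F) (hc F)) (hBMmix : ∀ F : T4Family, BMix (stage3OfFamily F).d₆ (stage3OfFamily F).ℓ₆ (stage3OfFamily F).hd' (stage3OfFamily F).hL' (stage3OfFamily F).b₀ (stage3OfFamily F).b₁ (Mstar F) 2 (c F) (hc F) ≤ (pM F).BM) (hδmix : ∀ F : T4Family, (p F).δ₀ ≤ δMix (stage3OfFamily F).d₆ (stage3OfFamily F).ℓ₆ (stage3OfFamily F).hd' (stage3OfFamily F).hL' (stage3OfFamily F).b₀ (stage3OfFamily F).b₁ (Mstar F) 2 (c F) (hc F)) (hM1fac : ∀ F : T4Family, MRec (stage3OfFamily F).d₆ (stage3OfFamily F).ℓ₆ (stage3OfFamily F).hd' (stage3OfFamily F).hL' (stage3OfFamily F).b₀ (stage3OfFamily F).b₁ (Mstar F) 2 (c F) (hc F) ≤ (p F).M₁) (ha1fac : ∀ F : T4Family, (p F).a₁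 ≤ aRec (stage3OfFamily F).d₆ (stage3OfFamily F).ℓ₆ (stage3OfFamily F).hd' (stage3OfFamily F).hL' (stage3OfFamily F).b₀ (stage3OfFamily F).b₁ (Mstar F) 2 (c F) (hc F)) (hδfac : ∀ F : T4Family, (p F).δ₀ ≤ δRec (stage3OfFamily F).d₆ (stage3OfFamily F).ℓ₆ (stage3OfFamily F).hd' (stage3OfFamily F).hL' (stage3OfFamily F).b₀ (stage3OfFamily F).b₁ (Mstar F) 2 (c F) (hc F)) (hθfac : ∀ F : T4Family, (p F).θ₀ * Real.exp ((3 / 4 + (p F).δ₀) * (p F).ρ) * BRec (stage3OfFamily F).d₆ (stage3OfFamily F).ℓ₆ (stage3OfFamily F).hd' (stage3OfFamily F).hL' (stage3OfFamily F).b₀ (stage3OfFamily F).b₁ (Mstar F) 2 (c F) (hc F) ≤ (pM F).θM) (hcntH : ∀ F : T4Family, ∀ x (a : (geo9Y x).Site), (∑ cᵢ, if a ∈ (SH F) x cᵢ then (1 : ℝ) else 0) ≤ (p F).NH) (hcnt3 : ∀ F : T4Family, ∀ x (a : (geo9Y x).Site), (∑ cᵢ, if a ∈ (S3 F) x cᵢ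 then (1 : ℝ) else 0) ≤ (p3 F).N3) (hcntI : ∀ F : T4Family, ∀ x (a : (geo9Y x).Site), (∑ cᵢ, if a ∈ (SI F) x cᵢ then (1 : ℝ) else 0) ≤ (p F).NI) (hMw : ∀ F : T4Family, ∀ x : MemberY (stage3OfFamily F).d₆ (stage3OfFamily F).ℓ₆ (stage3OfFamily F).hd' (stage3OfFamily F).hL' (stage3OfFamily F).b₀ (stage3OfFamily F).b₁ (Mstar F), walkCntM₀Y (stage3OfFamily F).d₆ (stage3OfFamily F).ℓ₆ (stage3OfFamily F).hd' (stage3OfFamily F).hL' (stage3OfFamily F).b₀ (stage3OfFamily F).b₁ (Mstar F) ≤ (geo9Y x).M) (hNMw : ∀ F : T4Family, walkCntY (stage3OfFamily F).d₆ (stage3OfFamily F).ℓ₆ (stage3OfFamily F).hd' (stage3OfFamily F).hL' (stage3OfFamily F).b₀ (stage3OfFamily F).b₁ (Mstar F) ≤ (pM F).NM)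
    (hM3 : ∀ F : T4Family, nbrM₀Y (stage3OfFamily F).d₆ (stage3OfFamily F).ℓ₆ (stage3OfFamily F).hd' (stage3OfFamily F).hL' (stage3OfFamily F).b₀ (stage3OfFamily F).b₁ 3 ≤ (Mstar F)) (hρ3 : ∀ F : T4Family, 3 ≤ (p F).ρ) (hNc : ∀ F : T4Family, walkCntY (stage3OfFamily F).d₆ (stage3OfFamily F).ℓ₆ (stage3OfFamily F).hd' (stage3OfFamily F).hL' (stage3OfFamily F).b₀ (stage3OfFamily F).b₁ (Mstar F) ≤ (p F).Nc) (hN' : ∀ F : T4Family, walkCntY (stage3OfFamily F).d₆ (stage3OfFamily F).ℓ₆ (stage3OfFamily F).hd' (stage3OfFamily F).hL' (stage3OfFamily F).b₀ (stage3OfFamily F).b₁ (Mstar F) ≤ (p F).N') (hCℓ : ∀ F : T4Family, ((((stage3OfFamily F).ℓ₆ + 1 : ℕ) : ℝ)) ^ 2 ≤ (p F).Cℓ) (hKc : ∀ F : T4Family, KcWalkY (stage3OfFamily F).d₆ (stage3OfFamily F).ℓ₆ (stage3OfFamily F).hd' (stage3OfFamily F).hL' (stage3OfFamily F).b₀ (stage3OfFamily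 F).b₁ (trBasis 2) ≤ (p F).Kc) (hθ₀ : ∀ F : T4Family, thetaWalkY (stage3OfFamily F).d₆ (stage3OfFamily F).ℓ₆ (stage3OfFamily F).hd' (stage3OfFamily F).hL' (stage3OfFamily F).b₀ (stage3OfFamily F).b₁ (trBasis 2) (p F).Cℓ ≤ (p F).θ₀) (𝔬A : ∀ F : T4Family, ∀ x : MemberY (stage3OfFamily F).d₆ (stage3OfFamily F).ℓ₆ (stage3OfFamily F).hd' (stage3OfFamily F).hL' (stage3OfFamily F).b₀ (stage3OfFamily F).b₁ (Mstar F), Ops310 (geo9Y x) (bg9YR (Matrix (Fin 2) (Fin 2) ℂ) (specialUnitaryUnits (Fin 2)) (R₁ F) (R₂ F) x) (XBK (TrIdx 2) x.toKIdx) (XBK (TrIdx 2) x.toKIdx) ((ιA F) x) ((AA F) x)) (rdA : ∀ F : T4Family, ∀ x : MemberY (stage3OfFamily F).d₆ (stage3OfFamily F).ℓ₆ (stage3OfFamily F).hd' (stage3OfFamily F).hL' (stage3OfFamily F).b₀ (stage3OfFamily F).b₁ (Mstar F), WalkReading310 (geo9Y x) (bg9YR (Matrix (Fin 2) (Fin 2)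 ℂ) (specialUnitaryUnits (Fin 2)) (R₁ F) (R₂ F) x) (XBK (TrIdx 2) x.toKIdx) ((ιA F) x) ((AA F) x)) (𝔭A : ∀ F : T4Family, ∀ x : MemberY (stage3OfFamily F).d₆ (stage3OfFamily F).ℓ₆ (stage3OfFamily F).hd' (stage3OfFamily F).hL' (stage3OfFamily F).b₀ (stage3OfFamily F).b₁ (Mstar F), HolderProbes (geo9Y x) (bg9YR (Matrix (Fin 2) (Fin 2) ℂ) (specialUnitaryUnits (Fin 2)) (R₁ F) (R₂ F) x) (XBK (TrIdx 2) x.toKIdx) (XBK (TrIdx 2) x.toKIdx) (PK (FBondY x.toKIdx) (Fin ((stage3OfFamily F).d₆ + 1)) (TrIdx 2)) (PK (FBondY x.toKIdx) (Fin ((stage3OfFamily F).d₆ + 1)) (TrIdx 2)))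
    (h𝔭A : ∀ F : T4Family, ∀ x : MemberY (stage3OfFamily F).d₆ (stage3OfFamily F).ℓ₆ (stage3OfFamily F).hd' (stage3OfFamily F).hL' (stage3OfFamily F).b₀ (stage3OfFamily F).b₁ (Mstar F), (𝔭A F) x = holderProbesKA x.toKIdx (trBasis 2) (bg9YR (Matrix (Fin 2) (Fin 2) ℂ) (specialUnitaryUnits (Fin 2)) (R₁ F) (R₂ F) x) (fun U => U) (lettersYOfRecordV4P 2 (stage3OfFamily F) (Mstar F) (𝔯 F) x).parB ((bI F) x)) (𝔡A : ∀ F : T4Family, ∀ x : MemberY (stage3OfFamily F).d₆ (stage3OfFamily F).ℓ₆ (stage3OfFamily F).hd' (stage3OfFamily F).hL' (stage3OfFamily F).b₀ (stage3OfFamily F).b₁ (Mstar F), DirOps310 ((𝔬A F) x) (Fin ((stage3OfFamily F).d₆ + 1))) (𝔩A : ∀ F : T4Family, ∀ x : MemberY (stage3OfFamily F).d₆ (stage3OfFamily F).ℓ₆ (stage3OfFamily F).hd' (stage3OfFamily F).hL' (stage3OfFamily F).b₀ (stage3OfFamily F).b₁ (Mstar F), DirLetters310 ((𝔬A F) x)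 (Fin ((stage3OfFamily F).d₆ + 1))) (bHXA : ∀ F : T4Family, ∀ x : MemberY (stage3OfFamily F).d₆ (stage3OfFamily F).ℓ₆ (stage3OfFamily F).hd' (stage3OfFamily F).hL' (stage3OfFamily F).b₀ (stage3OfFamily F).b₁ (Mstar F), ℝ → BlockNorm (toB6 (geo9Y x) 1 ((H F) x)) ((XBK (TrIdx 2) x.toKIdx) → ℝ)) (κA : ∀ F : T4Family, MemberY (stage3OfFamily F).d₆ (stage3OfFamily F).ℓ₆ (stage3OfFamily F).hd' (stage3OfFamily F).hL' (stage3OfFamily F).b₀ (stage3OfFamily F).b₁ (Mstar F) → Sizes310) (SHA S3A SIA SMA S2A : ∀ F : T4Family, ∀ x : MemberY (stage3OfFamily F).d₆ (stage3OfFamily F).ℓ₆ (stage3OfFamily F).hd' (stage3OfFamily F).hL' (stage3OfFamily F).b₀ (stage3OfFamily F).b₁ (Mstar F), (ιA F) x → Finset (geo9Y x).Site) (hbHXA : ∀ F : T4Family, ∀ x : MemberY (stage3OfFamily F).d₆ (stage3OfFamily F).ℓ₆ (stage3OfFamily F).hd' (stage3OfFamily F).hL' (stage3OfFamily F).b₀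 (stage3OfFamily F).b₁ (Mstar F), (bHXA F) x = fun ε => letI : Fintype (B9GeoNormsKLevelV1.geo9K x.toKIdx).Site := (inferInstance : Fintype (geo9Y x).Site); bHK x.toKIdx ((bI F) x) ε) (hstA : ∀ F : T4Family, ∀ x, StaticOK310 ((𝔬A F) x) (q F).ρ (q F).Nc (q F).N' (q F).NF (q F).Cℓ ((κA F) x)) (hκA : ∀ F : T4Family, ∀ x, ((κA F) x).Bounded (q F).Kc) (hrdA : ∀ F : T4Family, ∀ x, ((rdA F) x).OKRel ((𝔬A F) x).blk (RelB x.toKIdx)) (hlocA : ∀ F : T4Family, ∀ x, Locality310 ((𝔬A F) x) ((rdA F) x))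
    (h36A : ∀ F : T4Family, ∀ x, (q F).M₁ ≤ (geo9Y x).M → ∀ α₀ : ℝ, 0 < α₀ → (c F) * (geo9Y x).M * α₀ ≤ (q F).a₁ → ∀ U : (bg9YR (Matrix (Fin 2) (Fin 2) ℂ) (specialUnitaryUnits (Fin 2)) (R₁ F) (R₂ F) x).Cfg, (bg9YR (Matrix (Fin 2) (Fin 2) ℂ) (specialUnitaryUnits (Fin 2)) (R₁ F) (R₂ F) x).Reg335 (c F) α₀ U → Local342G ((𝔬A F) x) 1 ((H F) x) (q F).B₀ (q F).δ₀ U ∧ B9Thm310Whole.Factors389 ((𝔬A F) x) 1 ((H F) x) (q F).θ₀ (q F).δ₀ U ∧ Identities310₂ ((𝔬A F) x) ((𝔡A F) x) ((𝔩A F) x) 1 ((H F) x) U) (hGsqA : ∀ F : T4Family, ∀ x, (q F).M₁ ≤ (geo9Y x).M → ∀ α₀ : ℝ, 0 < α₀ → (c F) * (geo9Y x).M * α₀ ≤ (q F).a₁ → ∀ U : (bg9YR (Matrix (Fin 2) (Fin 2) ℂ) (specialUnitaryUnits (Fin 2)) (R₁ F) (R₂ F) x).Cfg, (bg9YR (Matrix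 (Fin 2) (Fin 2) ℂ) (specialUnitaryUnits (Fin 2)) (R₁ F) (R₂ F) x).Reg335 (c F) α₀ U → ∀ i, IsTransposePair (((𝔬A F) x).Gsq U i) (((𝔬A F) x).Gsq U i) ∧ ∀ v, 0 ≤ v ⬝ᵥ ((𝔬A F) x).Gsq U i v) (h36HA : ∀ F : T4Family, ∀ x, (q F).M₁ ≤ (geo9Y x).M → ∀ α₀ : ℝ, 0 < α₀ → (c F) * (geo9Y x).M * α₀ ≤ (q F).a₁ → ∀ U : (bg9YR (Matrix (Fin 2) (Fin 2) ℂ) (specialUnitaryUnits (Fin 2)) (R₁ F) (R₂ F) x).Cfg, (bg9YR (Matrix (Fin 2) (Fin 2) ℂ) (specialUnitaryUnits (Fin 2)) (R₁ F) (R₂ F) x).Reg335 (c F) α₀ U → HolderLegs310 ((𝔬A F) x) ((𝔭A F) x) 1 ((H F) x) ((SHA F) x) (q F).Bl (q F).δ₀ U ∧ FactorsHolder310 ((𝔬A F) x) ((𝔭A F) x) 1 ((H F) x) (q F).Bt (q F).δ₀ U ∧ (L2SecondLegs310 ((𝔬A F) x) ((𝔡A F) x) 1 ((H F) x) ((S3A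 F) x) (q3 F).B3 (q F).δ₀ U ∧ ∀ a, IsTransposePair (((𝔬A F) x).Rt U a) (((𝔬A F) x).Rf U a)) ∧ (InputLegsPair310 ((𝔬A F) x) ((𝔡A F) x) ((𝔭A F) x) 1 ((H F) x) ((bHXA F) x) ((SIA F) x) (q F).BI (q F).BI2 (q F).δ₀ U ∧ FactorsInputPair310 ((𝔬A F) x) ((𝔡A F) x) 1 ((H F) x) ((bHXA F) x) (q F).θI (q F).δ₀ U) ∧ (L2MixedLegs310 ((𝔬A F) x) ((𝔡A F) x) 1 ((H F) x) ((SMA F) x) (qM F).BM (q F).δ₀ U ∧ FactorsL2Mixed310 ((𝔬A F) x) ((𝔡A F) x) 1 ((H F) x) (qM F).θM (q F).δ₀ U)) (bHXTA : ∀ F : T4Family, ∀ x : MemberY (stage3OfFamily F).d₆ (stage3OfFamily F).ℓ₆ (stage3OfFamily F).hd' (stage3OfFamily F).hL' (stage3OfFamily F).b₀ (stage3OfFamily F).b₁ (Mstar F), (bg9YR (Matrix (Fin 2) (Fin 2) ℂ) (specialUnitaryUnits (Fin 2)) (R₁ F) (R₂ F) x).Cfg → ℝ → BlockNorm (toB6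 (geo9Y x) 1 ((H F) x)) ((XBK (TrIdx 2) x.toKIdx) → ℝ))
    (hbHXTA : ∀ F : T4Family, ∀ (x : MemberY (stage3OfFamily F).d₆ (stage3OfFamily F).ℓ₆ (stage3OfFamily F).hd' (stage3OfFamily F).hL' (stage3OfFamily F).b₀ (stage3OfFamily F).b₁ (Mstar F)) (U : (bg9YR (Matrix (Fin 2) (Fin 2) ℂ) (specialUnitaryUnits (Fin 2)) (R₁ F) (R₂ F) x).Cfg), (bHXTA F) x U = fun ε => letI : Fintype (B9GeoNormsKLevelV1.geo9K x.toKIdx).Site := (inferInstance : Fintype (geo9Y x).Site); bHZKPIfam (κ := TrIdx 2) x.toKIdx (trBasis 2) (taxiB x.toKIdx (bg9YR (Matrix (Fin 2) (Fin 2) ℂ) (specialUnitaryUnits (Fin 2)) (R₁ F) (R₂ F) x) (fun U => U) U) (R := (1 : ℝ)) (H := (H F) x) ε) (hopIA : ∀ F : T4Family, ∀ x, (q F).M₁ ≤ (geo9Y x).M → ∀ α₀ : ℝ, 0 < α₀ → (c F) * (geo9Y x).M * α₀ ≤ (q F).a₁ → ∀ U : (bg9YR (Matrix (Fin 2) (Fin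 2) ℂ) (specialUnitaryUnits (Fin 2)) (R₁ F) (R₂ F) x).Cfg, (bg9YR (Matrix (Fin 2) (Fin 2) ℂ) (specialUnitaryUnits (Fin 2)) (R₁ F) (R₂ F) x).Reg335 (c F) α₀ U → InputLegsPair310 ((𝔬A F) x) ((𝔡A F) x) ((𝔭A F) x) 1 ((H F) x) ((bHXTA F) x U) ((SIA F) x) (q F).BI (q F).BI2 (q F).δ₀ U ∧ FactorsInputPair310 ((𝔬A F) x) ((𝔡A F) x) 1 ((H F) x) ((bHXTA F) x U) (q F).θI (q F).δ₀ U) (h36A2 : ∀ F : T4Family, ∀ x, (q F).M₁ ≤ (geo9Y x).M → ∀ α₀ : ℝ, 0 < α₀ → (c F) * (geo9Y x).M * α₀ ≤ (q F).a₁ → ∀ U : (bg9YR (Matrix (Fin 2) (Fin 2) ℂ) (specialUnitaryUnits (Fin 2)) (R₁ F) (R₂ F) x).Cfg, (bg9YR (Matrix (Fin 2) (Fin 2) ℂ) (specialUnitaryUnits (Fin 2)) (R₁ F) (R₂ F) x).Reg335 (c F) α₀ U → L2TwoLegs310 ((𝔬A F) x) 1 ((H F) x) ((S2A F) x) (q F).B2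 (q F).δ₀ U ∧ FactorsL2_310 ((𝔬A F) x) 1 ((H F) x) (q F).θ2 (q F).δ₀ U) (hcntHA : ∀ F : T4Family, ∀ x (a : (geo9Y x).Site), (∑ cᵢ, if a ∈ (SHA F) x cᵢ then (1 : ℝ) else 0) ≤ (q F).NH) (hcnt3A : ∀ F : T4Family, ∀ x (a : (geo9Y x).Site), (∑ cᵢ, if a ∈ (S3A F) x cᵢ then (1 : ℝ) else 0) ≤ (q3 F).N3) (hcntIA : ∀ F : T4Family, ∀ x (a : (geo9Y x).Site), (∑ cᵢ, if a ∈ (SIA F) x cᵢ then (1 : ℝ) else 0) ≤ (q F).NI) (hcntMA : ∀ F : T4Family, ∀ x (a : (geo9Y x).Site), (∑ cᵢ, if a ∈ (SMA F) x cᵢ then (1 : ℝ) else 0) ≤ (qM F).NM) (hcnt2A : ∀ F : T4Family, ∀ x (a : (geo9Y x).Site), (∑ cᵢ, if a ∈ (S2A F) x cᵢ then (1 : ℝ) else 0) ≤ (q F).N2) (hblkA : ∀ F : T4Family, ∀ x : MemberY (stage3OfFamily F).d₆ (stage3OfFamily F).ℓ₆ (stage3OfFamily F).hd' (stage3OfFamily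 F).hL' (stage3OfFamily F).b₀ (stage3OfFamily F).b₁ (Mstar F), ((𝔬A F) x).blk = blkBK x.toKIdx ((bI F) x))
    (hblkYA : ∀ F : T4Family, ∀ x : MemberY (stage3OfFamily F).d₆ (stage3OfFamily F).ℓ₆ (stage3OfFamily F).hd' (stage3OfFamily F).hL' (stage3OfFamily F).b₀ (stage3OfFamily F).b₁ (Mstar F), ((𝔬A F) x).blkY = blkBK x.toKIdx ((bI F) x)) (hGcoA : ∀ F : T4Family, ∀ (x : MemberY (stage3OfFamily F).d₆ (stage3OfFamily F).ℓ₆ (stage3OfFamily F).hd' (stage3OfFamily F).hL' (stage3OfFamily F).b₀ (stage3OfFamily F).b₁ (Mstar F)) (U : (bg9YR (Matrix (Fin 2) (Fin 2) ℂ) (specialUnitaryUnits (Fin 2)) (R₁ F) (R₂ F) x).Cfg), ((𝔬A F) x).G U = GcoK x.toKIdx (trBasis 2) (bg9YR (Matrix (Fin 2) (Fin 2) ℂ) (specialUnitaryUnits (Fin 2)) (R₁ F) (R₂ F) x) (fun U => U) (lettersYOfRecordV4P 2 (stage3OfFamily F) (Mstar F) (𝔯 F) x).GA U) (hDcoA :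 ∀ F : T4Family, ∀ (x : MemberY (stage3OfFamily F).d₆ (stage3OfFamily F).ℓ₆ (stage3OfFamily F).hd' (stage3OfFamily F).hL' (stage3OfFamily F).b₀ (stage3OfFamily F).b₁ (Mstar F)) (U : (bg9YR (Matrix (Fin 2) (Fin 2) ℂ) (specialUnitaryUnits (Fin 2)) (R₁ F) (R₂ F) x).Cfg), ((𝔬A F) x).D U = DcoK x.toKIdx (trBasis 2) (bg9YR (Matrix (Fin 2) (Fin 2) ℂ) (specialUnitaryUnits (Fin 2)) (R₁ F) (R₂ F) x) (fun U => U) U) (hDscoA : ∀ F : T4Family, ∀ (x : MemberY (stage3OfFamily F).d₆ (stage3OfFamily F).ℓ₆ (stage3OfFamily F).hd' (stage3OfFamily F).hL' (stage3OfFamily F).b₀ (stage3OfFamily F).b₁ (Mstar F)) (U : (bg9YR (Matrix (Fin 2) (Fin 2) ℂ) (specialUnitaryUnits (Fin 2)) (R₁ F) (R₂ F) x).Cfg), ((𝔬A F) x).Dstar U = DscoK x.toKIdx (trBasis 2) (bg9YR (Matrix (Fin 2) (Fin 2) ℂ) (specialUnitaryUnits (Fin 2)) (R₁ F) (R₂ F)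 x) (fun U => U) U) (hLcoA : ∀ F : T4Family, ∀ (x : MemberY (stage3OfFamily F).d₆ (stage3OfFamily F).ℓ₆ (stage3OfFamily F).hd' (stage3OfFamily F).hL' (stage3OfFamily F).b₀ (stage3OfFamily F).b₁ (Mstar F)) (U : (bg9YR (Matrix (Fin 2) (Fin 2) ℂ) (specialUnitaryUnits (Fin 2)) (R₁ F) (R₂ F) x).Cfg), ((𝔬A F) x).Lap U = LcoK x.toKIdx (trBasis 2) (bg9YR (Matrix (Fin 2) (Fin 2) ℂ) (specialUnitaryUnits (Fin 2)) (R₁ F) (R₂ F) x) (fun U => U) U) (h𝔡Ad : ∀ F : T4Family, ∀ (x : MemberY (stage3OfFamily F).d₆ (stage3OfFamily F).ℓ₆ (stage3OfFamily F).hd' (stage3OfFamily F).hL' (stage3OfFamily F).b₀ (stage3OfFamily F).b₁ (Mstar F)) (U : (bg9YR (Matrix (Fin 2) (Fin 2) ℂ) (specialUnitaryUnits (Fin 2)) (R₁ F) (R₂ F) x).Cfg), ((𝔡A F) x).Dd U = fun μ => coordOpK (trBasis 2) (fun _ : Fin ((stage3OfFamily F).d₆ + 1) => cdBₗ x.toKIdx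 U μ))
    (h𝔡As : ∀ F : T4Family, ∀ (x : MemberY (stage3OfFamily F).d₆ (stage3OfFamily F).ℓ₆ (stage3OfFamily F).hd' (stage3OfFamily F).hL' (stage3OfFamily F).b₀ (stage3OfFamily F).b₁ (Mstar F)) (U : (bg9YR (Matrix (Fin 2) (Fin 2) ℂ) (specialUnitaryUnits (Fin 2)) (R₁ F) (R₂ F) x).Cfg), ((𝔡A F) x).Dsd U = fun μ => coordOpK (trBasis 2) (fun _ : Fin ((stage3OfFamily F).d₆ + 1) => cdsBₗ x.toKIdx U μ)) (hGsqAS : ∀ F : T4Family, ∀ (x : MemberY (stage3OfFamily F).d₆ (stage3OfFamily F).ℓ₆ (stage3OfFamily F).hd' (stage3OfFamily F).hL' (stage3OfFamily F).b₀ (stage3OfFamily F).b₁ (Mstar F)) (U : (bg9YR (Matrix (Fin 2) (Fin 2) ℂ) (specialUnitaryUnits (Fin 2)) (R₁ F) (R₂ F) x).Cfg) (j : (ιA F) x), ∃ (r : ℝ) (G : (FBondY x.toKIdx → Matrix (Fin 2) (Fin 2) ℂ) →ₗ[ℝ] (FBondY x.toKIdx → Matrix (Fin 2) (Fin 2) ℂ)),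 ((𝔬A F) x).Gsq U j = r • coordOpK (trBasis 2) (fun _ : Fin ((stage3OfFamily F).d₆ + 1) => G)) (𝔬12 : ∀ F : T4Family, ∀ x : MemberY (stage3OfFamily F).d₆ (stage3OfFamily F).ℓ₆ (stage3OfFamily F).hd' (stage3OfFamily F).hL' (stage3OfFamily F).b₀ (stage3OfFamily F).b₁ (Mstar F), B9Thm312Whole.Ops (geo9Y x) (bg9YR (Matrix (Fin 2) (Fin 2) ℂ) (specialUnitaryUnits (Fin 2)) (R₁ F) (R₂ F) x) (XBK (TrIdx 2) x.toKIdx) (XBK (TrIdx 2) x.toKIdx) (XHK (TrIdx 2) x.toKIdx) (XSK (TrIdx 2) x.toKIdx)) (h𝔬12 : ∀ F : T4Family, (𝔬12 F) = ops312YOfRecord 2 (stage3OfFamily F) (Mstar F) (𝔯 F) (R₁ F) (R₂ F) (bI F)) (h𝔈 : ∀ F : T4Family, (𝔈 F) = expsYOfRecordV2 2 (stage3OfFamily F) (Mstar F) (𝔯 F) (𝔈₀ F) (R₁ F) (R₂ F) (bI F) (α' F) (r39 F) (B39 F) (p F) (q F) (p3 F) (q3 F) (pM F) (qM F) (H F)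 (𝔬A F) (rdA F) (𝔬12 F)) (bH13 : ∀ F : T4Family, ∀ x : MemberY (stage3OfFamily F).d₆ (stage3OfFamily F).ℓ₆ (stage3OfFamily F).hd' (stage3OfFamily F).hL' (stage3OfFamily F).b₀ (stage3OfFamily F).b₁ (Mstar F), (bg9YR (Matrix (Fin 2) (Fin 2) ℂ) (specialUnitaryUnits (Fin 2)) (R₁ F) (R₂ F) x).Cfg → BlockNorm (toB6 (geo9Y x) 1 ((H F) x)) (XSK (TrIdx 2) x.toKIdx → ℝ)) (δ12₀ δK12 σ12 ρ12 a12 M12 B12₃ δ12₃ ρ13 α12 : ∀ F : T4Family, ℝ) (ρf12 : ∀ F : T4Family, ℝ) (hρf12 : ∀ F : T4Family, 0 < (ρf12 F)) (hρf1 : ∀ F : T4Family, (ρf12 F) + (σ12 F) ≤ (1 - (α12 F)) * (ρ12 F)) (hρf2 : ∀ F : T4Family, (ρf12 F) + 2 * (σ12 F) + (α12 F) * (ρ12 F) ≤ (ρ12 F)) (hB12₃ : ∀ F : T4Family, 0 ≤ (B12₃ F)) (hσ12 : ∀ F : T4Family, 0 < (σ12 F)) (hρ12 : ∀ F : T4Family,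 0 < (ρ12 F)) (hρS12 : ∀ F : T4Family, (ρ12 F) ≤ (δ12₀ F))
    (hρδ12 : ∀ F : T4Family, (ρ12 F) + 2 * (σ12 F) ≤ (δK12 F)) (hρ₃12 : ∀ F : T4Family, (ρ12 F) + (σ12 F) ≤ (δ12₃ F)) (ha12 : ∀ F : T4Family, 0 < (a12 F)) (hM12 : ∀ F : T4Family, 0 < (M12 F)) (hα12 : ∀ F : T4Family, 0 < (α12 F)) (hα12' : ∀ F : T4Family, (α12 F) ≤ 1 / 2) (hδ₃₀ : ∀ F : T4Family, (δ12₃ F) < (δ12₀ F)) (hδ12₀ : ∀ F : T4Family, (δ12₀ F) ≤ (1 - 3 * (q F).αF) * ((1 - 2 * (q F).α) * (q F).δ₀)) (t12 δT12 ρS σS : ∀ F : T4Family, ℝ) (ht12 : ∀ F : T4Family, 0 ≤ (t12 F)) (hσS : ∀ F : T4Family, 0 < (σS F)) (hρST : ∀ F : T4Family, (ρS F) ≤ (δT12 F)) (hρS₀ : ∀ F : T4Family, (ρS F) + (σS F) ≤ (δ12₀ F)) (hδKS : ∀ F : T4Family, (δK12 F) + (q F).αF * ((1 - 2 * (q F).α)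 * (q F).δ₀) ≤ (ρS F)) (hσSK : ∀ F : T4Family, (σS F) ≤ (δK12 F)) (bXH : ∀ F : T4Family, ∀ x : MemberY (stage3OfFamily F).d₆ (stage3OfFamily F).ℓ₆ (stage3OfFamily F).hd' (stage3OfFamily F).hL' (stage3OfFamily F).b₀ (stage3OfFamily F).b₁ (Mstar F), (bg9YR (Matrix (Fin 2) (Fin 2) ℂ) (specialUnitaryUnits (Fin 2)) (R₁ F) (R₂ F) x).Cfg → BlockNorm (toB6 (geo9Y x) 1 ((H F) x)) (XBK (TrIdx 2) x.toKIdx → ℝ)) (w13 wX : ∀ F : T4Family, ℝ → ℝ) (hw13₀ : ∀ F : T4Family, ∀ s, 0 ≤ (w13 F) s) (hw13₁ : ∀ F : T4Family, ∀ s, (w13 F) s ≤ 1) (hwX₀ : ∀ F : T4Family, ∀ s, 0 ≤ (wX F) s) (hwX₁ : ∀ F : T4Family, ∀ s, (wX F) s ≤ 1) (hbH13 : ∀ F : T4Family, ∀ (x : MemberY (stage3OfFamily F).d₆ (stage3OfFamily F).ℓ₆ (stage3OfFamily F).hd' (stage3OfFamily F).hL' (stage3OfFamily F).b₀ (stage3OfFamily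 F).b₁ (Mstar F)) (U : (bg9YR (Matrix (Fin 2) (Fin 2) ℂ) (specialUnitaryUnits (Fin 2)) (R₁ F) (R₂ F) x).Cfg), (bH13 F) x U = letI : Fintype (B9GeoNormsKLevelV1.geo9K x.toKIdx).Site := (inferInstance : Fintype (geo9Y x).Site); bHZPG (κ := TrIdx 2) x.toKIdx (trBasis 2) (taxiS x.toKIdx (bg9YR (Matrix (Fin 2) (Fin 2) ℂ) (specialUnitaryUnits (Fin 2)) (R₁ F) (R₂ F) x) (fun U => U) U) (R := (1 : ℝ)) (H := (H F) x) (w13 F) (hw13₀ F) (hw13₁ F))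
    (hbXH : ∀ F : T4Family, ∀ (x : MemberY (stage3OfFamily F).d₆ (stage3OfFamily F).ℓ₆ (stage3OfFamily F).hd' (stage3OfFamily F).hL' (stage3OfFamily F).b₀ (stage3OfFamily F).b₁ (Mstar F)) (U : (bg9YR (Matrix (Fin 2) (Fin 2) ℂ) (specialUnitaryUnits (Fin 2)) (R₁ F) (R₂ F) x).Cfg), (bXH F) x U = letI : Fintype (B9GeoNormsKLevelV1.geo9K x.toKIdx).Site := (inferInstance : Fintype (geo9Y x).Site); bHZKPG (κ := TrIdx 2) x.toKIdx (trBasis 2) (taxiB x.toKIdx (bg9YR (Matrix (Fin 2) (Fin 2) ℂ) (specialUnitaryUnits (Fin 2)) (R₁ F) (R₂ F) x) (fun U => U) U) (R := (1 : ℝ)) (H := (H F) x) (wX F) (hwX₀ F) (hwX₁ F)) (hρ13 : ∀ F : T4Family, 0 < (ρ13 F)) (hρ13ρ : ∀ F : T4Family, (ρ13 F) + 5 * (σ12 F) ≤ (ρ12 F)) (hσρ13 : ∀ F : T4Family, 3 * (σ12 F) < (1 - (α12 F)) * (ρ13 F)) (B13₄ : ∀ F : T4Family, ℝ) (Bx13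 : ∀ F : T4Family, ℝ → ℝ) (Br13 : ∀ F : T4Family, ℝ → ℝ → ℝ) (hB13₄ : ∀ F : T4Family, 0 ≤ (B13₄ F)) (hBr13 : ∀ F : T4Family, ∀ ε ε', 0 < ε' → ε' < 1 → ε' < ε → ε ≤ ε' + 1 → 0 ≤ (Br13 F) ε ε') (hBx13 : ∀ F : T4Family, ∀ β, 0 ≤ β → β < 1 → 0 ≤ (Bx13 F) β) (tJ δB rT : ∀ F : T4Family, ℝ) (ha1J : ∀ F : T4Family, 10 * (((stage3OfFamily F).ℓ₆ + 1 : ℕ) : ℝ) ^ 7 * (a12 F) ≤ 1) (htJ : ∀ F : T4Family, 2 * (((stage3OfFamily F).d₆ : ℝ) + 1) * ((((stage3OfFamily F).ℓ₆ + 1 : ℕ) : ℝ)) ^ 3 * (2 : ℝ) * (10 ^ 4 * (((stage3OfFamily F).d₆ : ℝ) + 1) * (10 * (((stage3OfFamily F).ℓ₆ + 1 : ℕ) : ℝ) ^ 7)) * Real.exp (3 * (δB F)) ≤ (tJ F)) (hrTP : ∀ F : T4Family, (rT F) ≤ min ((1 - 2 * (p F).α) * (p F).δ₀) (δ39 F)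 / 8) (hrTB : ∀ F : T4Family, (rT F) ≤ (δB F)) (hδT12 : ∀ F : T4Family, 0 ≤ (δT12 F)) (hδTr : ∀ F : T4Family, (δT12 F) + 3 * (σS F) + 3 * ((q F).αF * ((1 - 2 * (q F).α) * (q F).δ₀)) ≤ (rT F)) (ϑF : ∀ F : T4Family, ℝ) (hϑF : ∀ F : T4Family, 2 * (10 * ((((stage3OfFamily F).ℓ₆ + 1 : ℕ) : ℝ)) * (a12 F)) * (1 + 10 * ((((stage3OfFamily F).ℓ₆ + 1 : ℕ) : ℝ)) * (a12 F)) * Real.exp (4 * (10 * ((((stage3OfFamily F).ℓ₆ + 1 : ℕ) : ℝ)) * (a12 F))) * ((((stage3OfFamily F).ℓ₆ + 1 : ℕ) : ℝ)) ≤ (ϑF F)) (sch : ∀ F : T4Family, ℝ → ℝ) (hsch0 : ∀ F : T4Family, ∀ β', 0 ≤ β' → β' < 1 → 0 < (sch F) β') (hsch1 : ∀ F : T4Family, ∀ β', 0 ≤ β' → β' < 1 → (sch F) β' < 1) (hschβ : ∀ F : T4Family, ∀ β', 0 ≤ β' → β' < 1 → β' < (sch F) β') (hwsch : ∀ F : T4Family,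 ∀ β', 0 ≤ β' → β' < 1 → 0 < (w13 F) ((sch F) β')) (δ45 : ∀ F : T4Family, ℝ) (hδ45 : ∀ F : T4Family, (δ12₃ F) < (δ45 F)) (BZ : ∀ F : T4Family, ℝ → ℝ)
    (hBZ : ∀ F : T4Family, ∀ β', 0 ≤ β' → β' < 1 → 0 ≤ (BZ F) β') (hBZge : ∀ F : T4Family, ∀ β', 0 ≤ β' → β' < 1 → ((((stage3OfFamily F).ℓ₆ + 1 : ℕ) : ℝ)) * inputConst45 (exp261 (@geo9Y (stage3OfFamily F).d₆ (stage3OfFamily F).ℓ₆ (stage3OfFamily F).hd' (stage3OfFamily F).hL' (stage3OfFamily F).b₀ (stage3OfFamily F).b₁ (Mstar F)) (q F).δ₀ (q F).α) (q F).δ₀ (q F).α (q F).NI (q F).NF ((((stage3OfFamily F).ℓ₆ + 1 : ℕ) : ℝ)) (holderConst (exp261 (@geo9Y (stage3OfFamily F).d₆ (stage3OfFamily F).ℓ₆ (stage3OfFamily F).hd' (stage3OfFamily F).hL' (stage3OfFamily F).b₀ (stage3OfFamily F).b₁ (Mstar F)) (q F).δ₀ (q F).α) (q F).δ₀ (q F).α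 (q F).NH (q F).NF (const37 (exp261 (@geo9Y (stage3OfFamily F).d₆ (stage3OfFamily F).ℓ₆ (stage3OfFamily F).hd' (stage3OfFamily F).hL' (stage3OfFamily F).b₀ (stage3OfFamily F).b₁ (Mstar F)) (q F).δ₀ (q F).α) (q F).δ₀ (q F).α (q F).ρ (q F).B₀ (q F).Nc (q F).N' (q F).Cℓ (q F).Kc) ((q F).Bl β') ((q F).Bt β')) ((q F).BI2 ((sch F) β' - β') β') ((q F).θI ((sch F) β')) ≤ (BZ F) β') (hδ45le : ∀ F : T4Family, (δ45 F) ≤ ((1 - (q F).αF) * ((1 - 2 * (q F).α) * (q F).δ₀) - (q F).α * (q F).δ₀)) (hΔ2 : ∀ F : T4Family, ∀ (x : MemberY (stage3OfFamily F).d₆ (stage3OfFamily F).ℓ₆ (stage3OfFamily F).hd' (stage3OfFamily F).hL' (stage3OfFamily F).b₀ (stage3OfFamily F).b₁ (Mstar F)) (U : (bg9YR (Matrix (Fin 2) (Fin 2) ℂ) (specialUnitaryUnits (Fin 2)) (R₁ F) (R₂ F) x).Cfg), (∀ μ z, U μ z ∈ specialUnitaryUnits (Fin 2)) → IsSymmTr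 (fun _ => (1 : ℝ)) (((𝔯 F) x).Δ2 U)) (θ₂ δ₂ : ∀ F : T4Family, ℝ) (hθ₂ : ∀ F : T4Family, 0 ≤ (θ₂ F)) (hrT4 : ∀ F : T4Family, (rT F) ≤ δ46 (stage3OfFamily F).d₆ (stage3OfFamily F).ℓ₆ (stage3OfFamily F).hd' (stage3OfFamily F).hL' (stage3OfFamily F).b₀ (stage3OfFamily F).b₁ (Mstar F) 2 (c F) (hc F)) (hrT2 : ∀ F : T4Family, (rT F) ≤ (δ₂ F)) (hδ₃T : ∀ F : T4Family, (δ12₃ F) ≤ (1 - 2 * (q F).αF) * (rT F) - (σS F)) (hδ12₃F : ∀ F : T4Family, (δ12₃ F) ≤ (1 - 2 * (p F).αF) * ((1 - 2 * (p F).α) * (p F).δ₀))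
    (hD2sup : ∀ F : T4Family, ∀ x : MemberY (stage3OfFamily F).d₆ (stage3OfFamily F).ℓ₆ (stage3OfFamily F).hd' (stage3OfFamily F).hL' (stage3OfFamily F).b₀ (stage3OfFamily F).b₁ (Mstar F), (M12 F) ≤ (geo9Y x).M → ∀ α₀ : ℝ, 0 < α₀ → (geo9Y x).M * α₀ ≤ (a12 F) → ∀ U : (bg9YR (Matrix (Fin 2) (Fin 2) ℂ) (specialUnitaryUnits (Fin 2)) (R₁ F) (R₂ F) x).Cfg, (bg9YR (Matrix (Fin 2) (Fin 2) ℂ) (specialUnitaryUnits (Fin 2)) (R₁ F) (R₂ F) x).Reg335 (c F) α₀ U → (bg9YR (Matrix (Fin 2) (Fin 2) ℂ) (specialUnitaryUnits (Fin 2)) (R₁ F) (R₂ F) x).Reg336 (c F) α₀ U → B6RandomWalk.HasMajorant (g := toB6 (geo9Y x) 1 ((H F) x)) ((𝔬12 F) x).blk (D2coK x.toKIdx (trBasis 2) (bg9YR (Matrix (Fin 2) (Fin 2) ℂ) (specialUnitaryUnits (Fin 2)) (R₁ F) (R₂ F) x) (fun U => U) (((𝔯 F) x).Δ2) U) (fun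 (a b : (geo9Y x).Site) => (θ₂ F) * ((geo9Y x).M * α₀) * ((geo9Y x).len a ^ 2)⁻¹ * Real.exp (-((δ₂ F) * (geo9Y x).dist a b)))) (δ45Y : ∀ F : T4Family, ℝ) (hδ45Y : ∀ F : T4Family, (δ12₃ F) < (δ45Y F)) (BiY : ∀ F : T4Family, ℝ → ℝ) (hBiY : ∀ F : T4Family, ∀ β', 0 ≤ β' → β' < 1 → 0 ≤ (BiY F) β') (αW σW δFW : ∀ F : T4Family, ℝ) (hαW0 : ∀ F : T4Family, 0 < (αW F)) (hαW1 : ∀ F : T4Family, (αW F) < 1) (hσW : ∀ F : T4Family, 0 < (σW F)) (hδFW : ∀ F : T4Family, 0 < (δFW F)) (hδFP : ∀ F : T4Family, (δFW F) ≤ min ((1 - 2 * (p F).α) * (p F).δ₀) (δ39 F) / 8) (hbudW : ∀ F : T4Family, 0 ≤ (δFW F) - (αW F) * (δFW F) - 2 * (σW F)) (hδ3W : ∀ F : T4Family, (δ12₃ F) ≤ (δFW F) - (αW F) * (δFW F) - 2 * (σW F)) (hwschX : ∀ F : T4Family, ∀ β', 0 ≤ β' → β' < 1 → 0 < (wX F)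 ((sch F) β')) (δ45W : ∀ F : T4Family, ℝ) (hδ45W : ∀ F : T4Family, (δFW F) - (αW F) * (δFW F) - 2 * (σW F) ≤ (δ45W F)) (B45W : ∀ F : T4Family, ℝ → ℝ) (hB45W : ∀ F : T4Family, ∀ β', 0 ≤ β' → β' < 1 → 0 ≤ (B45W F) β') (δhW : ∀ F : T4Family, ℝ) (hδhW : ∀ F : T4Family, (δFW F) - (αW F) * (δFW F) - (σW F) ≤ (δhW F)) (BhW : ∀ F : T4Family, ℝ → ℝ) (hBhW : ∀ F : T4Family, ∀ β', 0 ≤ β' → β' < 1 → 0 ≤ (BhW F) β')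
    (hB45Wge : ∀ F : T4Family, ∀ β', 0 ≤ β' → β' < 1 → let Cσ : ℝ := (((((stage3OfFamily F).ℓ₆ + 1 : ℕ) : ℝ)) * (((((stage3OfFamily F).ℓ₆ + 1 : ℕ) : ℝ)) ^ 3 * (2 + 2 * coordBound39 (trBasis 2) * basisBound39 (trBasis 2) * ((((stage3OfFamily F).ℓ₆ + 1 : ℕ) : ℝ)) ^ 2)) * Real.exp ((1 - (p F).αF) * ((1 - 2 * (p F).α) * (p F).δ₀) * (2 * (rNear (stage3OfFamily F).d₆ (stage3OfFamily F).ℓ₆ + 1) + ((((stage3OfFamily F).d₆ : ℝ) + 1) * ((((stage3OfFamily F).ℓ₆ : ℝ) + 1) + 1) + 2)))); let X44 : ℝ := (((((stage3OfFamily F).ℓ₆ + 1 : ℕ) : ℝ)) * ((1 + CLip (stage3OfFamily F).d₆ (stage3OfFamily F).ℓ₆) * inputConst44 (exp261 (@geo9Y (stage3OfFamily F).d₆ (stage3OfFamily F).ℓ₆ (stage3OfFamily F).hd' (stage3OfFamily F).hL' (stage3OfFamily F).b₀ (stage3OfFamily F).b₁ (Mstar F)) (p F).δ₀ (p F).α)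 (p F).δ₀ (p F).α (p F).NI (p F).N' ((p F).C (exp261 (@geo9Y (stage3OfFamily F).d₆ (stage3OfFamily F).ℓ₆ (stage3OfFamily F).hd' (stage3OfFamily F).hL' (stage3OfFamily F).b₀ (stage3OfFamily F).b₁ (Mstar F)) (p F).δ₀ (p F).α)) ((((stage3OfFamily F).ℓ₆ + 1 : ℕ) : ℝ)) ((p F).BI ((sch F) β')) ((p F).θI ((sch F) β')) * Cσ * B6.c1 (exp261 (@geo9Y (stage3OfFamily F).d₆ (stage3OfFamily F).ℓ₆ (stage3OfFamily F).hd' (stage3OfFamily F).hL' (stage3OfFamily F).b₀ (stage3OfFamily F).b₁ (Mstar F)) (p F).δ₀ (p F).α) (p F).δ₀ (p F).α)); ((((stage3OfFamily F).d₆ + 1 : ℕ) : ℝ)) * (((((((stage3OfFamily F).ℓ₆ + 1 : ℕ) : ℝ)) * ((1 + CLip (stage3OfFamily F).d₆ (stage3OfFamily F).ℓ₆) * inputConst45 (exp261 (@geo9Y (stage3OfFamily F).d₆ (stage3OfFamily F).ℓ₆ (stage3OfFamily F).hd' (stage3OfFamily F).hL' (stage3OfFamily F).b₀ (stage3OfFamily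 F).b₁ (Mstar F)) (p F).δ₀ (p F).α) (p F).δ₀ (p F).α (p F).NI (p F).N' ((((stage3OfFamily F).ℓ₆ + 1 : ℕ) : ℝ)) (holderConst (exp261 (@geo9Y (stage3OfFamily F).d₆ (stage3OfFamily F).ℓ₆ (stage3OfFamily F).hd' (stage3OfFamily F).hL' (stage3OfFamily F).b₀ (stage3OfFamily F).b₁ (Mstar F)) (p F).δ₀ (p F).α) (p F).δ₀ (p F).α (p F).NH (p F).N' ((p F).C (exp261 (@geo9Y (stage3OfFamily F).d₆ (stage3OfFamily F).ℓ₆ (stage3OfFamily F).hd' (stage3OfFamily F).hL' (stage3OfFamily F).b₀ (stage3OfFamily F).b₁ (Mstar F)) (p F).δ₀ (p F).α)) ((p F).Bl β') ((p F).Bt β')) ((p F).BI2 ((sch F) β' - β') β') ((p F).θI ((sch F) β')) * Cσ * B6.c1 (exp261 (@geo9Y (stage3OfFamily F).d₆ (stage3OfFamily F).ℓ₆ (stage3OfFamily F).hd' (stage3OfFamily F).hL' (stage3OfFamily F).b₀ (stage3OfFamily F).b₁ (Mstar F)) (p F).δ₀ (p F).α) (p F).δ₀ (p F).α)) + 2 *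 coordBound39 (trBasis 2) * basisBound39 (trBasis 2) * (((stage3OfFamily F).ℓ₆ : ℝ) + 1) * Real.exp (((1 - (p F).αF) * ((1 - 2 * (p F).α) * (p F).δ₀) - 3 * ((p F).α * (p F).δ₀)) * ((((stage3OfFamily F).d₆ : ℝ) + 1) * ((((stage3OfFamily F).ℓ₆ : ℝ) + 1) + 1) + 2)) * (((((stage3OfFamily F).d₆ + 1 : ℕ) : ℝ)) ^ 2 * (2 * (10 * ((((stage3OfFamily F).ℓ₆ + 1 : ℕ) : ℝ)) * ((p F).a₁ / (c F))) * (1 + 10 * ((((stage3OfFamily F).ℓ₆ + 1 : ℕ) : ℝ)) * ((p F).a₁ / (c F))) * Real.exp (4 * (10 * ((((stage3OfFamily F).ℓ₆ + 1 : ℕ) : ℝ)) * ((p F).a₁ / (c F))))) * ((((stage3OfFamily F).ℓ₆ + 1 : ℕ) : ℝ)) ^ 6) * X44 + coordBound39 (trBasis 2) * basisBound39 (trBasis 2) * X44 + X44) + X44 + coordBound39 (trBasis 2) * basisBound39 (trBasis 2) * X44) ≤ (B45W F) β')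
    (hδ45Wle : ∀ F : T4Family, (δ45W F) ≤ ((1 - (p F).αF) * ((1 - 2 * (p F).α) * (p F).δ₀) - 3 * ((p F).α * (p F).δ₀)))
    (hBhWge : ∀ F : T4Family, ∀ β', 0 ≤ β' → β' < 1 → ((B9RWSums343Holder.holderConst (B9RWSums347DefiniteFaces.exp261 (@geo9Y (stage3OfFamily F).d₆ (stage3OfFamily F).ℓ₆ (stage3OfFamily F).hd' (stage3OfFamily F).hL' (stage3OfFamily F).b₀ (stage3OfFamily F).b₁ (Mstar F)) (p F).δ₀ (p F).α) (p F).δ₀ (p F).α (p F).NH (p F).N' ((p F).C (B9RWSums347DefiniteFaces.exp261 (@geo9Y (stage3OfFamily F).d₆ (stage3OfFamily F).ℓ₆ (stage3OfFamily F).hd' (stage3OfFamily F).hL' (stage3OfFamily F).b₀ (stage3OfFamily F).b₁ (Mstar F)) (p F).δ₀ (p F).α)) ((p F).Bl β') ((p F).Bt β') + 2 * B9Thm39ReadingCoords.coordBound39 (trBasis 2) * B9Thm39ReadingCoords.basisBound39 (trBasis 2) * (((stage3OfFamily F).ℓ₆ : ℝ) + 1) * Real.exp (((1 - 2 * (p F).α)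 * (p F).δ₀) * ((((stage3OfFamily F).d₆ : ℝ) + 1) * ((((stage3OfFamily F).ℓ₆ : ℝ) + 1) + 1) + 2)) * (((((stage3OfFamily F).d₆ + 1 : ℕ) : ℝ)) ^ 2 * (2 * (10 * (((stage3OfFamily F).ℓ₆ + 1 : ℕ) : ℝ) * ((p F).a₁ / (c F))) * (1 + 10 * (((stage3OfFamily F).ℓ₆ + 1 : ℕ) : ℝ) * ((p F).a₁ / (c F))) * Real.exp (4 * (10 * (((stage3OfFamily F).ℓ₆ + 1 : ℕ) : ℝ) * ((p F).a₁ / (c F))))) * (((stage3OfFamily F).ℓ₆ + 1 : ℕ) : ℝ) ^ 6) * ((p F).C (B9RWSums347DefiniteFaces.exp261 (@geo9Y (stage3OfFamily F).d₆ (stage3OfFamily F).ℓ₆ (stage3OfFamily F).hd' (stage3OfFamily F).hL' (stage3OfFamily F).b₀ (stage3OfFamily F).b₁ (Mstar F)) (p F).δ₀ (p F).α)) + B9Thm39ReadingCoords.coordBound39 (trBasis 2) * B9Thm39ReadingCoords.basisBound39 (trBasis 2) * ((p F).C (B9RWSums347DefiniteFaces.exp261 (@geo9Y (stage3OfFamily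 F).d₆ (stage3OfFamily F).ℓ₆ (stage3OfFamily F).hd' (stage3OfFamily F).hL' (stage3OfFamily F).b₀ (stage3OfFamily F).b₁ (Mstar F)) (p F).δ₀ (p F).α)) + ((p F).C (B9RWSums347DefiniteFaces.exp261 (@geo9Y (stage3OfFamily F).d₆ (stage3OfFamily F).ℓ₆ (stage3OfFamily F).hd' (stage3OfFamily F).hL' (stage3OfFamily F).b₀ (stage3OfFamily F).b₁ (Mstar F)) (p F).δ₀ (p F).α))) + ((p F).C (B9RWSums347DefiniteFaces.exp261 (@geo9Y (stage3OfFamily F).d₆ (stage3OfFamily F).ℓ₆ (stage3OfFamily F).hd' (stage3OfFamily F).hL' (stage3OfFamily F).b₀ (stage3OfFamily F).b₁ (Mstar F)) (p F).δ₀ (p F).α)) + B9Thm39ReadingCoords.coordBound39 (trBasis 2) * B9Thm39ReadingCoords.basisBound39 (trBasis 2) * ((p F).C (B9RWSums347DefiniteFaces.exp261 (@geo9Y (stage3OfFamily F).d₆ (stage3OfFamily F).ℓ₆ (stage3OfFamily F).hd' (stage3OfFamily F).hL' (stage3OfFamily F).b₀ (stage3OfFamily F).b₁ (Mstar F)) (p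 F).δ₀ (p F).α))) ≤ (BhW F) β')
    (hδhWle : ∀ F : T4Family, (δhW F) ≤ ((1 - 2 * (p F).α) * (p F).δ₀)) (CP : ∀ F : T4Family, ℝ) (hCPge : ∀ F : T4Family, (((stage3OfFamily F).d₆ + 1 : ℕ) : ℝ) * (coordBound39 (trBasis 2) * basisBound39 (trBasis 2) * nearBlkCntY (stage3OfFamily F).d₆ (stage3OfFamily F).ℓ₆ (stage3OfFamily F).hd' (stage3OfFamily F).hL' (stage3OfFamily F).b₀ (stage3OfFamily F).b₁ (Mstar F) * ((max 1 (2 : ℝ) * ((nbrCountY (stage3OfFamily F).d₆ (stage3OfFamily F).ℓ₆ (stage3OfFamily F).hd' (stage3OfFamily F).hL' (stage3OfFamily F).b₀ (stage3OfFamily F).b₁ 2 : ℝ) * (p F).C (B9RWSums347DefiniteFaces.exp261 (@geo9Y (stage3OfFamily F).d₆ (stage3OfFamily F).ℓ₆ (stage3OfFamily F).hd' (stage3OfFamily F).hL' (stage3OfFamily F).b₀ (stage3OfFamily F).b₁ (Mstar F)) (p F).δ₀ (p F).α) * Real.exp (2 * ((1 - 2 * (p F).α) * (p F).δ₀)))) *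 (cR39 (basis39 (Matrix (Fin 2) (Fin 2) ℂ)) * Fintype.card (κ39 (Matrix (Fin 2) (Fin 2) ℂ)) * (B39 F) * Real.exp (2 * (δ39 F))) * (max 1 (2 : ℝ) * ((nbrCountY (stage3OfFamily F).d₆ (stage3OfFamily F).ℓ₆ (stage3OfFamily F).hd' (stage3OfFamily F).hL' (stage3OfFamily F).b₀ (stage3OfFamily F).b₁ 2 : ℝ) * (p F).C (B9RWSums347DefiniteFaces.exp261 (@geo9Y (stage3OfFamily F).d₆ (stage3OfFamily F).ℓ₆ (stage3OfFamily F).hd' (stage3OfFamily F).hL' (stage3OfFamily F).b₀ (stage3OfFamily F).b₁ (Mstar F)) (p F).δ₀ (p F).α) * Real.exp (2 * ((1 - 2 * (p F).α) * (p F).δ₀)))) * cg349 (stage3OfFamily F).d₆ (stage3OfFamily F).ℓ₆ (stage3OfFamily F).hd' (stage3OfFamily F).hL' (stage3OfFamily F).b₀ (stage3OfFamily F).b₁ ((1 - 2 * (p F).α) * (p F).δ₀) (δ39 F)) * Real.exp (2 * (min ((1 - 2 * (p F).α) * (p F).δ₀) (δ39 F) / 8))) ≤ (CP F)) (hBxW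 : ∀ F : T4Family, ∀ β', 0 ≤ β' → β' < 1 → (cR39 (trBasis 2))⁻¹ * (((wX F) ((sch F) β'))⁻¹ * (B45W F) β' + (BhW F) β' * ((CP F) * ((((stage3OfFamily F).ℓ₆ + 1 : ℕ) : ℝ))) * (((wX F) ((sch F) β'))⁻¹ * (((((stage3OfFamily F).ℓ₆ + 1 : ℕ) : ℝ)) * Real.exp (((δFW F) - (αW F) * (δFW F) - (σW F)) * (rNear (stage3OfFamily F).d₆ (stage3OfFamily F).ℓ₆ + 1)))) * rowConst261 (@geo9Y (stage3OfFamily F).d₆ (stage3OfFamily F).ℓ₆ (stage3OfFamily F).hd' (stage3OfFamily F).hL' (stage3OfFamily F).b₀ (stage3OfFamily F).b₁ (Mstar F)) (σW F) * rowConst261 (@geo9Y (stage3OfFamily F).d₆ (stage3OfFamily F).ℓ₆ (stage3OfFamily F).hd' (stage3OfFamily F).hL' (stage3OfFamily F).b₀ (stage3OfFamily F).b₁ (Mstar F)) (σW F)) ≤ (Bx13 F) β')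
    (hBiYge : ∀ F : T4Family, ∀ β', 0 ≤ β' → β' < 1 → ((((stage3OfFamily F).ℓ₆ + 1 : ℕ) : ℝ)) * inputConst45 (exp261 (@geo9Y (stage3OfFamily F).d₆ (stage3OfFamily F).ℓ₆ (stage3OfFamily F).hd' (stage3OfFamily F).hL' (stage3OfFamily F).b₀ (stage3OfFamily F).b₁ (Mstar F)) (q F).δ₀ (q F).α) (q F).δ₀ (q F).α (q F).NI (q F).NF ((((stage3OfFamily F).ℓ₆ + 1 : ℕ) : ℝ)) (holderConst (exp261 (@geo9Y (stage3OfFamily F).d₆ (stage3OfFamily F).ℓ₆ (stage3OfFamily F).hd' (stage3OfFamily F).hL' (stage3OfFamily F).b₀ (stage3OfFamily F).b₁ (Mstar F)) (q F).δ₀ (q F).α) (q F).δ₀ (q F).α (q F).NH (q F).NF (const37 (exp261 (@geo9Y (stage3OfFamily F).d₆ (stage3OfFamily F).ℓ₆ (stage3OfFamily F).hd' (stage3OfFamily F).hL' (stage3OfFamily F).b₀ (stage3OfFamily F).b₁ (Mstar F)) (q F).δ₀ (q F).α) (q F).δ₀ (q F).α (q F).ρ (q F).B₀ (q F).Nc (q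 F).N' (q F).Cℓ (q F).Kc) ((q F).Bl β') ((q F).Bt β')) ((q F).BI2 ((sch F) β' - β') β') ((q F).θI ((sch F) β')) ≤ (BiY F) β') (hδ45Yle : ∀ F : T4Family, (δ45Y F) ≤ ((1 - (q F).αF) * ((1 - 2 * (q F).α) * (q F).δ₀) - (q F).α * (q F).δ₀)) (hrgdd13 : ∀ F : T4Family, ∀ x : MemberY (stage3OfFamily F).d₆ (stage3OfFamily F).ℓ₆ (stage3OfFamily F).hd' (stage3OfFamily F).hL' (stage3OfFamily F).b₀ (stage3OfFamily F).b₁ (Mstar F), (M12 F) ≤ (geo9Y x).M → ∀ α₀ : ℝ, 0 < α₀ → (geo9Y x).M * α₀ ≤ (a12 F) → ∀ U : (bg9YR (Matrix (Fin 2) (Fin 2) ℂ) (specialUnitaryUnits (Fin 2)) (R₁ F) (R₂ F) x).Cfg, (bg9YR (Matrix (Fin 2) (Fin 2) ℂ) (specialUnitaryUnits (Fin 2)) (R₁ F) (R₂ F) x).Reg335 (c F) α₀ U → (bg9YR (Matrix (Fin 2) (Fin 2) ℂ) (specialUnitaryUnits (Fin 2)) (R₁ F) (R₂ F) x).Reg336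 (c F) α₀ U → ∀ (μ : Fin ((stage3OfFamily F).d₆ + 1)) (ε ε' : ℝ), 0 < ε' → ε' < 1 → ε' < ε → ε ≤ ε' + 1 → HasMaj ((bHXA F) x ε) ((bHXT F) x U ε') (((𝔬12 F) x).R U ∘ₗ ((𝔬12 F) x).Dvstar U ∘ₗ ((𝔬12 F) x).G1 U ∘ₗ ((𝔡A F) x).Dsd U μ) (fun a b => (Br13 F) ε ε' * Real.exp (-((δ12₃ F) * (geo9Y x).dist a b))))
    (hZ : ∀ F : T4Family, ∀ x : MemberY (stage3OfFamily F).d₆ (stage3OfFamily F).ℓ₆ (stage3OfFamily F).hd' (stage3OfFamily F).hL' (stage3OfFamily F).b₀ (stage3OfFamily F).b₁ (Mstar F), (M12 F) ≤ (geo9Y x).M → ∀ α₀ : ℝ, 0 < α₀ → (geo9Y x).M * α₀ ≤ (a12 F) → ∀ U : (bg9YR (Matrix (Fin 2) (Fin 2) ℂ) (specialUnitaryUnits (Fin 2)) (R₁ F) (R₂ F) x).Cfg, (bg9YR (Matrix (Fin 2) (Fin 2) ℂ) (specialUnitaryUnits (Fin 2)) (R₁ F) (R₂ F) x).Reg335 (c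 F) α₀ U → (bg9YR (Matrix (Fin 2) (Fin 2) ℂ) (specialUnitaryUnits (Fin 2)) (R₁ F) (R₂ F) x).Reg336 (c F) α₀ U → QY x.toKIdx (parBY x.toKIdx) U ∘ₗ gradY x.toKIdx U ∘ₗ GpPhysY x.toKIdx (parSymY x.toKIdx) U ∘ₗ RY x.toKIdx (parSymY x.toKIdx) (GpPhysY x.toKIdx (parSymY x.toKIdx)) U = 0) (s44 : ∀ F : T4Family, ℝ) (hs440 : ∀ F : T4Family, 0 < (s44 F)) (hs441 : ∀ F : T4Family, (s44 F) < 1) (hws44 : ∀ F : T4Family, 0 < (w13 F) (s44 F)) (δ44 : ∀ F : T4Family, ℝ) (hδ44 : ∀ F : T4Family, (δ12₃ F) < (δ44 F)) (Bi44 : ∀ F : T4Family, ℝ) (hBi44 : ∀ F : T4Family, 0 ≤ (Bi44 F)) (hB12₃d : ∀ F : T4Family, (((stage3OfFamily F).d₆ : ℝ) + 1) * ((1 + CLip (stage3OfFamily F).d₆ (stage3OfFamily F).ℓ₆) * (Bi44 F) * (CJG (stage3OfFamily F).d₆ (stage3OfFamily F).ℓ₆ (trBasis 2) (s44 F) (thetaL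 (stage3OfFamily F).d₆ (stage3OfFamily F).ℓ₆ (ϑF F)) ((w13 F) (s44 F)) ((δ12₃ F) + 1 + 1 / 2 * ((δ44 F) - (δ12₃ F))) * ((((stage3OfFamily F).ℓ₆ + 1 : ℕ) : ℝ))) * rowConst261 (@geo9Y (stage3OfFamily F).d₆ (stage3OfFamily F).ℓ₆ (stage3OfFamily F).hd' (stage3OfFamily F).hL' (stage3OfFamily F).b₀ (stage3OfFamily F).b₁ (Mstar F)) 1) ≤ (B12₃ F)) (hB12₃p : ∀ F : T4Family, (((stage3OfFamily F).d₆ : ℝ) + 1) * (1 * ((((stage3OfFamily F).d₆ : ℝ) + 1) * ((1 + CLip (stage3OfFamily F).d₆ (stage3OfFamily F).ℓ₆) * (Bi44 F) * (CJG (stage3OfFamily F).d₆ (stage3OfFamily F).ℓ₆ (trBasis 2) (s44 F) (thetaL (stage3OfFamily F).d₆ (stage3OfFamily F).ℓ₆ (ϑF F)) ((w13 F) (s44 F)) ((δ12₃ F) + 1 + 1 / 2 * ((δ44 F) - (δ12₃ F))) * ((((stage3OfFamily F).ℓ₆ + 1 : ℕ) : ℝ))) * rowConst261 (@geo9Y (stage3OfFamily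 F).d₆ (stage3OfFamily F).ℓ₆ (stage3OfFamily F).hd' (stage3OfFamily F).hL' (stage3OfFamily F).b₀ (stage3OfFamily F).b₁ (Mstar F)) 1)) * rowConst261 (@geo9Y (stage3OfFamily F).d₆ (stage3OfFamily F).ℓ₆ (stage3OfFamily F).hd' (stage3OfFamily F).hL' (stage3OfFamily F).b₀ (stage3OfFamily F).b₁ (Mstar F)) 1) ≤ (B12₃ F))
    (hBi44ge : ∀ F : T4Family, ((((stage3OfFamily F).ℓ₆ + 1 : ℕ) : ℝ)) * inputConst44 (exp261 (@geo9Y (stage3OfFamily F).d₆ (stage3OfFamily F).ℓ₆ (stage3OfFamily F).hd' (stage3OfFamily F).hL' (stage3OfFamily F).b₀ (stage3OfFamily F).b₁ (Mstar F)) (q F).δ₀ (q F).α) (q F).δ₀ (q F).α (q F).NI (q F).NF (const37 (exp261 (@geo9Y (stage3OfFamily F).d₆ (stage3OfFamily F).ℓ₆ (stage3OfFamily F).hd' (stage3OfFamily F).hL' (stage3OfFamily F).b₀ (stage3OfFamily F).b₁ (Mstar F)) (q F).δ₀ (q F).α) (q F).δ₀ (q F).α (q F).ρ (q F).B₀ (q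 F).Nc (q F).N' (q F).Cℓ (q F).Kc) ((((stage3OfFamily F).ℓ₆ + 1 : ℕ) : ℝ)) ((q F).BI (s44 F)) ((q F).θI (s44 F)) ≤ (Bi44 F)) (hδ44le : ∀ F : T4Family, (δ44 F) ≤ ((1 - (q F).αF) * ((1 - 2 * (q F).α) * (q F).δ₀) - (q F).α * (q F).δ₀)) (hwX44 : ∀ F : T4Family, 0 < (wX F) (s44 F)) (B44G δ44G : ∀ F : T4Family, ℝ) (hB44G : ∀ F : T4Family, 0 ≤ (B44G F)) (hδ44G : ∀ F : T4Family, (δFW F) - (αW F) * (δFW F) - 2 * (σW F) ≤ (δ44G F)) (hB44Gge : ∀ F : T4Family, let Cσ : ℝ := (((((stage3OfFamily F).ℓ₆ + 1 : ℕ) : ℝ)) * (((((stage3OfFamily F).ℓ₆ + 1 : ℕ) : ℝ)) ^ 3 * (2 + 2 * coordBound39 (trBasis 2) * basisBound39 (trBasis 2) * ((((stage3OfFamily F).ℓ₆ + 1 : ℕ) : ℝ)) ^ 2)) * Real.exp ((1 - (p F).αF) * ((1 - 2 * (p F).α) * (p F).δ₀) * (2 * (rNear (stage3OfFamily F).d₆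 (stage3OfFamily F).ℓ₆ + 1) + ((((stage3OfFamily F).d₆ : ℝ) + 1) * ((((stage3OfFamily F).ℓ₆ : ℝ) + 1) + 1) + 2)))); ((((stage3OfFamily F).ℓ₆ + 1 : ℕ) : ℝ)) * (((((stage3OfFamily F).d₆ + 1 : ℕ) : ℝ)) * ((1 + CLip (stage3OfFamily F).d₆ (stage3OfFamily F).ℓ₆) * inputConst44 (exp261 (@geo9Y (stage3OfFamily F).d₆ (stage3OfFamily F).ℓ₆ (stage3OfFamily F).hd' (stage3OfFamily F).hL' (stage3OfFamily F).b₀ (stage3OfFamily F).b₁ (Mstar F)) (p F).δ₀ (p F).α) (p F).δ₀ (p F).α (p F).NI (p F).N' ((p F).C (exp261 (@geo9Y (stage3OfFamily F).d₆ (stage3OfFamily F).ℓ₆ (stage3OfFamily F).hd' (stage3OfFamily F).hL' (stage3OfFamily F).b₀ (stage3OfFamily F).b₁ (Mstar F)) (p F).δ₀ (p F).α)) ((((stage3OfFamily F).ℓ₆ + 1 : ℕ) : ℝ)) ((p F).BI (s44 F)) ((p F).θI (s44 F)) * Cσ * B6.c1 (exp261 (@geo9Y (stage3OfFamily F).d₆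 (stage3OfFamily F).ℓ₆ (stage3OfFamily F).hd' (stage3OfFamily F).hL' (stage3OfFamily F).b₀ (stage3OfFamily F).b₁ (Mstar F)) (p F).δ₀ (p F).α) (p F).δ₀ (p F).α)) ≤ (B44G F)) (hδ44Gle : ∀ F : T4Family, (δ44G F) ≤ ((1 - (p F).αF) * ((1 - 2 * (p F).α) * (p F).δ₀) - 3 * ((p F).α * (p F).δ₀)))
    (hB₃wG : ∀ F : T4Family, (cR39 (trBasis 2))⁻¹ * (((wX F) (s44 F))⁻¹ * (B44G F) + ((((stage3OfFamily F).d₆ + 1 : ℕ) : ℝ) * (p F).C (B9RWSums347DefiniteFaces.exp261 (@geo9Y (stage3OfFamily F).d₆ (stage3OfFamily F).ℓ₆ (stage3OfFamily F).hd' (stage3OfFamily F).hL' (stage3OfFamily F).b₀ (stage3OfFamily F).b₁ (Mstar F)) (p F).δ₀ (p F).α)) * ((CP F) * ((((stage3OfFamily F).ℓ₆ + 1 : ℕ) : ℝ))) * (((wX F) (s44 F))⁻¹ * (((((stage3OfFamily F).ℓ₆ + 1 : ℕ) : ℝ)) * Real.exp (((δFW F) - (αW F) * (δFW F) - (σW F))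 * (rNear (stage3OfFamily F).d₆ (stage3OfFamily F).ℓ₆ + 1)))) * rowConst261 (@geo9Y (stage3OfFamily F).d₆ (stage3OfFamily F).ℓ₆ (stage3OfFamily F).hd' (stage3OfFamily F).hL' (stage3OfFamily F).b₀ (stage3OfFamily F).b₁ (Mstar F)) (σW F) * rowConst261 (@geo9Y (stage3OfFamily F).d₆ (stage3OfFamily F).ℓ₆ (stage3OfFamily F).hd' (stage3OfFamily F).hL' (stage3OfFamily F).b₀ (stage3OfFamily F).b₁ (Mstar F)) (σW F)) ≤ (B12₃ F)) (BHG : ∀ F : T4Family, ℝ) (hBHG : ∀ F : T4Family, 0 ≤ (BHG F)) (hwBhG : ∀ F : T4Family, ∀ s, 0 < s → s < 1 → (wX F) s * holderConst (exp261 (@geo9Y (stage3OfFamily F).d₆ (stage3OfFamily F).ℓ₆ (stage3OfFamily F).hd' (stage3OfFamily F).hL' (stage3OfFamily F).b₀ (stage3OfFamily F).b₁ (Mstar F)) (q F).δ₀ (q F).α) (q F).δ₀ (q F).α (q F).NH (q F).NF (const37 (exp261 (@geo9Y (stage3OfFamily F).d₆ (stage3OfFamily F).ℓ₆ (stage3OfFamily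 F).hd' (stage3OfFamily F).hL' (stage3OfFamily F).b₀ (stage3OfFamily F).b₁ (Mstar F)) (q F).δ₀ (q F).α) (q F).δ₀ (q F).α (q F).ρ (q F).B₀ (q F).Nc (q F).N' (q F).Cℓ (q F).Kc) ((q F).Bl s) ((q F).Bt s) ≤ (BHG F)) (B43 δ43 : ∀ F : T4Family, ℝ) (hB43 : ∀ F : T4Family, 0 ≤ (B43 F)) (B₀D : ∀ F : T4Family, ℝ) (hB₀D : ∀ F : T4Family, 0 ≤ (B₀D F))
    (hbudD : ∀ F : T4Family, ∀ s : ℝ, 0 < s → s < 1 → (w13 F) s * (((((stage3OfFamily F).d₆ + 1 : ℕ) : ℝ)) * (B9RWSums343Holder.holderConst (B9RWSums347DefiniteFaces.exp261 (@geo9Y (stage3OfFamily F).d₆ (stage3OfFamily F).ℓ₆ (stage3OfFamily F).hd' (stage3OfFamily F).hL' (stage3OfFamily F).b₀ (stage3OfFamily F).b₁ (Mstar F)) (p F).δ₀ (p F).α) (p F).δ₀ (p F).α (p F).NH (p F).N' ((p F).C (B9RWSums347DefiniteFaces.exp261 (@geo9Y (stage3OfFamily F).d₆ (stage3OfFamily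 F).ℓ₆ (stage3OfFamily F).hd' (stage3OfFamily F).hL' (stage3OfFamily F).b₀ (stage3OfFamily F).b₁ (Mstar F)) (p F).δ₀ (p F).α)) ((p F).Bl s) ((p F).Bt s) + 2 * B9Thm39ReadingCoords.coordBound39 (trBasis 2) * B9Thm39ReadingCoords.basisBound39 (trBasis 2) * (((stage3OfFamily F).ℓ₆ : ℝ) + 1) * Real.exp (((1 - 2 * (p F).α) * (p F).δ₀) * ((((stage3OfFamily F).d₆ : ℝ) + 1) * ((((stage3OfFamily F).ℓ₆ : ℝ) + 1) + 1) + 2)) * (((((stage3OfFamily F).d₆ + 1 : ℕ) : ℝ)) ^ 2 * (2 * (10 * (((stage3OfFamily F).ℓ₆ + 1 : ℕ) : ℝ) * ((p F).a₁ / (c F))) * (1 + 10 * (((stage3OfFamily F).ℓ₆ + 1 : ℕ) : ℝ) * ((p F).a₁ / (c F))) * Real.exp (4 * (10 * (((stage3OfFamily F).ℓ₆ + 1 : ℕ) : ℝ) * ((p F).a₁ / (c F))))) * (((stage3OfFamily F).ℓ₆ + 1 : ℕ) : ℝ) ^ 6) * ((p F).C (B9RWSums347DefiniteFaces.exp261 (@geo9Y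 (stage3OfFamily F).d₆ (stage3OfFamily F).ℓ₆ (stage3OfFamily F).hd' (stage3OfFamily F).hL' (stage3OfFamily F).b₀ (stage3OfFamily F).b₁ (Mstar F)) (p F).δ₀ (p F).α)) + B9Thm39ReadingCoords.coordBound39 (trBasis 2) * B9Thm39ReadingCoords.basisBound39 (trBasis 2) * ((p F).C (B9RWSums347DefiniteFaces.exp261 (@geo9Y (stage3OfFamily F).d₆ (stage3OfFamily F).ℓ₆ (stage3OfFamily F).hd' (stage3OfFamily F).hL' (stage3OfFamily F).b₀ (stage3OfFamily F).b₁ (Mstar F)) (p F).δ₀ (p F).α)) + ((p F).C (B9RWSums347DefiniteFaces.exp261 (@geo9Y (stage3OfFamily F).d₆ (stage3OfFamily F).ℓ₆ (stage3OfFamily F).hd' (stage3OfFamily F).hL' (stage3OfFamily F).b₀ (stage3OfFamily F).b₁ (Mstar F)) (p F).δ₀ (p F).α)))) ≤ (B₀D F))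
    (hB43ge : ∀ F : T4Family, ((((stage3OfFamily F).ℓ₆ + 1 : ℕ) : ℝ)) * (((((stage3OfFamily F).d₆ + 1 : ℕ) : ℝ)) * ((p F).C (B9RWSums347DefiniteFaces.exp261 (@geo9Y (stage3OfFamily F).d₆ (stage3OfFamily F).ℓ₆ (stage3OfFamily F).hd' (stage3OfFamily F).hL' (stage3OfFamily F).b₀ (stage3OfFamily F).b₁ (Mstar F)) (p F).δ₀ (p F).α)) + (B₀D F)) * Real.exp (((1 - 2 * (p F).α) * (p F).δ₀) * (rNear (stage3OfFamily F).d₆ (stage3OfFamily F).ℓ₆ + 1)) ≤ (B43 F)) (hδ43le : ∀ F : T4Family, (δ43 F) ≤ ((1 - 2 * (p F).α) * (p F).δ₀)) (ρrg : ∀ F : T4Family, ℝ) (hρrg0 : ∀ F : T4Family, 0 ≤ (ρrg F)) (hbudrg : ∀ F : T4Family, (ρrg F) + (σW F) + (αW F) * (δFW F) ≤ (δFW F)) (hbud43 : ∀ F : T4Family, (ρrg F) + (σW F) ≤ (δ43 F)) (hδ₃rg : ∀ F : T4Family, (δ12₃ F) ≤ (ρrg F))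
    (hB₃rg : ∀ F : T4Family, (B43 F) * (cR39 (trBasis 2))⁻¹ * rowConst261 (@geo9Y (stage3OfFamily F).d₆ (stage3OfFamily F).ℓ₆ (stage3OfFamily F).hd' (stage3OfFamily F).hL' (stage3OfFamily F).b₀ (stage3OfFamily F).b₁ (Mstar F)) (σW F) + CTel (stage3OfFamily F).d₆ (stage3OfFamily F).ℓ₆ (trBasis 2) (ρrg F) ((CP F) * ((((stage3OfFamily F).ℓ₆ + 1 : ℕ) : ℝ)) * (((((stage3OfFamily F).d₆ + 1 : ℕ) : ℝ) * (p F).C (B9RWSums347DefiniteFaces.exp261 (@geo9Y (stage3OfFamily F).d₆ (stage3OfFamily F).ℓ₆ (stage3OfFamily F).hd' (stage3OfFamily F).hL' (stage3OfFamily F).b₀ (stage3OfFamily F).b₁ (Mstar F)) (p F).δ₀ (p F).α)) * (cR39 (trBasis 2))⁻¹ * rowConst261 (@geo9Y (stage3OfFamily F).d₆ (stage3OfFamily F).ℓ₆ (stage3OfFamily F).hd' (stage3OfFamily F).hL' (stage3OfFamily F).b₀ (stage3OfFamily F).b₁ (Mstar F)) (σW F)) * rowConst261 (@geo9Y (stage3OfFamily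 F).d₆ (stage3OfFamily F).ℓ₆ (stage3OfFamily F).hd' (stage3OfFamily F).hL' (stage3OfFamily F).b₀ (stage3OfFamily F).b₁ (Mstar F)) (σW F)) ((CP F) * ((((stage3OfFamily F).ℓ₆ + 1 : ℕ) : ℝ)) * (((((stage3OfFamily F).d₆ + 1 : ℕ) : ℝ) * (p F).C (B9RWSums347DefiniteFaces.exp261 (@geo9Y (stage3OfFamily F).d₆ (stage3OfFamily F).ℓ₆ (stage3OfFamily F).hd' (stage3OfFamily F).hL' (stage3OfFamily F).b₀ (stage3OfFamily F).b₁ (Mstar F)) (p F).δ₀ (p F).α)) * (cR39 (trBasis 2))⁻¹ * rowConst261 (@geo9Y (stage3OfFamily F).d₆ (stage3OfFamily F).ℓ₆ (stage3OfFamily F).hd' (stage3OfFamily F).hL' (stage3OfFamily F).b₀ (stage3OfFamily F).b₁ (Mstar F)) (σW F)) * rowConst261 (@geo9Y (stage3OfFamily F).d₆ (stage3OfFamily F).ℓ₆ (stage3OfFamily F).hd' (stage3OfFamily F).hL' (stage3OfFamily F).b₀ (stage3OfFamily F).b₁ (Mstar F)) (σW F)) ≤ (B12₃ F)) (E14₁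 E14₂ : ∀ F : T4Family, ∀ x : MemberY (stage3OfFamily F).d₆ (stage3OfFamily F).ℓ₆ (stage3OfFamily F).hd' (stage3OfFamily F).hL' (stage3OfFamily F).b₀ (stage3OfFamily F).b₁ (Mstar F), B9.RWExpansion (geo9Y x) (bg9YR (Matrix (Fin 2) (Fin 2) ℂ) (specialUnitaryUnits (Fin 2)) (R₁ F) (R₂ F) x)) (T14₁ : ∀ F : T4Family, ∀ x : MemberY (stage3OfFamily F).d₆ (stage3OfFamily F).ℓ₆ (stage3OfFamily F).hd' (stage3OfFamily F).hL' (stage3OfFamily F).b₀ (stage3OfFamily F).b₁ (Mstar F), ((E14₁ F) x).Walk → BondOpY (Matrix (Fin 2) (Fin 2) ℂ) x.toKIdx)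
    (T14₂ : ∀ F : T4Family, ∀ x : MemberY (stage3OfFamily F).d₆ (stage3OfFamily F).ℓ₆ (stage3OfFamily F).hd' (stage3OfFamily F).hL' (stage3OfFamily F).b₀ (stage3OfFamily F).b₁ (Mstar F), ((E14₂ F) x).Walk → BondOpY (Matrix (Fin 2) (Fin 2) ℂ) x.toKIdx) (X14₁ : ∀ F : T4Family, ∀ x : MemberY (stage3OfFamily F).d₆ (stage3OfFamily F).ℓ₆ (stage3OfFamily F).hd' (stage3OfFamily F).hL' (stage3OfFamily F).b₀ (stage3OfFamily F).b₁ (Mstar F), ((E14₁ F) x).Walk → ℕ → (geo9Y x).Site → Prop) (M14₁ : ∀ F : T4Family, ∀ x : MemberY (stage3OfFamily F).d₆ (stage3OfFamily F).ℓ₆ (stage3OfFamily F).hd' (stage3OfFamily F).hL' (stage3OfFamily F).b₀ (stage3OfFamily F).b₁ (Mstar F), ((E14₁ F) x).Walk → ℕ → Prop) (X14₂ : ∀ F : T4Family, ∀ x : MemberY (stage3OfFamily F).d₆ (stage3OfFamily F).ℓ₆ (stage3OfFamily F).hd' (stage3OfFamily F).hL' (stage3OfFamily F).b₀ (stage3OfFamily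 F).b₁ (Mstar F), ((E14₂ F) x).Walk → ℕ → (geo9Y x).Site → Prop) (M14₂ : ∀ F : T4Family, ∀ x : MemberY (stage3OfFamily F).d₆ (stage3OfFamily F).ℓ₆ (stage3OfFamily F).hd' (stage3OfFamily F).hL' (stage3OfFamily F).b₀ (stage3OfFamily F).b₁ (Mstar F), ((E14₂ F) x).Walk → ℕ → Prop) (diam14 : ∀ F : T4Family, MemberY (stage3OfFamily F).d₆ (stage3OfFamily F).ℓ₆ (stage3OfFamily F).hd' (stage3OfFamily F).hL' (stage3OfFamily F).b₀ (stage3OfFamily F).b₁ (Mstar F) → ℝ) (r14 : ∀ F : T4Family, ℝ) (hr14 : ∀ F : T4Family, ∀ x, (diam14 F) x ≤ (r14 F)) (near14₁ : ∀ F : T4Family, ∀ (x : MemberY (stage3OfFamily F).d₆ (stage3OfFamily F).ℓ₆ (stage3OfFamily F).hd' (stage3OfFamily F).hL' (stage3OfFamily F).b₀ (stage3OfFamily F).b₁ (Mstar F)) ω m pᵢ, (M14₁ F) x ω m → (X14₁ F) x ω m pᵢ → ∃ qᵢ, qᵢ ∈ OmegaC x.D x.D' ∧ tdistK (ℓ :=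 (stage3OfFamily F).ℓ₆) (Mh := x.Mh) (k := x.k) (P := x.P') (kLab x pᵢ) qᵢ ≤ (diam14 F) x) (first14₁ : ∀ F : T4Family, ∀ (x : MemberY (stage3OfFamily F).d₆ (stage3OfFamily F).ℓ₆ (stage3OfFamily F).hd' (stage3OfFamily F).hL' (stage3OfFamily F).b₀ (stage3OfFamily F).b₁ (Mstar F)) ω y, ((E14₁ F) x).first ω y → (X14₁ F) x ω 0 y)
    (chain14₁ : ∀ F : T4Family, ∀ (x : MemberY (stage3OfFamily F).d₆ (stage3OfFamily F).ℓ₆ (stage3OfFamily F).hd' (stage3OfFamily F).hL' (stage3OfFamily F).b₀ (stage3OfFamily F).b₁ (Mstar F)) ω y y', ((E14₁ F) x).first ω y → ((E14₁ F) x).last ω y' → ∃ l : List (geo9Y x).Site, l.length = ((E14₁ F) x).wlen ω ∧ (∀ (m : ℕ) (hm : m < l.length), (X14₁ F) x ω (m + 1) (l[m])) ∧ B9Thm314.chainSum (geo9Y x).dist y l y' ≤ ((E14₁ F) x).wdist ω y y') (near14₂ : ∀ F : T4Family, ∀ (x : MemberY (stage3OfFamily F).d₆ (stage3OfFamily F).ℓ₆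 (stage3OfFamily F).hd' (stage3OfFamily F).hL' (stage3OfFamily F).b₀ (stage3OfFamily F).b₁ (Mstar F)) ω m pᵢ, (M14₂ F) x ω m → (X14₂ F) x ω m pᵢ → ∃ qᵢ, qᵢ ∈ OmegaC x.D x.D' ∧ tdistK (ℓ := (stage3OfFamily F).ℓ₆) (Mh := x.Mh) (k := x.k) (P := x.P') (kLab x pᵢ) qᵢ ≤ (diam14 F) x) (first14₂ : ∀ F : T4Family, ∀ (x : MemberY (stage3OfFamily F).d₆ (stage3OfFamily F).ℓ₆ (stage3OfFamily F).hd' (stage3OfFamily F).hL' (stage3OfFamily F).b₀ (stage3OfFamily F).b₁ (Mstar F)) ω y, ((E14₂ F) x).first ω y → (X14₂ F) x ω 0 y) (chain14₂ : ∀ F : T4Family, ∀ (x : MemberY (stage3OfFamily F).d₆ (stage3OfFamily F).ℓ₆ (stage3OfFamily F).hd' (stage3OfFamily F).hL' (stage3OfFamily F).b₀ (stage3OfFamily F).b₁ (Mstar F)) ω y y', ((E14₂ F) x).first ω y → ((E14₂ F) x).last ω y' → ∃ l : List (geo9Y x).Site, l.length = ((E14₂ F) x).wlen ω ∧ (∀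 (m : ℕ) (hm : m < l.length), (X14₂ F) x ω (m + 1) (l[m])) ∧ B9Thm314.chainSum (geo9Y x).dist y l y' ≤ ((E14₂ F) x).wdist ω y y') (h14₁ : ∀ F : T4Family, Thm310AllNormsPrinted (c F) geo9Y (bg9YR (Matrix (Fin 2) (Fin 2) ℂ) (specialUnitaryUnits (Fin 2)) (R₁ F) (R₂ F)) (E14₁ F) (fun x ω => kernelFamilyB x.toKIdx (bg9YR (Matrix (Fin 2) (Fin 2) ℂ) (specialUnitaryUnits (Fin 2)) (R₁ F) (R₂ F) x) (fun U => U) ((T14₁ F) x ω) (lettersYOfRecordV4P 2 (stage3OfFamily F) (Mstar F) (𝔯 F) x).parB)) (h14₂ : ∀ F : T4Family, Thm310AllNormsPrinted (c F) geo9Y (bg9YR (Matrix (Fin 2) (Fin 2) ℂ) (specialUnitaryUnits (Fin 2)) (R₁ F) (R₂ F)) (E14₂ F) (fun x ω => kernelFamilyB x.toKIdx (bg9YR (Matrix (Fin 2) (Fin 2) ℂ) (specialUnitaryUnits (Fin 2)) (R₁ F) (R₂ F) x) (fun U => U) ((T14₂ F) x ω) (lettersYOfRecordV4P 2 (stage3OfFamily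 F) (Mstar F) (𝔯 F) x).parB))
    (W14₁ : ∀ F : T4Family, ∀ x : MemberY (stage3OfFamily F).d₆ (stage3OfFamily F).ℓ₆ (stage3OfFamily F).hd' (stage3OfFamily F).hL' (stage3OfFamily F).b₀ (stage3OfFamily F).b₁ (Mstar F), ℕ → (geo9Y x).Site → (geo9Y x).Site → Finset ((E14₁ F) x).Walk) (W14₂ : ∀ F : T4Family, ∀ x : MemberY (stage3OfFamily F).d₆ (stage3OfFamily F).ℓ₆ (stage3OfFamily F).hd' (stage3OfFamily F).hL' (stage3OfFamily F).b₀ (stage3OfFamily F).b₁ (Mstar F), ℕ → (geo9Y x).Site → (geo9Y x).Site → Finset ((E14₂ F) x).Walk) (hW14₁ : ∀ F : T4Family, ∀ x, WalkSetsSpec ((E14₁ F) x) ((W14₁ F) x)) (hW14₂ : ∀ F : T4Family, ∀ x, WalkSetsSpec ((E14₂ F) x) ((W14₂ F) x)) (hcnt14₁ : ∀ F : T4Family, WalkWeightsSummable geo9Y (bg9YR (Matrix (Fin 2) (Fin 2) ℂ) (specialUnitaryUnits (Fin 2)) (R₁ F) (R₂ F)) (E14₁ F) (W14₁ F)) (hcnt14₂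 : ∀ F : T4Family, WalkWeightsSummable geo9Y (bg9YR (Matrix (Fin 2) (Fin 2) ℂ) (specialUnitaryUnits (Fin 2)) (R₁ F) (R₂ F)) (E14₂ F) (W14₂ F)) (hexp14 : ∀ F : T4Family, ∀ (x : MemberY (stage3OfFamily F).d₆ (stage3OfFamily F).ℓ₆ (stage3OfFamily F).hd' (stage3OfFamily F).hL' (stage3OfFamily F).b₀ (stage3OfFamily F).b₁ (Mstar F)) (U : (bg9YR (Matrix (Fin 2) (Fin 2) ℂ) (specialUnitaryUnits (Fin 2)) (R₁ F) (R₂ F) x).Cfg), ((E14₁ F) x).Converges U ∧ ((E14₂ F) x).Converges U → ExpansionReads x.toKIdx (B := bg9YR (Matrix (Fin 2) (Fin 2) ℂ) (specialUnitaryUnits (Fin 2)) (R₁ F) (R₂ F) x) (fun U => U) (lettersYOfRecordV4P 2 (stage3OfFamily F) (Mstar F) (𝔯 F) x).Kdiff (pairOp (locDataY x ((E14₁ F) x) ((X14₁ F) x) ((M14₁ F) x) ((diam14 F) x)).Touches (locData₂ (locDataY x ((E14₁ F) x) ((X14₁ F) x) ((M14₁ F) x) ((diam14 F) x)) ((X14₂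 F) x) ((M14₂ F) x)).Touches ((T14₁ F) x) ((T14₂ F) x)) (pairWalkSets ((W14₁ F) x) ((W14₂ F) x) (locDataY x ((E14₁ F) x) ((X14₁ F) x) ((M14₁ F) x) ((diam14 F) x)).Touches (locData₂ (locDataY x ((E14₁ F) x) ((X14₁ F) x) ((M14₁ F) x) ((diam14 F) x)) ((X14₂ F) x) ((M14₂ F) x)).Touches) U) (a₀E δ₁E B₁E : ∀ F : T4Family, ℝ) (ha₀E : ∀ F : T4Family, 0 < (a₀E F)) (hδ₁E : ∀ F : T4Family, 0 < (δ₁E F)) (hB₁E : ∀ F : T4Family, 0 < (B₁E F))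
    (hE : ∀ F : T4Family, ∀ (x : MemberY (stage3OfFamily F).d₆ (stage3OfFamily F).ℓ₆ (stage3OfFamily F).hd' (stage3OfFamily F).hL' (stage3OfFamily F).b₀ (stage3OfFamily F).b₁ (Mstar F)), ((Mstar F) : ℝ) ≤ (geo9Y x).M → ∀ (α₀ : ℝ), 0 < α₀ → (geo9Y x).M * α₀ ≤ (a₀E F) → ∀ U : (bg9YR (Matrix (Fin 2) (Fin 2) ℂ) (specialUnitaryUnits (Fin 2)) (R₁ F) (R₂ F) x).Cfg, (bg9YR (Matrix (Fin 2) (Fin 2) ℂ) (specialUnitaryUnits (Fin 2)) (R₁ F) (R₂ F) x).Reg335 (c F) α₀ U → (bg9YR (Matrix (Fin 2) (Fin 2) ℂ) (specialUnitaryUnits (Fin 2)) (R₁ F) (R₂ F) x).Reg336 (c F) α₀ U → givenBy3185stY x (lettersYOfRecordV4P 2 (stage3OfFamily F) (Mstar F) (𝔯 F) x) (sectEStYOfRecordV7 2 (stage3OfFamily F) (Mstar F) (𝔢₀ F) x) U ∧ hasRWExpCY ((𝔴 F) x) U (δ₁E F) ∧ DecayMidOnStY x (lettersYOfRecordV4P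 2 (stage3OfFamily F) (Mstar F) (𝔯 F) x) (sectEStYOfRecordV7 2 (stage3OfFamily F) (Mstar F) (𝔢₀ F) x) (B₁E F) U (δ₁E F)) (τS δP Bx13₀ : ∀ F : T4Family, ℝ) (hτS : ∀ F : T4Family, 0 < (τS F)) (hBx13₀ : ∀ F : T4Family, 0 ≤ (Bx13₀ F)) (hwBx13 : ∀ F : T4Family, ∀ s, 0 < s → s < 1 → (wX F) s * (Bx13 F) s ≤ (Bx13₀ F)) (hρP12 : ∀ F : T4Family, (ρ12 F) + 2 * (σ12 F) ≤ (δP F)) (hU8a : ∀ F : T4Family, (δK12 F) + 3 * (σS F) + 4 * (τS F) ≤ (1 - 2 * (p F).α) * (p F).δ₀) (hU8b : ∀ F : T4Family, (δK12 F) + 3 * (σS F) + 4 * (τS F) ≤ min ((1 - 2 * (p F).α) * (p F).δ₀) (δ39 F) / 8) (hU8c : ∀ F : T4Family, (δK12 F) + 3 * (σS F) + 4 * (τS F) ≤ (δ₂ F)) (hU8d : ∀ F : T4Family, (δK12 F) + 3 * (σS F) + 5 * (τS F) ≤ (δ44G F)) (hU8e : ∀ F : T4Family, (δK12 F) + 3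 * (σS F) + 4 * (τS F) ≤ (δB F)) (hU8f : ∀ F : T4Family, (δK12 F) + 2 * (σS F) + (τS F) ≤ (δ43 F)) (hU8g : ∀ F : T4Family, (δK12 F) + (τS F) + (σS F) ≤ (δT12 F)) (hU8h : ∀ F : T4Family, (δK12 F) + (τS F) + (σS F) ≤ (δ12₃ F)) (hU8i : ∀ F : T4Family, (δK12 F) + (τS F) + (σS F) ≤ (δP F)) (hU8j : ∀ F : T4Family, (δP F) + 2 * (τS F) ≤ (δ12₀ F)) (hU8k : ∀ F : T4Family, (δP F) + (σS F) + 2 * (τS F) ≤ (δ12₃ F)) (ιR : ∀ F : T4Family, Type) (instN06_6 : ∀ F : T4Family, Fintype (ιR F)) (instN06_7 : ∀ F : T4Family, DecidableEq (ιR F)) (bR : ∀ F : T4Family, Module.Basis (ιR F) ℝ (Matrix (Fin 2) (Fin 2) ℂ))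
    (C38 : ∀ F : T4Family, ∀ j : (SCMemberY (stage3OfFamily F).d₆ (stage3OfFamily F).ℓ₆ (stage3OfFamily F).hd' (stage3OfFamily F).hL' (stage3OfFamily F).b₀ (stage3OfFamily F).b₁ (Mstar F)), ℝ → CfgY (Matrix (Fin 2) (Fin 2) ℂ) j.val.toKIdx → AfldY (Matrix (Fin 2) (Fin 2) ℂ) j.val.toKIdx → Prop) (instN06_8 : ∀ F : T4Family, ∀ x : MemberY (stage3OfFamily F).d₆ (stage3OfFamily F).ℓ₆ (stage3OfFamily F).hd' (stage3OfFamily F).hL' (stage3OfFamily F).b₀ (stage3OfFamily F).b₁ (Mstar F), Nonempty (geo9Y x).Site)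
    -- NODE N07's LEAF from NODE 00's `CarriersZSectE.b11Leaf_Z11OfRecord_withSectE_of_parts` at print's letters `L := F.L`, `η i := (F.P i.K).eta i.k`: the six remaining printed parts of [B11] + n16's dictionary inputs, displayed per F
    (hN07 : ∀ F : T4Family, ∃ (β : ZIdx → Type) (_ : ∀ i, Fintype (β i)) (_ : Fact (0 < (F.L : ℝ))) (_ : ∀ i : ZIdx, Fact (0 < (F.P i.K).eta i.k))
      (ζ : ResidZ F 2) (E : SectEPres F 2 (F.L : ℝ) (fun i : ZIdx => (F.P i.K).eta i.k) β ζ)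
      (βr : ∀ i, B11Prop7Assembly.Bridge ((Z11OfRecord F 2 (ζ.withSectE E)).famX i) ((Z11OfRecord F 2 (ζ.withSectE E)).famLG i)) (O₁ O₂ e₅ a : ℝ),
      0 < E.C₄ ∧ 0 < E.a₃ ∧ 0 < E.α ∧
      (∀ i, (βr i).Laws ζ.C₁ ζ.B₃) ∧ (∀ i, B11Prop7Assembly.ExistenceLeavesCap (βr i) ζ.B₀ ζ.B₃ ζ.C₁ O₁ O₂ e₅) ∧
      (∀ i, ((Z11OfRecord F 2 (ζ.withSectE E)).famX i).Laws) ∧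
      0 < ζ.B₀ ∧ 0 < ζ.B₁ ∧ 1 ≤ ζ.B₃ ∧ 1 ≤ ζ.C₁ ∧ ζ.B₀ ≤ 4 * ζ.B₁ ∧ 0 < ζ.c₁ ∧ 0 < O₁ ∧ 0 < O₂ ∧ 0 < e₅ ∧ 0 < a ∧
      (∀ (i : ZIdx) (ε₁ : ℝ) (V : ((Z11OfRecord F 2 (ζ.withSectE E)).famX i).Bdry), 0 < ε₁ → ε₁ ≤ a →
        ((Z11OfRecord F 2 (ζ.withSectE E)).famX i).Reg7 ε₁ V →
          ∃ U₀ : ((Z11OfRecord F 2 (ζ.withSectE E)).famLG i).Cfg,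
            ((Z11OfRecord F 2 (ζ.withSectE E)).famLG i).Sat14 (ζ.C₁ * ζ.B₃ * ε₁) (ζ.C₁ * ε₁) ((βr i).bdry V) U₀) ∧
      B11.Prop2Printed ζ.B₁ ζ.B₃ ζ.C₁ ζ.c₁ (Z11OfRecord F 2 (ζ.withSectE E)).famLG ∧
      B11.Prop3Printed ζ.C₁ ζ.B₃ ζ.C₂ ζ.C₃ ζ.B₀ ζ.c1h ζ.c₄ ζ.δ₀ (Z11OfRecord F 2 (ζ.withSectE E)).famLG ∧
      B11.Prop5Printed ζ.B₁ ζ.B₃ ζ.C₁ (Z11OfRecord F 2 (ζ.withSectE E)).famLG ∧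
      B11.Prop8Printed ζ.B₃ (Z11OfRecord F 2 (ζ.withSectE E)).famX ∧ B11.SectFPrinted ζ.B₃ (Z11OfRecord F 2 (ζ.withSectE E)).famX ∧
      B11.Prop9Printed ζ.B₅ ζ.C₁ ζ.β₀ ζ.δ₀ ζ.famAn)
    -- NODE N08's SLOT from dag-n08-w4's `…N08AlphaEq324RowACReMassedZSlot.printedUV3V_at_slotOfRecord_of_coreLTAtAC_of_massBoundZAE_of_consts` at `N := 2, L := F.L`: N08's (α)-AC residual (R-AC-324⁷ reading), displayed per F
    (hN08 : ∀ F : T4Family, ∃ (𝔊 : Literature.MathematicalPhysics.QuantumFieldTheory.Balaban1985CMP102.Setting.GroupModel (SU 2)) (𝔠 : Summit.QuantumFields.Balaban3D.Proofs.Primitives.AlphaConsts F.L 𝔊.N) (εbg cm : ℝ)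
      (X : ∀ S : Literature.MathematicalPhysics.QuantumFieldTheory.Balaban1985CMP102.Setting.Scales F.L, Summit.QuantumFields.Balaban3D.Proofs.StandardAC.ExternalInputsAC S (SU 2))
      (𝔖 : ∀ (S : Literature.MathematicalPhysics.QuantumFieldTheory.Balaban1985CMP102.Setting.Scales F.L) (k : ℕ), Summit.QuantumFields.Balaban3D.Carriers.StepSeries S (SU 2) ↥(Summit.QuantumFields.Balaban3D.Proofs.GroupModelLieC.lieC 𝔊) (Summit.QuantumFields.Balaban3D.Carriers.nblkOf S 𝔠.lane.carrier k) k)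
      (𝔄 : ∀ S : Literature.MathematicalPhysics.QuantumFieldTheory.Balaban1985CMP102.Setting.Scales F.L, Summit.QuantumFields.YangMills.Theorems.BalabanUVNodesN08AlphaEq324RowAC.AlphaDataLTAC 𝔊 𝔠 (X S) (𝔖 S))
      (c : ∀ (S : Literature.MathematicalPhysics.QuantumFieldTheory.Balaban1985CMP102.Setting.Scales F.L) (k : ℕ), Summit.QuantumFields.Balaban3D.Carriers.Hist S.P (k + 1) → GaugeField S.P (k + 1) (SU 2) → ℕ → ℝ),
      (∀ S, (X S).av = B10RunsOfRecord.avOfPrint 2 S) ∧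
      (∀ (S : Literature.MathematicalPhysics.QuantumFieldTheory.Balaban1985CMP102.Setting.Scales F.L) k (V : GaugeField S.P (k + 1) (SU 2)), (X S).Uk k V = B10RunsOfRecord.UkA 2 (fun S => (X S).av) S (k + 1) εbg V) ∧
      𝔠.lane.F.b₀ * (𝔠.lane.F.p₀ ^ 𝔠.lane.F.p₀ * Real.exp (1 - 𝔠.lane.F.p₀)) ≤ εbg ∧
      (∀ S : Literature.MathematicalPhysics.QuantumFieldTheory.Balaban1985CMP102.Theorems.Family F.L (Summit.QuantumFields.Balaban3D.Proofs.Constants.eps0Of 𝔠.gamma0), Summit.QuantumFields.YangMills.Theorems.BalabanUVNodesN08AlphaEq324RowAC.RunAlphaEq324CoreLTAtAC 𝔊 𝔠 (X S.1) (𝔖 S.1) (𝔄 S.1) (c S.1)) ∧ 0 ≤ cm ∧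
      (∀ S : Literature.MathematicalPhysics.QuantumFieldTheory.Balaban1985CMP102.Theorems.Family F.L (Summit.QuantumFields.Balaban3D.Proofs.Constants.eps0Of 𝔠.gamma0), ∀ k, 1 ≤ k → k ≤ S.1.K → ∀ h : Summit.QuantumFields.Balaban3D.Carriers.Hist S.1.P k, ∀ᵐ U ∂(fieldMeasure S.1.P k (SU 2)),
        Summit.QuantumFields.Balaban3D.Proofs.MassesAC.massRecAC 𝔠.lane.carrier.M₁ (Summit.QuantumFields.Balaban3D.Carriers.rcolOf S.1 𝔠.lane.carrier) (Summit.QuantumFields.Balaban3D.Carriers.eps1Of S.1 𝔠.lane.carrier) (Summit.QuantumFields.Balaban3D.Carriers.epsSOf S.1 𝔠.lane.carrier) (X S.1).av k h U ≤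
          Real.exp (cm * S.1.sites k + 𝔠.lane.carrier.dg * 𝔠.lane.carrier.c₁ *
            ∑ j ∈ Finset.range k, (Summit.QuantumFields.Balaban3D.Carriers.ZVol 𝔠.lane.carrier.M₁ (Summit.QuantumFields.Balaban3D.Carriers.rcolOf S.1 𝔠.lane.carrier) k h j : ℝ))))
    (h09 : ∀ (F : T4Family) {j : ℕ} {γ ε₀ ε₂₉ B₃ B₃' a₀ a₁ : ℝ} (hγ₀ : 0 < γ) (hγh : γ ≤ 1 / 2) (hε : 0 < ε₀) (hε' : 0 < ε₂₉) (hB : 0 ≤ B₃) (hB' : 0 ≤ B₃') (ha₀ : 0 < a₀) (ha₁ : 0 < a₁) (ha₀ρ : a₀ ≤ 1 / (109824 * (F.L : ℝ) ^ 2)) (hε₀ρ : ε₀ = a₀) {bl β' : ℝ} (hbox : BetaLowerH bl γ (betaOfRecord₁₃ F 2 (theta13OfThm1CCMWZB F 2 j γ a₀ ε₀ ε₂₉ B₃ B₃' a₀ a₁ (Efl F j γ ε₀ ε₂₉ B₃ B₃' a₀ a₁) (fun p i => Real.log (B16ZLower.zNorm (SU 2) (gOfRecord₁₃ F 2 (theta13OfThm1CCMWZB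 F 2 j γ a₀ ε₀ ε₂₉ B₃ B₃' a₀ a₁ (fun _ _ => 0) (fun _ _ => 0)) p i ^ 2) ε))))) (hbox' : BetaUpperH β' γ (betaOfRecord₁₃ F 2 (theta13OfThm1CCMWZB F 2 j γ a₀ ε₀ ε₂₉ B₃ B₃' a₀ a₁ (Efl F j γ ε₀ ε₂₉ B₃ B₃' a₀ a₁) (fun p i => Real.log (B16ZLower.zNorm (SU 2) (gOfRecord₁₃ F 2 (theta13OfThm1CCMWZB F 2 j γ a₀ ε₀ ε₂₉ B₃ B₃' a₀ a₁ (fun _ _ => 0) (fun _ _ => 0)) p i ^ 2) ε))))) (hl : -bl * γ ^ 2 ≤ 3) (hβ' : β' * γ ^ 2 ≤ 3 / 4),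
      ∃ lam12 : ResidB12 F 2 (theta13OfThm1CCMWZB F 2 j γ a₀ ε₀ ε₂₉ B₃ B₃' a₀ a₁ (Efl F j γ ε₀ ε₂₉ B₃ B₃' a₀ a₁) (fun p i => Real.log (B16ZLower.zNorm (SU 2) (gOfRecord₁₃ F 2 (theta13OfThm1CCMWZB F 2 j γ a₀ ε₀ ε₂₉ B₃ B₃' a₀ a₁ (fun _ _ => 0) (fun _ _ => 0)) p i ^ 2) ε))).τ9.M,
      ∀ P : B12.RunParams, B12Sec2to5.Lemma4Printed (F12OfRecord₁₂ F 2 (theta13OfThm1CCMWZB F 2 j γ a₀ ε₀ ε₂₉ B₃ B₃' a₀ a₁ (Efl F j γ ε₀ ε₂₉ B₃ B₃' a₀ a₁) (fun p i => Real.log (B16ZLower.zNorm (SU 2) (gOfRecord₁₃ F 2 (theta13OfThm1CCMWZB F 2 j γ a₀ ε₀ ε₂₉ B₃ B₃' a₀ a₁ (fun _ _ => 0) (fun _ _ => 0)) p i ^ 2) ε))).toStage12Params lam12 P) (lam12 P).consts)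
    (hN09T : ∀ (F : T4Family) {j : ℕ} {γ ε₀ ε₂₉ B₃ B₃' a₀ a₁ : ℝ} (hγ₀ : 0 < γ) (hγh : γ ≤ 1 / 2) (hε : 0 < ε₀) (hε' : 0 < ε₂₉) (hB : 0 ≤ B₃) (hB' : 0 ≤ B₃') (ha₀ : 0 < a₀) (ha₁ : 0 < a₁) (ha₀ρ : a₀ ≤ 1 / (109824 * (F.L : ℝ) ^ 2)) (hε₀ρ : ε₀ = a₀) {bl β' : ℝ} (hbox : BetaLowerH bl γ (betaOfRecord₁₃ F 2 (theta13OfThm1CCMWZB F 2 j γ a₀ ε₀ ε₂₉ B₃ B₃' a₀ a₁ (Efl F j γ ε₀ ε₂₉ B₃ B₃' a₀ a₁) (fun p i => Real.log (B16ZLower.zNorm (SU 2) (gOfRecord₁₃ F 2 (theta13OfThm1CCMWZB F 2 j γ a₀ ε₀ ε₂₉ B₃ B₃' a₀ a₁ (fun _ _ => 0) (fun _ _ => 0)) p i ^ 2) ε))))) (hbox' : BetaUpperH β' γ (betaOfRecord₁₃ F 2 (theta13OfThm1CCMWZB F 2 j γ a₀ ε₀ ε₂₉ B₃ B₃' a₀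 a₁ (Efl F j γ ε₀ ε₂₉ B₃ B₃' a₀ a₁) (fun p i => Real.log (B16ZLower.zNorm (SU 2) (gOfRecord₁₃ F 2 (theta13OfThm1CCMWZB F 2 j γ a₀ ε₀ ε₂₉ B₃ B₃' a₀ a₁ (fun _ _ => 0) (fun _ _ => 0)) p i ^ 2) ε))))) (hl : -bl * γ ^ 2 ≤ 3) (hβ' : β' * γ ^ 2 ≤ 3 / 4),
      ∃ cd : (P : B12.RunParams) → (i : ℕ) → ContourData (F.P P.K) i (SU 2),
        (∀ (P : B12.RunParams) (k : ℕ), k ≤ P.K → ∀ V ∈ domAltOfRecord F 2 (numerics7OfThm1CCM F.L j ε₀ B₃ B₃' a₀ a₁) P.K k, Uk F 2 P.K k a₀ V ∈ bgReg F 2 P.K k a₀) ∧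
        (∀ (P : B12.RunParams), ∀ i < P.K, ∀ W ∈ domAltOfRecord F 2 (numerics7OfThm1CCM F.L j ε₀ B₃ B₃' a₀ a₁) P.K (i + 1), AxialGauge (cd P i) (critCfgOfRecord F 2 (numerics7OfThm1CCM F.L j ε₀ B₃ B₃' a₀ a₁) P.K i W)) ∧
        (∀ (P : B12.RunParams) (k : ℕ), k ≤ P.K → ∀ V ∈ domAltOfRecord F 2 (numerics7OfThm1CCM F.L j ε₀ B₃ B₃' a₀ a₁) P.K k, ∀ i < k, AxialGauge (cd P i) (Averaging.iter (avOfRecord F 2 P.K) i (Uk F 2 P.K k a₀ V))) ∧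
        (∀ (P : B12.RunParams) (i : ℕ), i + 1 < P.K → ∀ U : GaugeField (F.P P.K) (i + 1) (SU 2), (avOfRecord F 2 P.K (i + 1)).avg U ∈ domAltOfRecord F 2 (numerics7OfThm1CCM F.L j ε₀ B₃ B₃' a₀ a₁) P.K (i + 2) →
          U ∉ regSetOfRecord F 2 P.K i (betaInputOfRecord F 2 (TβOfRecord₁₃ F 2) (chiβOfRecord₁₃ F 2 (theta13OfThm1CCMWZB F 2 j γ a₀ ε₀ ε₂₉ B₃ B₃' a₀ a₁ (Efl F j γ ε₀ ε₂₉ B₃ B₃' a₀ a₁) (fun p i => Real.log (B16ZLower.zNorm (SU 2) (gOfRecord₁₃ F 2 (theta13OfThm1CCMWZB F 2 j γ a₀ ε₀ ε₂₉ B₃ B₃' a₀ a₁ (fun _ _ => 0) (fun _ _ => 0)) p i ^ 2) ε)))) P.K (gOfRecord₁₃ F 2 (theta13OfThm1CCMWZB F 2 j γ a₀ ε₀ ε₂₉ B₃ B₃' a₀ a₁ (Efl F j γ ε₀ ε₂₉ B₃ B₃' a₀ a₁) (fun p i => Real.log (B16ZLower.zNorm (SU 2) (gOfRecord₁₃ F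 2 (theta13OfThm1CCMWZB F 2 j γ a₀ ε₀ ε₂₉ B₃ B₃' a₀ a₁ (fun _ _ => 0) (fun _ _ => 0)) p i ^ 2) ε))) P) i) ∩ domAltOfRecord F 2 (numerics7OfThm1CCM F.L j ε₀ B₃ B₃' a₀ a₁) P.K (i + 1) →
            chiβOfRecord₁₃ F 2 (theta13OfThm1CCMWZB F 2 j γ a₀ ε₀ ε₂₉ B₃ B₃' a₀ a₁ (Efl F j γ ε₀ ε₂₉ B₃ B₃' a₀ a₁) (fun p i => Real.log (B16ZLower.zNorm (SU 2) (gOfRecord₁₃ F 2 (theta13OfThm1CCMWZB F 2 j γ a₀ ε₀ ε₂₉ B₃ B₃' a₀ a₁ (fun _ _ => 0) (fun _ _ => 0)) p i ^ 2) ε))) P.K (gOfRecord₁₃ F 2 (theta13OfThm1CCMWZB F 2 j γ a₀ ε₀ ε₂₉ B₃ B₃' a₀ a₁ (Efl F j γ ε₀ ε₂₉ B₃ B₃' a₀ a₁) (fun p i => Real.log (B16ZLower.zNorm (SU 2) (gOfRecord₁₃ F 2 (theta13OfThm1CCMWZB F 2 j γ a₀ ε₀ ε₂₉ B₃ B₃'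 a₀ a₁ (fun _ _ => 0) (fun _ _ => 0)) p i ^ 2) ε))) P) (i + 1) U = 0) ∧
        (∀ (P : B12.RunParams), ∀ i < P.K, MeasureTheory.Integrable (betaInputOfRecord F 2 (TβOfRecord₁₃ F 2) (chiβOfRecord₁₃ F 2 (theta13OfThm1CCMWZB F 2 j γ a₀ ε₀ ε₂₉ B₃ B₃' a₀ a₁ (Efl F j γ ε₀ ε₂₉ B₃ B₃' a₀ a₁) (fun p i => Real.log (B16ZLower.zNorm (SU 2) (gOfRecord₁₃ F 2 (theta13OfThm1CCMWZB F 2 j γ a₀ ε₀ ε₂₉ B₃ B₃' a₀ a₁ (fun _ _ => 0) (fun _ _ => 0)) p i ^ 2) ε)))) P.K (gOfRecord₁₃ F 2 (theta13OfThm1CCMWZB F 2 j γ a₀ ε₀ ε₂₉ B₃ B₃' a₀ a₁ (Efl F j γ ε₀ ε₂₉ B₃ B₃' a₀ a₁) (fun p i => Real.log (B16ZLower.zNorm (SU 2) (gOfRecord₁₃ F 2 (theta13OfThm1CCMWZB F 2 j γ a₀ ε₀ ε₂₉ B₃ B₃' a₀ a₁ (fun _ _ => 0) (fun _ _ => 0))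 p i ^ 2) ε))) P) i) (fieldMeasure (F.P P.K) i (SU 2))) ∧
        (∀ (P : B12.RunParams) (k : ℕ), k ≤ P.K → ∀ V ∈ domAltOfRecord F 2 (numerics7OfThm1CCM F.L j ε₀ B₃ B₃' a₀ a₁) P.K k, UkExists F 2 P.K k a₀ V ∧ UniqueUkOrbit F 2 P.K k a₀ V) ∧
        (∀ (P : B12.RunParams) (k : ℕ), k ≤ P.K → HRestrict F 2 a₀ P.K k (domAltOfRecord F 2 (numerics7OfThm1CCM F.L j ε₀ B₃ B₃' a₀ a₁) P.K k)) ∧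
        (∀ (P : B12.RunParams) (k : ℕ), k ≤ P.K → ∀ V ∈ domAltOfRecord F 2 (numerics7OfThm1CCM F.L j ε₀ B₃ B₃' a₀ a₁) P.K k, ∀ i < k, UniqueUkOrbit F 2 P.K (i + 1) a₀ (Averaging.iter (avOfRecord F 2 P.K) (i + 1) (Uk F 2 P.K k a₀ V))))
    (h10 : ∀ F : T4Family, ∃ lam13 : B12.RunParams → ResidB13 (stage3OfFamily F), ∀ P : B12.RunParams, B13LeafOfRecord (stage3OfFamily F) (lam13 P))
    (h11N : ∀ (F : T4Family) {j : ℕ} {γ ε₀ ε₂₉ B₃ B₃' a₀ a₁ : ℝ} (hγ₀ : 0 < γ) (hγh : γ ≤ 1 / 2) (hε : 0 < ε₀) (hε' : 0 < ε₂₉) (hB : 0 ≤ B₃) (hB' : 0 ≤ B₃') (ha₀ : 0 < a₀) (ha₁ : 0 < a₁) (ha₀ρ : a₀ ≤ 1 / (109824 * (F.L : ℝ) ^ 2)) (hε₀ρ : ε₀ = a₀) {bl β' : ℝ} (hbox : BetaLowerH bl γ (betaOfRecord₁₃ F 2 (theta13OfThm1CCMWZB F 2 j γ a₀ ε₀ ε₂₉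 B₃ B₃' a₀ a₁ (Efl F j γ ε₀ ε₂₉ B₃ B₃' a₀ a₁) (fun p i => Real.log (B16ZLower.zNorm (SU 2) (gOfRecord₁₃ F 2 (theta13OfThm1CCMWZB F 2 j γ a₀ ε₀ ε₂₉ B₃ B₃' a₀ a₁ (fun _ _ => 0) (fun _ _ => 0)) p i ^ 2) ε))))) (hbox' : BetaUpperH β' γ (betaOfRecord₁₃ F 2 (theta13OfThm1CCMWZB F 2 j γ a₀ ε₀ ε₂₉ B₃ B₃' a₀ a₁ (Efl F j γ ε₀ ε₂₉ B₃ B₃' a₀ a₁) (fun p i => Real.log (B16ZLower.zNorm (SU 2) (gOfRecord₁₃ F 2 (theta13OfThm1CCMWZB F 2 j γ a₀ ε₀ ε₂₉ B₃ B₃' a₀ a₁ (fun _ _ => 0) (fun _ _ => 0)) p i ^ 2) ε))))) (hl : -bl * γ ^ 2 ≤ 3) (hβ' : β' * γ ^ 2 ≤ 3 / 4),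
      ∃ σ : (P : B12.RunParams) → Sect3Supplier (gaussPinH (Stage13HParams.ofHistoryBlind F 2 ⟨theta13OfThm1CCMWZB F 2 j γ a₀ ε₀ ε₂₉ B₃ B₃' a₀ a₁ (Efl F j γ ε₀ ε₂₉ B₃ B₃' a₀ a₁) (fun p i => Real.log (B16ZLower.zNorm (SU 2) (gOfRecord₁₃ F 2 (theta13OfThm1CCMWZB F 2 j γ a₀ ε₀ ε₂₉ B₃ B₃' a₀ a₁ (fun _ _ => 0) (fun _ _ => 0)) p i ^ 2) ε)), ZrOfRecord₁₃ F 2 (theta13OfThm1CCMWZB F 2 j γ a₀ ε₀ ε₂₉ B₃ B₃' a₀ a₁ (Efl F j γ ε₀ ε₂₉ B₃ B₃' a₀ a₁) (fun p i => Real.log (B16ZLower.zNorm (SU 2) (gOfRecord₁₃ F 2 (theta13OfThm1CCMWZB F 2 j γ a₀ ε₀ ε₂₉ B₃ B₃' a₀ a₁ (fun _ _ => 0) (fun _ _ => 0)) p i ^ 2) ε)))⟩)) P,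
        (∀ P : B12.RunParams, Step.InInterval γ P.K (gOfRecord₁₃ F 2 (theta13OfThm1CCMWZB F 2 j γ a₀ ε₀ ε₂₉ B₃ B₃' a₀ a₁ (Efl F j γ ε₀ ε₂₉ B₃ B₃' a₀ a₁) (fun p i => Real.log (B16ZLower.zNorm (SU 2) (gOfRecord₁₃ F 2 (theta13OfThm1CCMWZB F 2 j γ a₀ ε₀ ε₂₉ B₃ B₃' a₀ a₁ (fun _ _ => 0) (fun _ _ => 0)) p i ^ 2) ε))) P) → SupplierObligations (gaussPinH (Stage13HParams.ofHistoryBlind F 2 ⟨theta13OfThm1CCMWZB F 2 j γ a₀ ε₀ ε₂₉ B₃ B₃' a₀ a₁ (Efl F j γ ε₀ ε₂₉ B₃ B₃' a₀ a₁) (fun p i => Real.log (B16ZLower.zNorm (SU 2) (gOfRecord₁₃ F 2 (theta13OfThm1CCMWZB F 2 j γ a₀ ε₀ ε₂₉ B₃ B₃' a₀ a₁ (fun _ _ => 0) (fun _ _ => 0)) p i ^ 2) ε)), ZrOfRecord₁₃ F 2 (theta13OfThm1CCMWZB F 2 j γ a₀ ε₀ ε₂₉ B₃ B₃' a₀ a₁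 (Efl F j γ ε₀ ε₂₉ B₃ B₃' a₀ a₁) (fun p i => Real.log (B16ZLower.zNorm (SU 2) (gOfRecord₁₃ F 2 (theta13OfThm1CCMWZB F 2 j γ a₀ ε₀ ε₂₉ B₃ B₃' a₀ a₁ (fun _ _ => 0) (fun _ _ => 0)) p i ^ 2) ε)))⟩)) P (σ P)) ∧
        (∀ P : B12.RunParams, Step.InInterval γ P.K (gOfRecord₁₃ F 2 (theta13OfThm1CCMWZB F 2 j γ a₀ ε₀ ε₂₉ B₃ B₃' a₀ a₁ (Efl F j γ ε₀ ε₂₉ B₃ B₃' a₀ a₁) (fun p i => Real.log (B16ZLower.zNorm (SU 2) (gOfRecord₁₃ F 2 (theta13OfThm1CCMWZB F 2 j γ a₀ ε₀ ε₂₉ B₃ B₃' a₀ a₁ (fun _ _ => 0) (fun _ _ => 0)) p i ^ 2) ε))) P) → OperandRowsAlongChain (gaussPinH (Stage13HParams.ofHistoryBlind F 2 ⟨theta13OfThm1CCMWZB F 2 j γ a₀ ε₀ ε₂₉ B₃ B₃' a₀ a₁ (Efl F j γ ε₀ ε₂₉ B₃ B₃' a₀ a₁) (fun p i => Real.log (B16ZLower.zNorm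 (SU 2) (gOfRecord₁₃ F 2 (theta13OfThm1CCMWZB F 2 j γ a₀ ε₀ ε₂₉ B₃ B₃' a₀ a₁ (fun _ _ => 0) (fun _ _ => 0)) p i ^ 2) ε)), ZrOfRecord₁₃ F 2 (theta13OfThm1CCMWZB F 2 j γ a₀ ε₀ ε₂₉ B₃ B₃' a₀ a₁ (Efl F j γ ε₀ ε₂₉ B₃ B₃' a₀ a₁) (fun p i => Real.log (B16ZLower.zNorm (SU 2) (gOfRecord₁₃ F 2 (theta13OfThm1CCMWZB F 2 j γ a₀ ε₀ ε₂₉ B₃ B₃' a₀ a₁ (fun _ _ => 0) (fun _ _ => 0)) p i ^ 2) ε)))⟩)) P (σ P)))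
    (hEfl : ∀ (F : T4Family) (j : ℕ) (γ ε₀ ε₂₉ B₃ B₃' a₀ a₁ : ℝ), ∃ CE : ℝ, 0 ≤ CE ∧ ∀ (P : B12.RunParams) (i : ℕ), i < P.K → |Efl F j γ ε₀ ε₂₉ B₃ B₃' a₀ a₁ P i| ≤ CE * sitesCard (F.P P.K) (i + 1))
    (h13pos : ∀ (F : T4Family) {j : ℕ} {γ ε₀ ε₂₉ B₃ B₃' a₀ a₁ : ℝ} (hγ₀ : 0 < γ) (hγh : γ ≤ 1 / 2) (hε : 0 < ε₀) (hε' : 0 < ε₂₉) (hB : 0 ≤ B₃) (hB' : 0 ≤ B₃') (ha₀ : 0 < a₀) (ha₁ : 0 < a₁) (ha₀ρ : a₀ ≤ 1 / (109824 * (F.L : ℝ) ^ 2)) (hε₀ρ : ε₀ = a₀) {bl β' : ℝ} (hbox : BetaLowerH bl γ (betaOfRecord₁₃ F 2 (theta13OfThm1CCMWZB F 2 j γ a₀ ε₀ ε₂₉ B₃ B₃' a₀ a₁ (Efl F j γ ε₀ ε₂₉ B₃ B₃' a₀ a₁) (fun p i => Real.log (B16ZLower.zNorm (SU 2) (gOfRecord₁₃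 F 2 (theta13OfThm1CCMWZB F 2 j γ a₀ ε₀ ε₂₉ B₃ B₃' a₀ a₁ (fun _ _ => 0) (fun _ _ => 0)) p i ^ 2) ε))))) (hbox' : BetaUpperH β' γ (betaOfRecord₁₃ F 2 (theta13OfThm1CCMWZB F 2 j γ a₀ ε₀ ε₂₉ B₃ B₃' a₀ a₁ (Efl F j γ ε₀ ε₂₉ B₃ B₃' a₀ a₁) (fun p i => Real.log (B16ZLower.zNorm (SU 2) (gOfRecord₁₃ F 2 (theta13OfThm1CCMWZB F 2 j γ a₀ ε₀ ε₂₉ B₃ B₃' a₀ a₁ (fun _ _ => 0) (fun _ _ => 0)) p i ^ 2) ε))))) (hl : -bl * γ ^ 2 ≤ 3) (hβ' : β' * γ ^ 2 ≤ 3 / 4)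
      (hP : (gaussPinH (Stage13HParams.ofHistoryBlind F 2 ⟨theta13OfThm1CCMWZB F 2 j γ a₀ ε₀ ε₂₉ B₃ B₃' a₀ a₁ (Efl F j γ ε₀ ε₂₉ B₃ B₃' a₀ a₁) (fun p i => Real.log (B16ZLower.zNorm (SU 2) (gOfRecord₁₃ F 2 (theta13OfThm1CCMWZB F 2 j γ a₀ ε₀ ε₂₉ B₃ B₃' a₀ a₁ (fun _ _ => 0) (fun _ _ => 0)) p i ^ 2) ε)), ZrOfRecord₁₃ F 2 (theta13OfThm1CCMWZB F 2 j γ a₀ ε₀ ε₂₉ B₃ B₃' a₀ a₁ (Efl F j γ ε₀ ε₂₉ B₃ B₃' a₀ a₁) (fun p i => Real.log (B16ZLower.zNorm (SU 2) (gOfRecord₁₃ F 2 (theta13OfThm1CCMWZB F 2 j γ a₀ ε₀ ε₂₉ B₃ B₃' a₀ a₁ (fun _ _ => 0) (fun _ _ => 0)) p i ^ 2) ε)))⟩)).Provisos₁₃SepCoPH F 2),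
      ∃ γ₁₃ : ℝ, 0 < γ₁₃ ∧ ∃ em ep : ℝ → ℝ,
        (∀ P : B12.RunParams, ((datumOfRecord₁₃SepCoPH F 2 (gaussPinH (Stage13HParams.ofHistoryBlind F 2 ⟨theta13OfThm1CCMWZB F 2 j γ a₀ ε₀ ε₂₉ B₃ B₃' a₀ a₁ (Efl F j γ ε₀ ε₂₉ B₃ B₃' a₀ a₁) (fun p i => Real.log (B16ZLower.zNorm (SU 2) (gOfRecord₁₃ F 2 (theta13OfThm1CCMWZB F 2 j γ a₀ ε₀ ε₂₉ B₃ B₃' a₀ a₁ (fun _ _ => 0) (fun _ _ => 0)) p i ^ 2) ε)), ZrOfRecord₁₃ F 2 (theta13OfThm1CCMWZB F 2 j γ a₀ ε₀ ε₂₉ B₃ B₃' a₀ a₁ (Efl F j γ ε₀ ε₂₉ B₃ B₃' a₀ a₁) (fun p i => Real.log (B16ZLower.zNorm (SU 2) (gOfRecord₁₃ F 2 (theta13OfThm1CCMWZB F 2 j γ a₀ ε₀ ε₂₉ B₃ B₃' a₀ a₁ (fun _ _ => 0) (fun _ _ => 0)) p i ^ 2) ε)))⟩)) hP).C P).flow.InInterval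 γ₁₃ P.K → ∀ k, k + 1 ≤ P.K → SLaw₁₃CoPH F 2 (gaussPinH (Stage13HParams.ofHistoryBlind F 2 ⟨theta13OfThm1CCMWZB F 2 j γ a₀ ε₀ ε₂₉ B₃ B₃' a₀ a₁ (Efl F j γ ε₀ ε₂₉ B₃ B₃' a₀ a₁) (fun p i => Real.log (B16ZLower.zNorm (SU 2) (gOfRecord₁₃ F 2 (theta13OfThm1CCMWZB F 2 j γ a₀ ε₀ ε₂₉ B₃ B₃' a₀ a₁ (fun _ _ => 0) (fun _ _ => 0)) p i ^ 2) ε)), ZrOfRecord₁₃ F 2 (theta13OfThm1CCMWZB F 2 j γ a₀ ε₀ ε₂₉ B₃ B₃' a₀ a₁ (Efl F j γ ε₀ ε₂₉ B₃ B₃' a₀ a₁) (fun p i => Real.log (B16ZLower.zNorm (SU 2) (gOfRecord₁₃ F 2 (theta13OfThm1CCMWZB F 2 j γ a₀ ε₀ ε₂₉ B₃ B₃' a₀ a₁ (fun _ _ => 0) (fun _ _ => 0)) p i ^ 2) ε)))⟩)) P (k + 1) →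
      ∀ᵐ U ∂(fieldMeasure (F.P P.K) (k + 1) (SU 2)),
        chiβOfRecord₁₃ F 2 (theta13OfThm1CCMWZB F 2 j γ a₀ ε₀ ε₂₉ B₃ B₃' a₀ a₁ (Efl F j γ ε₀ ε₂₉ B₃ B₃' a₀ a₁) (fun p i => Real.log (B16ZLower.zNorm (SU 2) (gOfRecord₁₃ F 2 (theta13OfThm1CCMWZB F 2 j γ a₀ ε₀ ε₂₉ B₃ B₃' a₀ a₁ (fun _ _ => 0) (fun _ _ => 0)) p i ^ 2) ε))) P.K (gOfRecord₁₃ F 2 (theta13OfThm1CCMWZB F 2 j γ a₀ ε₀ ε₂₉ B₃ B₃' a₀ a₁ (Efl F j γ ε₀ ε₂₉ B₃ B₃' a₀ a₁) (fun p i => Real.log (B16ZLower.zNorm (SU 2) (gOfRecord₁₃ F 2 (theta13OfThm1CCMWZB F 2 j γ a₀ ε₀ ε₂₉ B₃ B₃' a₀ a₁ (fun _ _ => 0) (fun _ _ => 0)) p i ^ 2) ε))) P) (k + 1) U *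
              Real.exp (-(1 / (gOfRecord₁₃ F 2 (theta13OfThm1CCMWZB F 2 j γ a₀ ε₀ ε₂₉ B₃ B₃' a₀ a₁ (Efl F j γ ε₀ ε₂₉ B₃ B₃' a₀ a₁) (fun p i => Real.log (B16ZLower.zNorm (SU 2) (gOfRecord₁₃ F 2 (theta13OfThm1CCMWZB F 2 j γ a₀ ε₀ ε₂₉ B₃ B₃' a₀ a₁ (fun _ _ => 0) (fun _ _ => 0)) p i ^ 2) ε))) P (k + 1)) ^ 2 * wilsonBGOfRecord F 2 (theta13OfThm1CCMWZB F 2 j γ a₀ ε₀ ε₂₉ B₃ B₃' a₀ a₁ (Efl F j γ ε₀ ε₂₉ B₃ B₃' a₀ a₁) (fun p i => Real.log (B16ZLower.zNorm (SU 2) (gOfRecord₁₃ F 2 (theta13OfThm1CCMWZB F 2 j γ a₀ ε₀ ε₂₉ B₃ B₃' a₀ a₁ (fun _ _ => 0) (fun _ _ => 0)) p i ^ 2) ε))).εbg P (k + 1) U)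
                - em (gOfRecord₁₃ F 2 (theta13OfThm1CCMWZB F 2 j γ a₀ ε₀ ε₂₉ B₃ B₃' a₀ a₁ (Efl F j γ ε₀ ε₂₉ B₃ B₃' a₀ a₁) (fun p i => Real.log (B16ZLower.zNorm (SU 2) (gOfRecord₁₃ F 2 (theta13OfThm1CCMWZB F 2 j γ a₀ ε₀ ε₂₉ B₃ B₃' a₀ a₁ (fun _ _ => 0) (fun _ _ => 0)) p i ^ 2) ε))) P (k + 1)) * (Fintype.card (Literature.MathematicalPhysics.QuantumFieldTheory.Balaban1983to89.Site (F.P P.K) (k + 1)) : ℝ)) ≤ densOfRecord₁₃ F 2 (theta13OfThm1CCMWZB F 2 j γ a₀ ε₀ ε₂₉ B₃ B₃' a₀ a₁ (Efl F j γ ε₀ ε₂₉ B₃ B₃' a₀ a₁) (fun p i => Real.log (B16ZLower.zNorm (SU 2) (gOfRecord₁₃ F 2 (theta13OfThm1CCMWZB F 2 j γ a₀ ε₀ ε₂₉ B₃ B₃' a₀ a₁ (fun _ _ => 0) (fun _ _ => 0)) p i ^ 2) ε))) P (k + 1) U ∧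
          densOfRecord₁₃ F 2 (theta13OfThm1CCMWZB F 2 j γ a₀ ε₀ ε₂₉ B₃ B₃' a₀ a₁ (Efl F j γ ε₀ ε₂₉ B₃ B₃' a₀ a₁) (fun p i => Real.log (B16ZLower.zNorm (SU 2) (gOfRecord₁₃ F 2 (theta13OfThm1CCMWZB F 2 j γ a₀ ε₀ ε₂₉ B₃ B₃' a₀ a₁ (fun _ _ => 0) (fun _ _ => 0)) p i ^ 2) ε))) P (k + 1) U ≤ Real.exp (ep (gOfRecord₁₃ F 2 (theta13OfThm1CCMWZB F 2 j γ a₀ ε₀ ε₂₉ B₃ B₃' a₀ a₁ (Efl F j γ ε₀ ε₂₉ B₃ B₃' a₀ a₁) (fun p i => Real.log (B16ZLower.zNorm (SU 2) (gOfRecord₁₃ F 2 (theta13OfThm1CCMWZB F 2 j γ a₀ ε₀ ε₂₉ B₃ B₃' a₀ a₁ (fun _ _ => 0) (fun _ _ => 0)) p i ^ 2) ε))) P (k + 1)) * (Fintype.card (Literature.MathematicalPhysics.QuantumFieldTheory.Balaban1983to89.Site (F.P P.K) (k + 1)) : ℝ))))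
    (hrowsR : ∀ (F : T4Family) {j : ℕ} {γ ε₀ ε₂₉ B₃ B₃' a₀ a₁ : ℝ} (hγ₀ : 0 < γ) (hγh : γ ≤ 1 / 2) (hε : 0 < ε₀) (hε' : 0 < ε₂₉) (hB : 0 ≤ B₃) (hB' : 0 ≤ B₃') (ha₀ : 0 < a₀) (ha₁ : 0 < a₁) (ha₀ρ : a₀ ≤ 1 / (109824 * (F.L : ℝ) ^ 2)) (hε₀ρ : ε₀ = a₀) {bl β' : ℝ} (hbox : BetaLowerH bl γ (betaOfRecord₁₃ F 2 (theta13OfThm1CCMWZB F 2 j γ a₀ ε₀ ε₂₉ B₃ B₃' a₀ a₁ (Efl F j γ ε₀ ε₂₉ B₃ B₃' a₀ a₁) (fun p i => Real.log (B16ZLower.zNorm (SU 2) (gOfRecord₁₃ F 2 (theta13OfThm1CCMWZB F 2 j γ a₀ ε₀ ε₂₉ B₃ B₃' a₀ a₁ (fun _ _ => 0) (fun _ _ => 0)) p i ^ 2) ε))))) (hbox' : BetaUpperH β' γ (betaOfRecord₁₃ F 2 (theta13OfThm1CCMWZB F 2 j γ a₀ ε₀ ε₂₉ B₃ B₃' a₀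 a₁ (Efl F j γ ε₀ ε₂₉ B₃ B₃' a₀ a₁) (fun p i => Real.log (B16ZLower.zNorm (SU 2) (gOfRecord₁₃ F 2 (theta13OfThm1CCMWZB F 2 j γ a₀ ε₀ ε₂₉ B₃ B₃' a₀ a₁ (fun _ _ => 0) (fun _ _ => 0)) p i ^ 2) ε))))) (hl : -bl * γ ^ 2 ≤ 3) (hβ' : β' * γ ^ 2 ≤ 3 / 4),
      ∃ (b : ℕ → ℝ) (r γ₀ M : ℝ), 0 < γ₀ ∧
        (∀ (n : ℕ) (gs : ℕ → ℝ), RGEqH n (betaOfRecord₁₃ F 2 (theta13OfThm1CCMWZB F 2 j γ a₀ ε₀ ε₂₉ B₃ B₃' a₀ a₁ (Efl F j γ ε₀ ε₂₉ B₃ B₃' a₀ a₁) (fun p i => Real.log (B16ZLower.zNorm (SU 2) (gOfRecord₁₃ F 2 (theta13OfThm1CCMWZB F 2 j γ a₀ ε₀ ε₂₉ B₃ B₃' a₀ a₁ (fun _ _ => 0) (fun _ _ => 0)) p i ^ 2) ε)))) gs → Step.InInterval γ₀ n gs → ∀ k, k ≤ n → |betaOfRecord₁₃ F 2 (theta13OfThm1CCMWZB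 F 2 j γ a₀ ε₀ ε₂₉ B₃ B₃' a₀ a₁ (Efl F j γ ε₀ ε₂₉ B₃ B₃' a₀ a₁) (fun p i => Real.log (B16ZLower.zNorm (SU 2) (gOfRecord₁₃ F 2 (theta13OfThm1CCMWZB F 2 j γ a₀ ε₀ ε₂₉ B₃ B₃' a₀ a₁ (fun _ _ => 0) (fun _ _ => 0)) p i ^ 2) ε))) k (prefixOf gs k) - b k| ≤ r) ∧
        (∀ (n : ℕ) (gs : ℕ → ℝ), RGEqH n (betaOfRecord₁₃ F 2 (theta13OfThm1CCMWZB F 2 j γ a₀ ε₀ ε₂₉ B₃ B₃' a₀ a₁ (Efl F j γ ε₀ ε₂₉ B₃ B₃' a₀ a₁) (fun p i => Real.log (B16ZLower.zNorm (SU 2) (gOfRecord₁₃ F 2 (theta13OfThm1CCMWZB F 2 j γ a₀ ε₀ ε₂₉ B₃ B₃' a₀ a₁ (fun _ _ => 0) (fun _ _ => 0)) p i ^ 2) ε)))) gs → Step.InInterval γ₀ n gs → ∀ k, k ≤ n → -M ≤ ∑ j ∈ Finset.Ico k n, betaOfRecord₁₃ F 2 (theta13OfThm1CCMWZB F 2 j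 γ a₀ ε₀ ε₂₉ B₃ B₃' a₀ a₁ (Efl F j γ ε₀ ε₂₉ B₃ B₃' a₀ a₁) (fun p i => Real.log (B16ZLower.zNorm (SU 2) (gOfRecord₁₃ F 2 (theta13OfThm1CCMWZB F 2 j γ a₀ ε₀ ε₂₉ B₃ B₃' a₀ a₁ (fun _ _ => 0) (fun _ _ => 0)) p i ^ 2) ε))) j (prefixOf gs j)) ∧
        ∀ k : ℕ, ContinuousOn (fun x : ℝ => betaOfRecord₁₃ F 2 (theta13OfThm1CCMWZB F 2 j γ a₀ ε₀ ε₂₉ B₃ B₃' a₀ a₁ (Efl F j γ ε₀ ε₂₉ B₃ B₃' a₀ a₁) (fun p i => Real.log (B16ZLower.zNorm (SU 2) (gOfRecord₁₃ F 2 (theta13OfThm1CCMWZB F 2 j γ a₀ ε₀ ε₂₉ B₃ B₃' a₀ a₁ (fun _ _ => 0) (fun _ _ => 0)) p i ^ 2) ε))) k (clampPrefix (betaOfRecord₁₃ F 2 (theta13OfThm1CCMWZB F 2 j γ a₀ ε₀ ε₂₉ B₃ B₃' a₀ a₁ (Efl F j γ ε₀ ε₂₉ B₃ B₃' a₀ a₁)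 (fun p i => Real.log (B16ZLower.zNorm (SU 2) (gOfRecord₁₃ F 2 (theta13OfThm1CCMWZB F 2 j γ a₀ ε₀ ε₂₉ B₃ B₃' a₀ a₁ (fun _ _ => 0) (fun _ _ => 0)) p i ^ 2) ε)))) γ₀ k x))
          {x : ℝ | 0 < x ∧ x ≤ γ₀ ∧ ∀ j', j' ≤ k → 1 / γ₀ ^ 2 ≤ Y (betaOfRecord₁₃ F 2 (theta13OfThm1CCMWZB F 2 j γ a₀ ε₀ ε₂₉ B₃ B₃' a₀ a₁ (Efl F j γ ε₀ ε₂₉ B₃ B₃' a₀ a₁) (fun p i => Real.log (B16ZLower.zNorm (SU 2) (gOfRecord₁₃ F 2 (theta13OfThm1CCMWZB F 2 j γ a₀ ε₀ ε₂₉ B₃ B₃' a₀ a₁ (fun _ _ => 0) (fun _ _ => 0)) p i ^ 2) ε)))) γ₀ j' x}) :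
    Summit.QuantumFields.YangMills.Theses.BalabanUVNodes.StabilityBRunRowsAtRecordR13SepCoPHV := by
  -- NODE N07's leaf from its six remaining printed parts through NODE 00's Sect.-E presentation BY NAME (print's letters `L := F.L`, `η i := (F.P i.K).eta i.k`)
  have h07 : ∀ F : T4Family, ∃ ζ : ResidZ F 2, B11Leaf (Z11OfRecord F 2 ζ) := fun F => by
    obtain ⟨β, iβ, iL, iη, ζ, E, βr, O₁, O₂, e₅, a, hC₄, ha₃, hα, laws, leaves, plaws, hB₀, hB₁, hB₃, hC₁, hB₀B₁, hc₁, hO₁, hO₂, he₅, ha, hbg,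
      p2, p3, p5, p8, sF, p9⟩ := hN07 F
    exact ⟨ζ.withSectE E, b11Leaf_Z11OfRecord_withSectE_of_parts ζ E hC₄ ha₃ hα βr laws leaves plaws hB₀ hB₁ hB₃ hC₁ hB₀B₁ hc₁ hO₁ hO₂ he₅ ha hbg p2 p3 p5 p8 sF p9⟩
  -- NODE N08's slot from its (α)-AC residual through dag-n08-w4's slot theorem BY NAME (`N := 2`, `L := F.L`)
  have h08 : ∀ F : T4Family, PrintedUV3V 2 F.L := fun F => by
    obtain ⟨𝔊, 𝔠, εbg, cm, X, 𝔖, 𝔄, c, hav, hUk, hε, R, hcm, hmass⟩ := hN08 F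
    exact Summit.QuantumFields.YangMills.Theorems.BalabanUVNodesN08AlphaEq324RowACReMassedZSlot.printedUV3V_at_slotOfRecord_of_coreLTAtAC_of_massBoundZAE_of_consts (𝔄 := 𝔄) (c := c) hav hUk hε R hcm hmass
  -- NODE N06's leaf at every door, TYPED AT N06's OBJECT OF RECORD (edition 2), from dag-n06-d's certificate BY NAME at the door witness's Stage-11 view (its Stage-3 dictionary IS `stage3OfFamily F`, `rfl`; its run-indexed weight binder is not read)
  have h06 : ∀ (F : T4Family) {j : ℕ} {γ ε₀ ε₂₉ B₃ B₃' a₀ a₁ : ℝ}, 0 < γ → γ ≤ 1 / 2 → 0 < ε₀ → 0 < ε₂₉ → 0 ≤ B₃ → 0 ≤ B₃' → 0 < a₀ → 0 < a₁ →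
      B9LeafX (Y9OfRecordUPb (J := SCMemberY (stage3OfFamily F).d₆ (stage3OfFamily F).ℓ₆ (stage3OfFamily F).hd' (stage3OfFamily F).hL' (stage3OfFamily F).b₀ (stage3OfFamily F).b₁ (Mstar F)) 2 (stage3OfFamily F) (Mstar F) (opsYNuStOfRecordV4PE 2 (stage3OfFamily F) (Mstar F) (𝔯 F) (sectEStYOfRecordV7 2 (stage3OfFamily F) (Mstar F) (𝔢₀ F)) (𝔴 F) (𝔈 F)) SCMemberY.val (bR F) SCMemberY.ιBsc (C38 F)) := by
    intro F j γ ε₀ ε₂₉ B₃ B₃' a₀ a₁ dγ₀ dγh dε dε' dB dB' da₀ da₁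
    exact @b9LeafXUR_opsYNuOfRecordV6E_pairVH 2 _ F ((theta13OfThm1CCMWZB F 2 j γ a₀ ε₀ ε₂₉ B₃ B₃' a₀ a₁ (Efl F j γ ε₀ ε₂₉ B₃ B₃' a₀ a₁) (fun p i => Real.log (B16ZLower.zNorm (SU 2) (gOfRecord₁₃ F 2 (theta13OfThm1CCMWZB F 2 j γ a₀ ε₀ ε₂₉ B₃ B₃' a₀ a₁ (fun _ _ => 0) (fun _ _ => 0)) p i ^ 2) ε))).toStage12Params.toStage11 F 2 ⟨0, 0, 0⟩) ((admissible_theta13OfThm1CCMWZB_of_le_half F 2 (Efl F j γ ε₀ ε₂₉ B₃ B₃' a₀ a₁) (fun p i => Real.log (B16ZLower.zNorm (SU 2) (gOfRecord₁₃ F 2 (theta13OfThm1CCMWZB F 2 j γ a₀ ε₀ ε₂₉ B₃ B₃' a₀ a₁ (fun _ _ => 0) (fun _ _ => 0)) p i ^ 2) ε)) (j := j) dγ₀ dγh da₀ dε dε' dB dB' da₀ da₁).toStage12.toStage11 ⟨0, 0, 0⟩) (Mstar F) (𝔯 F) (𝔢₀ F) (𝔴 F) (𝔈 F) (𝔈₀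 F) (R₁ F) (R₂ F) (c F) (hcB F) (hc F) (hGR F) (hRP1 F) (hRP2 F) (hP1 F) (hP2 F) (instN06_1 F) (instN06_2 F) (instN06_3 F) (bI F) (hbI F) (α' F) (r39 F) (δ39 F) (B39 F) (a39 F) (M39 F) (hα'0 F) (hα'1 F) (hr39 F) (hrδ39 F) (hB39 F) (ha39 F) (hM39 F) (h348 F) (ιA F) (AA F) (instN06_4 F) (instN06_5 F) (p F) (q F) (hp F) (hq F) (hα3 F) (p3 F) (q3 F) (hp3 F) (hq3 F) (pM F) (qM F) (hpM F) (hqM F) (H F) (hM₀ F) (hM₀' F) (hM₀B F) (𝔭 F) (h𝔭 F) (bHX F) (hbHX F) (SH F) (S3 F) (SI F) (h36 F) (h36H F) (bHXT F) (hbHXT F) (hopI F) (hM1mix F) (ha1mix F) (hBMmix F) (hδmix F) (hM1fac F) (ha1fac F) (hδfac F) (hθfac F) (hcntH F) (hcnt3 F) (hcntI F) (hMw F) (hNMw F) (hM3 F) (hρ3 F) (hNc F) (hN' F) (hCℓ F) (hKc F) (hθ₀ F) (𝔬A F) (rdA F) (𝔭A F) (h𝔭A F) (𝔡A F) (𝔩A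 F) (bHXA F) (κA F) (SHA F) (S3A F) (SIA F) (SMA F) (S2A F) (hbHXA F) (hstA F) (hκA F) (hrdA F) (hlocA F) (h36A F) (hGsqA F) (h36HA F) (bHXTA F) (hbHXTA F) (hopIA F) (h36A2 F) (hcntHA F) (hcnt3A F) (hcntIA F) (hcntMA F) (hcnt2A F) (hblkA F) (hblkYA F) (hGcoA F) (hDcoA F) (hDscoA F) (hLcoA F) (h𝔡Ad F) (h𝔡As F) (hGsqAS F) (𝔬12 F) (h𝔬12 F) (h𝔈 F) (bH13 F) (δ12₀ F) (δK12 F) (σ12 F) (ρ12 F) (a12 F) (M12 F) (B12₃ F) (δ12₃ F) (ρ13 F) (α12 F) (ρf12 F) (hρf12 F) (hρf1 F) (hρf2 F) (hB12₃ F) (hσ12 F) (hρ12 F) (hρS12 F) (hρδ12 F) (hρ₃12 F) (ha12 F) (hM12 F) (hα12 F) (hα12' F) (hδ₃₀ F) (hδ12₀ F) (t12 F) (δT12 F) (ρS F) (σS F) (ht12 F) (hσS F) (hρST F) (hρS₀ F) (hδKS F) (hσSK F) (bXH F) (w13 F) (wX F) (hw13₀ F) (hw13₁ F) (hwX₀ F)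 (hwX₁ F) (hbH13 F) (hbXH F) (hρ13 F) (hρ13ρ F) (hσρ13 F) (B13₄ F) (Bx13 F) (Br13 F) (hB13₄ F) (hBr13 F) (hBx13 F) (tJ F) (δB F) (rT F) (ha1J F) (htJ F) (hrTP F) (hrTB F) (hδT12 F) (hδTr F) (ϑF F) (hϑF F) (sch F) (hsch0 F) (hsch1 F)
      (hschβ F) (hwsch F) (δ45 F) (hδ45 F) (BZ F) (hBZ F) (hBZge F) (hδ45le F) (hΔ2 F) (θ₂ F) (δ₂ F) (hθ₂ F) (hrT4 F) (hrT2 F) (hδ₃T F) (hδ12₃F F) (hD2sup F) (δ45Y F) (hδ45Y F) (BiY F) (hBiY F) (αW F) (σW F) (δFW F) (hαW0 F) (hαW1 F) (hσW F) (hδFW F) (hδFP F) (hbudW F) (hδ3W F) (hwschX F) (δ45W F) (hδ45W F) (B45W F) (hB45W F) (δhW F) (hδhW F) (BhW F) (hBhW F) (hB45Wge F) (hδ45Wle F) (hBhWge F) (hδhWle F) (CP F) (hCPge F) (hBxW F) (hBiYge F) (hδ45Yle F) (hrgdd13 F) (hZ F) (s44 F) (hs440 F) (hs441 F) (hws44 F)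 (δ44 F) (hδ44 F) (Bi44 F) (hBi44 F) (hB12₃d F) (hB12₃p F) (hBi44ge F) (hδ44le F) (hwX44 F) (B44G F) (δ44G F) (hB44G F) (hδ44G F) (hB44Gge F) (hδ44Gle F) (hB₃wG F) (BHG F) (hBHG F) (hwBhG F) (B43 F) (δ43 F) (hB43 F) (B₀D F) (hB₀D F) (hbudD F) (hB43ge F) (hδ43le F) (ρrg F) (hρrg0 F) (hbudrg F) (hbud43 F) (hδ₃rg F) (hB₃rg F) (E14₁ F) (E14₂ F) (T14₁ F) (T14₂ F) (X14₁ F) (M14₁ F) (X14₂ F) (M14₂ F) (diam14 F) (r14 F) (hr14 F) (near14₁ F) (first14₁ F) (chain14₁ F) (near14₂ F) (first14₂ F) (chain14₂ F) (h14₁ F) (h14₂ F) (W14₁ F) (W14₂ F) (hW14₁ F) (hW14₂ F) (hcnt14₁ F) (hcnt14₂ F) (hexp14 F) (a₀E F) (δ₁E F) (B₁E F) (ha₀E F) (hδ₁E F) (hB₁E F) (hE F) (τS F) (δP F) (Bx13₀ F) (hτS F) (hBx13₀ F) (hwBx13 F) (hρP12 F) (hU8a F) (hU8b F) (hU8c F)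 (hU8d F) (hU8e F) (hU8f F) (hU8g F) (hU8h F) (hU8i F) (hU8j F) (hU8k F) (SCMemberY (stage3OfFamily F).d₆ (stage3OfFamily F).ℓ₆ (stage3OfFamily F).hd' (stage3OfFamily F).hL' (stage3OfFamily F).b₀ (stage3OfFamily F).b₁ (Mstar F)) SCMemberY.val (ιR F) (instN06_6 F) (instN06_7 F) (bR F) SCMemberY.ιBsc (C38 F) SCMemberY.hιsc (instN06_8 F)
  refine N24_stabilityBRunRowsAtRecordR13SepCoPHV_byName_of_registeredStubsGridGZ_of_childrenSplitSlot8DoorPinnedN09Thm3InputsN11OperandRowsThm1AEPos_atGaussPinPrintedZB_pinY_of_runRowsCont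
    (fun θ₃ lam8 => ∃ (P : ℕ) (c₁ : ℝ) (ρ₀ : ℕ) (ax : ∀ i : IdxB8SubDPer θ₃ P, (famB8OfRecordPer θ₃ (lam8.cutSubBP₅κPer P M₁ R c₁ ρ₀).β (lam8.cutSubBP₅κPer P M₁ R c₁ ρ₀).len P i).Cfg → (famB8OfRecordPer θ₃ (lam8.cutSubBP₅κPer P M₁ R c₁ ρ₀).β (lam8.cutSubBP₅κPer P M₁ R c₁ ρ₀).len P i).Pert → (famB8OfRecordPer θ₃ (lam8.cutSubBP₅κPer P M₁ R c₁ ρ₀).β (lam8.cutSubBP₅κPer P M₁ R c₁ ρ₀).len P i).Pert), (0 < P ∧ M₁ * θ₃.L ∣ P) ∧ 0 < c₁ ∧ 1 ≤ ρ₀ ∧ B8LeafOfRecordSubBP₂DPerκ θ₃ P M₁ R ⟨lam8.cutSubBP₅κPer P M₁ R c₁ ρ₀, ax⟩)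
    ε hεz Efl h1G3 h3 (fun F {j} {γ} {ε₀} {ε₂₉} {B₃} {B₃'} {a₀} {a₁} hγ₀ hγh hε hε' hB hB' ha₀ ha₁ ha₀ρ hε₀ρ {bl} {β'} hbox hbox' hl hβ' => ?_)
    (fun F {j} {γ} {ε₀} {ε₂₉} {B₃} {B₃'} {a₀} {a₁} hγ₀ hγh hε hε' hB hB' ha₀ ha₁ _ _ {bl} {β'} _ _ _ _ => ⟨_, @h06 F j γ ε₀ ε₂₉ B₃ B₃' a₀ a₁ hγ₀ hγh hε hε' hB hB' ha₀ ha₁⟩) h07 h08 h09 hN09T (fun F {j} {γ} {ε₀} {ε₂₉} {B₃} {B₃'} {a₀} {a₁} _ _ _ _ _ _ _ _ _ _ {bl} {β'} _ _ _ _ => h10 F) h11N hEfl h13pos hrowsR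
  -- the Stage-3 view of the printed-z member IS the family dictionary (`rfl`); ζ-L's door at `stage3OfFamily F`
  haveI : FiniteDimensional ℝ (stage3OfFamily F).𝔸 :=
    -- RE-KEY-NEUTRAL (director-ym №262, FLAG №14 T0 (β)): the by-name lemma of `Node00/Record12NumericsFamilyFiniteDim` (p692370), any `(stage3OfFamily F).𝔸`.
    Literature.MathematicalPhysics.QuantumFieldTheory.Balaban1983to89.Node00.finiteDimensional_𝔸_stage3OfFamily F
  -- print's trace state on the record algebra `(stage3OfFamily F).𝔸 = M₂(ℂ)` BY NAME (NODE 00 `Record12NumericsFamilyTraceState`): `τ := tr`, `C_τ := 2`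
  obtain ⟨τ, Cτ, hτp, hτt, hτs, hCτ⟩ := Literature.MathematicalPhysics.QuantumFieldTheory.Balaban1983to89.Node00.exists_traceState_stage3OfFamily F
  obtain ⟨β, len, B₀'H, B₂', BG, BR, cL, hβ, hlen, hB₀'H, hB₂', hBG, hBR, hcL, hLet, SLetUB⟩ := hN06 F
  -- dag-n06-b's theorem is UNIFORM in the base letters `ops₀` and the block parameter `M`: chosen here (`ops₀ := 0`, `M := 1`), off the display
  let ops₀ : ℝ → ZdIdx (stage3OfFamily F).D (stage3OfFamily F).L → ℕ → OpsZd (stage3OfFamily F).D (stage3OfFamily F).𝔸 :=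
    fun _ _ _ => ⟨fun _ _ _ _ => 0, fun _ _ _ _ => 0, fun _ _ _ _ => 0, fun _ _ _ _ => 0⟩
  haveI : NeZero (M₁ * (stage3OfFamily F).L) := ⟨Nat.pos_iff_ne_zero.mp (Nat.mul_pos hM₁ (by have := F.hL11; show 0 < F.L; omega))⟩
  -- N06's five binders with ONE constant set over all members, from dag-n06-b's η-free ∃∀ theorem (road (i): the η-scaling of the record)
  obtain ⟨aI, haI, aT, haT, B₀, hB₀, Cβ, hCβ, cS, hcS, cSβ, hcSβ, hB⟩ :=
    Literature.MathematicalPhysics.QuantumFieldTheory.Balaban1983to89.B9Thm33BindersUniformZdPerNestedEta.IdxB8SubDPerκ.binders_uniform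
      (P := M₁ * (stage3OfFamily F).L) (Mκ := M₁) (Rκ := R) τ hτp hτt hτs (by show 2 ≤ 4; norm_num) hCτ ops₀ 1 hβ hlen
  -- ζ-L's door with `a_S := a_T`, `C_β ↦ max C_β 1` (dag-n05-d's two glue lines), the Hölder binder weakened by `holderAtIH2Per_anti`
  exact exists_residB8_slot8κ'_of_bindersLettersPer_doorL (stage3OfFamily F) (by show 2 ≤ 4; norm_num) (by have := F.hL11; show 5 ≤ F.L; omega) M₁ R hM₁
    τ hτp hτt hτs hCτ ops₀ le_rfl haI haT haT hB₀ (lt_max_of_lt_right one_pos) hcS hcSβ hB₀'H hB₂' hBG hBR hcL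
    (fun a m hm => (hB a m hm).1) (fun a m hm => (hB a m hm).2.1) (fun a m hm => holderAtIH2Per_anti (ha := le_rfl) (hC := le_max_left Cβ 1) (h := (hB a m hm).2.2.1))
    (fun a m hm => (hB a m hm).2.2.2.1) (fun a m hm => (hB a m hm).2.2.2.2) hLet SLetUB

end Summit.QuantumFields.YangMills.BalabanUVNodes.N24K1FaceTrN06VHSCN07N08N09T5JunctionLSlot8KappaPrimeAtGaussPinPrintedZBY

end
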